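import Literature.NumberTheory.Sieve.QuadraticRootCountLogSums
import Literature.NumberTheory.Sieve.SieveFrameworkFundamentalLemma
import Literature.NumberTheory.Sieve.LiouvillePolynomialValuesReducibleProofs
import HarnessLib

/-!
# Property S for quadratic polynomials from type-I information

Topic `Literature/NumberTheory/Sieve`; companion of `LiouvillePolynomialValues*.lean`
(Teräväinen 2024, Def. 2.9 / Prop. 2.11: every `P ∈ ℤ[X]` of degree `2` with positive leading
coefficient has property S — `#{n ≤ x : n ≡ b (q), P(n) is n-smooth} ≥ ηx` for all
`η < η₀(P)/q`).  The reducible case is PROVED in the tree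
(`teravainen2024_prop_2_11_quadratic_of_irreducible`); this file PROVES the irreducible case
CONDITIONALLY on plain **type-I information** for the congruence counts of `P` —
`teravainen2024_prop_2_11_quadratic_of_typeI`, `PropertySTypeI.hasPropertyS_of_typeI`,
`PropertySTypeI.dyadic_lower_bound` — namely: for every `q ≥ 1`, `b₀`, and every modulus `Q ≠ 0`
containing the primes of `q`, there are `K, y₀` with
`|∑_{N₁<n≤N₂, ℓ∣n, (n,Q)=1} (#{y<t≤2y : t ≡ b₀ (q), n ∣ P(t)} − (y/q)ρ_P(n)/n)| ≤ K y^{1−ε₀}`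
for `y ≥ y₀`, all levels `1 ≤ ℓ ≤ y^θ` and `N₁ ≤ N₂ ≤ y^{1+θ}` (some fixed `θ, ε₀ > 0`).  This is
what Hooley's method (equidistribution of the roots of `P` to moduli in a residue class — the
tree's `RootForms.sum_weylSum_eq_sum_levelForms`, DFI §2) delivers, as opposed to the bilinear
form of Iwaniec's Proposition 1 assumed in `LiouvillePolynomialValuesLevelProofs.lean`; the
constant `η₀` is uniform in `q` as Definition 2.9 requires.

**The argument** (`PropertySTypeI`, Part II).  Write `P = g·G`, `G = aX² + bX + c` primitive
irreducible, `a > 0` (`exists_primitive_data`).  A value `P(t)`, `y < t ≤ 2y`, is certified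
`t`-smooth by a factorisation `p₁ m ∣ P(t)` with a prime `y^κ < p₁ ≤ y^{2κ}` and a cofactor
`2A₀y/p₁ < m ≤ y` (`smooth_of_certificate`; multiplicity `≤ ⌈2/κ⌉ 2^{⌈2/η⌉}` when `m` is
`y^η`-rough, `sum_sum_card_le_mul_card_good`).  For each `p₁` the `y^η`-rough `m` prime to the
bad modulus `Q = rad(2agΔE₁q)` are counted from below by the fundamental lemma of the `β`-sieve
(the tree's `SieveSequence.fundamental_lemma_explicit`) applied to `a_m = #{t : p₁m ∣ P(t)}`
(`mSeq`, `sieve_step`), whose remainders split into a type-I remainder (the hypothesis), a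
`p₁`-shift term and a main-term window error (Part I below); the density is
`g(p) = ρ_G(p)/(p − 1 + ρ_G(p))` off `Q` (dimension `1` with a constant independent of `Q`,
`exists_hasSieveDimension`), and the main-term constant `𝔠 = L(1,χ_Δ) F_Q Z_Q` satisfies
`F_Q V_Q(z) ≥ ∏_{p<z}(1 − 1/p)(1 − χ(p)/p) ≥ c₀(G)/log z` UNIFORMLY in `Q` (`W_le_F_mul_V`,
`exists_W_lower`, through an odd-constant-term variant `G'` of `G`, `exists_odd_variant`, and the
tree's Mertens bound `prod_inv_one_sub_rhoG_div_le`), which is where the uniformity in `q` comes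
from.  `dyadic_core` is the inequality at one height with every largeness condition explicit;
`dyadic_lower_bound` chooses `κ = min(min(θ,ε₀)/8, 1/32)`, `δ = κ/2`, `z = y^η`, `D = y^δ`.

**Inputs from `QuadraticRootCountLogSums.lean`** (`RhoLogSums`, PROVED there): the level
of distribution of `ρ_G` on the integers prime to `Q` (`abs_rhoSum_sub_main_le`), its
logarithmic-window form `abs_rhoLogSum_sub_le`, the `p₁`-shift `abs_rhoLogSum_prime_mul_sub_le`,
the density `rhoDensity` and `const_pos` (`𝔠 = L(1,χ_Δ) F_Q Z_Q > 0`).  Everything here is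
PROVED; no named fact is introduced; the only defs are data (`cMain`, `kWin`, `mSeq`, `badMod`,
`primesIoc`).

## References

* J. Teräväinen, *On the Liouville function at polynomial arguments*, Amer. J. Math. 146 (2024)
  1115–1167, Definition 2.9, Proposition 2.11 and §7. [cite: Teravainen2024, Proposition 2.11]
* C. Hooley, *On the greatest prime factor of a quadratic polynomial*, Acta Math. 117 (1967)
  281–299 (smooth/large prime factors of quadratic values via root equidistribution — the shape
  of the type-I hypothesis). [cite: Hooley1967, §§2–6]
* J. Friedlander, H. Iwaniec, *Opera de Cribro*, AMS Colloquium Publ. 57 (2010), Cor. 6.10 (the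
  fundamental lemma used, via the tree). [cite: FriedlanderIwaniecOpera2010, Cor. 6.10]
* H. Halberstam, H.-E. Richert, *Sieve Methods* (1974), Ch. 1–2 (densities, dimension).
-/

noncomputable section

open Finset Real

namespace Literature.NumberTheory.Sieve

open RhoLogSums

namespace PropertySTypeI

open Polynomial Finset

/-! ### E2-A. Certificates of smoothness and their multiplicity -/

/-- **The certificate**: if `P(t) > 0`, `p₁ m ∣ P(t)` with `p₁ ≤ t`, `1 ≤ m ≤ t` and
`P(t) ≤ p₁ m t`, then every prime factor of `P(t)` is `≤ t` (the cofactor is `≤ t`).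
[folklore] -/
theorem smooth_of_certificate {v : ℤ} (hv : 0 < v) {t p₁ m : ℕ} (hp₁t : p₁ ≤ t) (hm1 : 1 ≤ m)
    (hmt : m ≤ t) (hp₁1 : 1 ≤ p₁) (hdvd : ((p₁ * m : ℕ) : ℤ) ∣ v) (hsize : v ≤ (p₁ * m * t : ℕ)) :
    ∀ p : ℕ, p.Prime → (p : ℤ) ∣ v → p ≤ t := by
  intro p hp hpv
  obtain ⟨ℓ, hℓ⟩ := hdvd
  have hpm0 : (0 : ℤ) < (p₁ * m : ℕ) := by exact_mod_cast Nat.mul_pos (by omega) (by omega)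
  have hℓ0 : 0 < ℓ := by
    by_contra h
    push Not at h
    have : v ≤ 0 := by rw [hℓ]; exact mul_nonpos_of_nonneg_of_nonpos hpm0.le h
    omega
  have hℓt : ℓ ≤ t := by
    by_contra h
    push Not at h
    have : ((p₁ * m * t : ℕ) : ℤ) < v := by
      rw [hℓ]; push_cast
      have : ((p₁ : ℤ) * m) * t < (p₁ * m) * ℓ := by
        apply mul_lt_mul_of_pos_left h; exact_mod_cast Nat.mul_pos (by omega) (by omega)
      exact_mod_cast this
    omega
  have hpP : Prime (p : ℤ) := Nat.prime_iff_prime_int.mp hp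
  rw [hℓ] at hpv
  rcases hpP.dvd_or_dvd hpv with h1 | h2
  · push_cast at h1
    rcases hpP.dvd_or_dvd h1 with h11 | h12
    · have : p ≤ p₁ := Nat.le_of_dvd (by omega) (Int.natCast_dvd_natCast.mp h11)
      omega
    · have : p ≤ m := Nat.le_of_dvd (by omega) (Int.natCast_dvd_natCast.mp h12)
      omega
  · have : (p : ℤ) ≤ ℓ := Int.le_of_dvd hℓ0 h2
    omega

/-- **Counting rough divisors**: if every prime `< z` divides `Pz` (e.g. `Pz = P(z)`), then an
integer `0 < n < z^(J+1)` has at most `2^J` divisors prime to `Pz` (induction on `J`: split by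
divisibility by one prime `p ≥ z` of `n`). [folklore] -/
theorem card_rough_divisors_le {z Pz : ℕ} (hPz : ∀ p : ℕ, p.Prime → p < z → p ∣ Pz) :
    ∀ J n : ℕ, 0 < n → n < z ^ (J + 1) →
      ((n.divisors).filter (fun m => m.Coprime Pz)).card ≤ 2 ^ J := by
  -- a divisor prime to `Pz` has all its prime factors `≥ z`
  have hrough : ∀ m : ℕ, m.Coprime Pz → ∀ p : ℕ, p.Prime → p ∣ m → z ≤ p := by
    intro m hm p hp hpm
    by_contra h
    push Not at h
    have h1 : p ∣ Pz := hPz p hp h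
    have : p ∣ Nat.gcd m Pz := Nat.dvd_gcd hpm h1
    rw [hm] at this
    exact hp.one_lt.ne' (Nat.dvd_one.mp this)
  intro J
  induction J with
  | zero =>
      intro n hn hnz
      rw [zero_add, pow_one] at hnz
      rw [pow_zero]
      refine Finset.card_le_one.mpr fun x hx y hy => ?_
      rw [Finset.mem_filter, Nat.mem_divisors] at hx hy
      have hx1 : x = 1 := by
        by_contra hne
        obtain ⟨p, hp, hpx⟩ := Nat.exists_prime_and_dvd hne
        have := hrough x hx.2 p hp hpx
        have : p ≤ n := Nat.le_of_dvd hn (hpx.trans hx.1.1)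
        omega
      have hy1 : y = 1 := by
        by_contra hne
        obtain ⟨p, hp, hpy⟩ := Nat.exists_prime_and_dvd hne
        have := hrough y hy.2 p hp hpy
        have : p ≤ n := Nat.le_of_dvd hn (hpy.trans hy.1.1)
        omega
      rw [hx1, hy1]
  | succ J ih =>
      intro n hn hnz
      set S := (n.divisors).filter (fun m => m.Coprime Pz) with hS
      by_cases hex : ∃ m ∈ S, m ≠ 1
      · obtain ⟨m, hm, hm1⟩ := hex
        rw [hS, Finset.mem_filter, Nat.mem_divisors] at hm
        obtain ⟨p, hp, hpm⟩ := Nat.exists_prime_and_dvd hm1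
        have hzp : z ≤ p := hrough m hm.2 p hp hpm
        have hpn : p ∣ n := hpm.trans hm.1.1
        have hnp : 0 < n / p := Nat.div_pos (Nat.le_of_dvd hn hpn) hp.pos
        have hnpz : n / p < z ^ (J + 1) := by
          have h1 : n / p * p ≤ n := Nat.div_mul_le_self n p
          have h2 : n < z ^ (J + 1) * z := by rw [← pow_succ]; exact hnz
          have h3 : z ^ (J + 1) * z ≤ z ^ (J + 1) * p := Nat.mul_le_mul_left _ hzp
          by_contra h
          push Not at h
          have : z ^ (J + 1) * p ≤ n / p * p := Nat.mul_le_mul_right _ h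
          omega
        have hIH := ih (n / p) hnp hnpz
        set S' := ((n / p).divisors).filter (fun m => m.Coprime Pz) with hS'
        have hsub : S ⊆ S' ∪ S'.image (fun m => p * m) := by
          intro x hx
          rw [hS, Finset.mem_filter, Nat.mem_divisors] at hx
          rw [Finset.mem_union, Finset.mem_image]
          by_cases hpx : p ∣ x
          · right
            obtain ⟨x', rfl⟩ := hpx
            refine ⟨x', ?_, rfl⟩
            rw [hS', Finset.mem_filter, Nat.mem_divisors]
            refine ⟨⟨?_, hnp.ne'⟩, Nat.Coprime.coprime_dvd_left (dvd_mul_left x' p) hx.2⟩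
            obtain ⟨k, hk⟩ := hx.1.1
            rw [hk, mul_assoc, Nat.mul_div_cancel_left _ hp.pos]
            exact dvd_mul_right _ _
          · left
            rw [hS', Finset.mem_filter, Nat.mem_divisors]
            refine ⟨⟨?_, hnp.ne'⟩, hx.2⟩
            have hcop : x.Coprime p := Nat.Coprime.symm ((Nat.Prime.coprime_iff_not_dvd hp).mpr hpx)
            obtain ⟨k, hk⟩ := hpn
            rw [hk, Nat.mul_div_cancel_left _ hp.pos]
            have : x ∣ p * k := hk ▸ hx.1.1
            exact hcop.dvd_of_dvd_mul_left this
        calc S.card ≤ (S' ∪ S'.image (fun m => p * m)).card := Finset.card_le_card hsub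
          _ ≤ S'.card + (S'.image (fun m => p * m)).card := Finset.card_union_le _ _
          _ ≤ S'.card + S'.card := Nat.add_le_add_left (Finset.card_image_le) _
          _ ≤ 2 ^ J + 2 ^ J := by gcongr
          _ = 2 ^ (J + 1) := by ring
      · push Not at hex
        calc S.card ≤ 1 := Finset.card_le_one.mpr fun x hx y hy => by rw [hex x hx, hex y hy]
          _ ≤ 2 ^ (J + 1) := Nat.one_le_two_pow

/-- **At most `3/κ`-ish large primes**: the number of primes `p > y^κ`-type, here: the number of
elements of a set `A` of primes all `≥ L ≥ 2` dividing `n` with `0 < n < L^(J+1)` is at most `J`.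
[folklore] -/
theorem card_primes_dvd_le {L : ℕ} (hL : 2 ≤ L) (J : ℕ) {n : ℕ} (hn : 0 < n) (hnL : n < L ^ (J + 1))
    (A : Finset ℕ) (hA : ∀ p ∈ A, p.Prime ∧ L ≤ p ∧ p ∣ n) : A.card ≤ J := by
  have hprod : ∏ p ∈ A, p ∣ n :=
    Finset.prod_primes_dvd n (fun p hp => (hA p hp).1.prime) fun p hp => (hA p hp).2.2
  have hle : L ^ A.card ≤ ∏ p ∈ A, p := by
    rw [← Finset.prod_const]
    exact Finset.prod_le_prod' fun p hp => (hA p hp).2.1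
  have h1 : L ^ A.card ≤ n := hle.trans (Nat.le_of_dvd hn hprod)
  have h2 : L ^ A.card < L ^ (J + 1) := lt_of_le_of_lt h1 hnL
  have := (Nat.pow_lt_pow_iff_right (by omega)).mp h2
  omega

end PropertySTypeI


namespace PropertySTypeI

open Polynomial Finset Iwaniec1978
open scoped NumberTheorySymbols

/-! ### E2-B. From `P ∈ ℤ[X]` (irreducible over `ℚ`) to the primitive quadratic `aX² + bX + c` -/

section Setup

variable {P : ℤ[X]}

/-- A quadratic is `quadPoly` of its coefficients. [folklore] -/
theorem eq_quadPoly (hdeg : P.natDegree = 2) : P = quadPoly (P.coeff 2) (P.coeff 1) (P.coeff 0) := by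
  conv_lhs => rw [Polynomial.as_sum_range_C_mul_X_pow P, hdeg]
  simp [Finset.sum_range_succ, quadPoly]
  ring

/-- The content of a nonzero integer polynomial is positive. [folklore] -/
theorem content_pos (hP : P ≠ 0) : 0 < P.content := by
  have h0 : P.content ≠ 0 := by rwa [Ne, Polynomial.content_eq_zero_iff]
  have hn : (0 : ℤ) ≤ P.content := Int.nonneg_of_normalize_eq_self Polynomial.normalize_content
  omega

/-- A product of distinct primes is squarefree (local copy). [folklore] -/
theorem squarefree_prod_primes {T : Finset ℕ} (hT : ∀ p ∈ T, p.Prime) : Squarefree (∏ p ∈ T, p) := by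
  refine Finset.squarefree_prod_of_pairwise_isCoprime ?_ fun p hp => (hT p hp).squarefree
  intro p hp q hq hpq
  exact Nat.coprime_iff_isRelPrime.1 ((Nat.coprime_primes (hT p hp) (hT q hq)).2 hpq)

/-- The radical `rad n = ∏_{p ∣ n} p` is squarefree, and a prime divides it iff it divides `n`
(`n ≠ 0`). [folklore] -/
theorem prime_dvd_rad_iff {n : ℕ} (hn : n ≠ 0) {p : ℕ} (hp : p.Prime) :
    p ∣ ∏ r ∈ n.primeFactors, r ↔ p ∣ n := by
  constructor
  · intro h
    obtain ⟨r, hr, hpr⟩ := (Prime.dvd_finsetProd_iff hp.prime _).mp h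
    have hr' := Nat.prime_of_mem_primeFactors hr
    have : p = r := (Nat.prime_dvd_prime_iff_eq hp hr').mp hpr
    rw [this]; exact Nat.dvd_of_mem_primeFactors hr
  · intro h
    exact Finset.dvd_prod_of_mem _ (Nat.mem_primeFactors.mpr ⟨hp, h, hn⟩)

end Setup

end PropertySTypeI


namespace PropertySTypeI

open Polynomial Finset Iwaniec1978 RhoLogSums ArithmeticFunction
open scoped NumberTheorySymbols ArithmeticFunction.Moebius
open Literature.NumberTheory.LFunctions (DirichletAbel.reChar RealChar.charDivisorDensity
  RealChar.one_sub_charDivisorDensity_prime RealChar.isMultiplicative_charDivisorDensity)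

/-! ### E2-C. Primitive data; transfer of divisibility and of the root count -/

section PrimitiveData

variable {P : ℤ[X]}

/-- **From `P` to `(a, b, c; g)`**: a degree-`2` integer polynomial with positive leading
coefficient, irreducible over `ℚ`, is `g · (aX² + bX + c)` with `g = cont P > 0`, `a > 0` and
`aX² + bX + c` irreducible in `ℤ[X]` (Gauss's lemma). [folklore] -/
theorem exists_primitive_data (hdeg : P.natDegree = 2) (hlc : 0 < P.leadingCoeff)
    (hirr : Irreducible (P.map (Int.castRingHom ℚ))) :
    ∃ a b c g : ℤ, 0 < a ∧ 0 < g ∧ Irreducible (quadPoly a b c) ∧ P = C g * quadPoly a b c := by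
  have hP0 : P ≠ 0 := by rintro rfl; simp at hdeg
  have hPQ : P = C P.content * P.primPart := P.eq_C_content_mul_primPart
  have hdegQ : P.primPart.natDegree = 2 := by rw [natDegree_primPart, hdeg]
  have hg : 0 < P.content := content_pos hP0
  have hQeq : P.primPart =
      quadPoly (P.primPart.coeff 2) (P.primPart.coeff 1) (P.primPart.coeff 0) := eq_quadPoly hdegQ
  refine ⟨P.primPart.coeff 2, P.primPart.coeff 1, P.primPart.coeff 0, P.content, ?_, hg, ?_, ?_⟩
  · have hlcQ : P.primPart.leadingCoeff = P.primPart.coeff 2 := by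
      rw [Polynomial.leadingCoeff, hdegQ]
    have hlcP : P.leadingCoeff = P.content * P.primPart.leadingCoeff := by
      conv_lhs => rw [hPQ]
      rw [leadingCoeff_mul, leadingCoeff_C]
    rw [← hlcQ]
    rw [hlcP] at hlc
    exact (pos_iff_pos_of_mul_pos hlc).mp hg
  · have hprim : P.primPart.IsPrimitive := P.isPrimitive_primPart
    rw [← hQeq, hprim.irreducible_iff_irreducible_map_fraction_map (K := ℚ)]
    have hmapP : P.map (Int.castRingHom ℚ) =
        C (P.content : ℚ) * P.primPart.map (algebraMap ℤ ℚ) := by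
      conv_lhs => rw [hPQ]
      rw [Polynomial.map_mul, Polynomial.map_C, algebraMap_int_eq]
      rfl
    have hunit : IsUnit (C (P.content : ℚ)) :=
      Polynomial.isUnit_C.mpr (IsUnit.mk0 _ (by exact_mod_cast hg.ne'))
    rw [hmapP] at hirr
    exact (irreducible_isUnit_mul hunit).mp hirr
  · rw [← hQeq]; exact hPQ

/-- `n ∣ g v ↔ n ∣ v` for `(n, g) = 1`. [folklore] -/
theorem natCast_dvd_mul_iff_of_coprime {g : ℤ} {n : ℕ} (hn : n.Coprime g.natAbs) (v : ℤ) :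
    (n : ℤ) ∣ g * v ↔ (n : ℤ) ∣ v := by
  have hcop : IsCoprime (n : ℤ) g := by
    rw [Int.isCoprime_iff_gcd_eq_one, Int.gcd_eq_natAbs, Int.natAbs_natCast]
    exact hn
  exact ⟨fun h => hcop.dvd_of_dvd_mul_left h, fun h => Dvd.dvd.mul_left h g⟩

/-- The root count of a one-member family, unfolded. [folklore] -/
theorem polyRootCountMod_single (F : ℤ[X]) (n : ℕ) :
    polyRootCountMod ![F] n =
      ((Finset.range n).filter fun ν : ℕ => (n : ℤ) ∣ F.eval (ν : ℤ)).card := by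
  unfold polyRootCountMod
  congr 1
  refine Finset.filter_congr fun ν _ => ?_
  simp

/-- **`ρ_{gF}(n) = ρ_F(n)` for `(n, g) = 1`.** [folklore] -/
theorem polyRootCountMod_C_mul {g : ℤ} (F : ℤ[X]) {n : ℕ} (hn : n.Coprime g.natAbs) :
    polyRootCountMod ![C g * F] n = polyRootCountMod ![F] n := by
  rw [polyRootCountMod_single, polyRootCountMod_single]
  congr 1
  refine Finset.filter_congr fun ν _ => ?_
  rw [eval_mul, eval_C]
  exact natCast_dvd_mul_iff_of_coprime hn _

/-- `n ∣ (gF)(t) ↔ n ∣ F(t)` for `(n, g) = 1`. [folklore] -/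
theorem natCast_dvd_eval_C_mul_iff {g : ℤ} (F : ℤ[X]) {n : ℕ} (hn : n.Coprime g.natAbs) (t : ℤ) :
    (n : ℤ) ∣ (C g * F).eval t ↔ (n : ℤ) ∣ F.eval t := by
  rw [eval_mul, eval_C]
  exact natCast_dvd_mul_iff_of_coprime hn _

end PrimitiveData

/-! ### E2-D. An odd-constant-term variant with the same discriminant; the sieve dimension -/

section Variant

variable {a b c : ℤ}

/-- **Odd-constant-term variant**: for `G = aX² + bX + c` irreducible with `a > 0` one of
`G`, `G(X+1) = aX² + (2a+b)X + (a+b+c)`, `±(cX² + bX + a)` is an irreducible quadratic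
`a'X² + b'X + c'` with `a' > 0`, `c'` odd and the same discriminant. [folklore] -/
theorem exists_odd_variant (ha : 0 < a) (hirr : Irreducible (quadPoly a b c)) :
    ∃ a' b' c' : ℤ, 0 < a' ∧ Odd c' ∧ Irreducible (quadPoly a' b' c') ∧
      b' ^ 2 - 4 * a' * c' = b ^ 2 - 4 * a * c := by
  have hprim := gcd_coeffs_eq_one ha.ne' hirr
  have hroot := forall_ne_zero_of_irreducible ha.ne' hirr
  have hc0 : c ≠ 0 := by
    intro h0
    have := hroot 0
    simp [h0] at this
  rcases Int.even_or_odd c with hce | hco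
  · rcases Int.even_or_odd a with hae | hao
    · -- `a`, `c` even: `G(X + 1)`
      have hb : Odd b := by
        by_contra hb
        rw [Int.not_odd_iff_even] at hb
        obtain ⟨a', ha'⟩ := hae
        obtain ⟨b', hb'⟩ := hb
        obtain ⟨c', hc'⟩ := hce
        have h2 : (2 : ℤ) ∣ (Int.gcd (Int.gcd a b) c : ℤ) :=
          Int.dvd_coe_gcd (Int.dvd_coe_gcd ⟨a', by rw [ha']; ring⟩ ⟨b', by rw [hb']; ring⟩)
            ⟨c', by rw [hc']; ring⟩
        rw [hprim] at h2
        norm_num at h2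
      have hirr' : Irreducible (quadPoly a (2 * a + b) (a + b + c)) := by
        refine irreducible_quadPoly_of_forall_ne_zero ha.ne' ?_ fun x hx => ?_
        · refine gcd_eq_one_of_forall_dvd fun d h1 h2 h3 => dvd_one_of_gcd_eq_one hprim h1 ?_ ?_
          · have : b = (2 * a + b) - 2 * a := by ring
            rw [this]; exact dvd_sub h2 (h1.mul_left 2)
          · have hb' : d ∣ b := by
              have : b = (2 * a + b) - 2 * a := by ring
              rw [this]; exact dvd_sub h2 (h1.mul_left 2)
            have : c = (a + b + c) - a - b := by ring
            rw [this]; exact dvd_sub (dvd_sub h3 h1) hb'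
        · refine hroot (x + 1) ?_
          push_cast at hx
          linear_combination hx
      refine ⟨a, 2 * a + b, a + b + c, ha, ?_, hirr', by ring⟩
      obtain ⟨a', ha'⟩ := hae
      obtain ⟨c', hc'⟩ := hce
      obtain ⟨b', hb'⟩ := hb
      exact ⟨a' + b' + c', by rw [ha', hb', hc']; ring⟩
    · -- `a` odd, `c` even: the reversed polynomial, with positive leading coefficient
      have hrev : ∀ x : ℚ, (c : ℚ) * x ^ 2 + b * x + a ≠ 0 := by
        intro x hx
        have hx0 : x ≠ 0 := by
          rintro rfl
          simp at hx
          exact ha.ne' (by exact_mod_cast hx)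
        refine hroot x⁻¹ ?_
        field_simp
        linear_combination hx
      rcases lt_or_gt_of_ne hc0 with hneg | hpos
      · have hirr' : Irreducible (quadPoly (-c) (-b) (-a)) := by
          refine irreducible_quadPoly_of_forall_ne_zero (by omega) ?_ fun x hx => ?_
          · exact gcd_eq_one_of_forall_dvd fun d h1 h2 h3 =>
              dvd_one_of_gcd_eq_one hprim (dvd_neg.mp h3) (dvd_neg.mp h2) (dvd_neg.mp h1)
          · refine hrev x ?_
            push_cast at hx
            linear_combination -hx
        exact ⟨-c, -b, -a, by omega, hao.neg, hirr', by ring⟩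
      · have hirr' : Irreducible (quadPoly c b a) := by
          refine irreducible_quadPoly_of_forall_ne_zero hc0 ?_ hrev
          exact gcd_eq_one_of_forall_dvd fun d h1 h2 h3 => dvd_one_of_gcd_eq_one hprim h3 h2 h1
        exact ⟨c, b, a, hpos, hao, hirr', by ring⟩
  · exact ⟨a, b, c, ha, hco, hirr, rfl⟩

/-- Two irreducible quadratics with the same discriminant have the same root count at every
odd prime not dividing the leading coefficients (`ρ(p) = 1 + (Δ/p)`). [folklore] -/
theorem rhoG_eq_of_disc_eq {a' b' c' : ℤ} (ha : 0 < a) (hirr : Irreducible (quadPoly a b c))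
    (ha' : 0 < a') (hirr' : Irreducible (quadPoly a' b' c'))
    (hΔ : b' ^ 2 - 4 * a' * c' = b ^ 2 - 4 * a * c) {p : ℕ} (hp : p.Prime) (hp2 : p ≠ 2)
    (hpa : ¬ (p : ℤ) ∣ a) (hpa' : ¬ (p : ℤ) ∣ a') : rhoG a b c p = rhoG a' b' c' p := by
  have h1 := rhoG_eq_one_add_jacobiSym ha hirr hp hp2 hpa
  have h2 := rhoG_eq_one_add_jacobiSym ha' hirr' hp hp2 hpa'
  rw [hΔ] at h2
  exact_mod_cast h1.trans h2.symm

/-- `ρ_G(p) ≤ p` (trivially). [folklore] -/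
theorem rhoG_le_self (a b c : ℤ) (p : ℕ) : rhoG a b c p ≤ p := by
  unfold rhoG polyRootCountMod
  exact (Finset.card_filter_le _ _).trans (Finset.card_range p).le

/-- **Sieve dimension `1` for `g = rhoDensity a b c Q`, with a constant independent of `Q`**:
`(1 − g(p))⁻¹ ≤ 1 + ρ_G(p)/(p − 1)`, which is `≤ (1 − ρ_{G'}(p)/p)⁻¹` off the primes of `2aa'`
(`G'` the odd variant, `ρ_G = ρ_{G'}` there) and `≤ 3` at those; then the tree's
`prod_inv_one_sub_rhoG_div_le` for `G'`. [folklore] -/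
theorem exists_hasSieveDimension (ha : 0 < a) (hirr : Irreducible (quadPoly a b c)) :
    ∃ K : ℝ, ∀ Q : ℕ, HasSieveDimension (rhoDensity a b c Q) 1 K := by
  obtain ⟨a', b', c', ha', hc', hirr', hΔ⟩ := exists_odd_variant ha hirr
  obtain ⟨C, hC⟩ := rhoMertensStrongG ha' hc' hirr'
  obtain ⟨K', hK'1, hK'⟩ := prod_inv_one_sub_rhoG_div_le ha' hc' hirr' hC
  set B : Finset ℕ := (2 * a.natAbs * a'.natAbs).primeFactors with hB
  have hB0 : 2 * a.natAbs * a'.natAbs ≠ 0 :=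
    mul_ne_zero (mul_ne_zero two_ne_zero (Int.natAbs_ne_zero.mpr ha.ne'))
      (Int.natAbs_ne_zero.mpr ha'.ne')
  have hlog2 : 0 < Real.log 2 := Real.log_pos one_lt_two
  have hK'0 : 0 < K' := by linarith
  refine ⟨3 ^ B.card * (1 + K' / Real.log 2), fun Q =>
    ⟨fun p hp => rhoDensity_prime_nonneg_lt_one a b c Q hp, ?_⟩⟩
  intro w z hw hwz
  rw [Real.rpow_one]
  set S := (Nat.primesBelow ⌈z⌉₊).filter (fun p : ℕ => w ≤ (p : ℝ)) with hS
  have hmemS : ∀ p ∈ S, p.Prime := fun p hp =>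
    (Nat.mem_primesBelow.mp (Finset.mem_filter.mp hp).1).2
  have hlogw : 0 < Real.log w := Real.log_pos (by linarith)
  have h3B : (1 : ℝ) ≤ 3 ^ B.card := one_le_pow₀ (by norm_num)
  have hratio1 : 1 ≤ Real.log z / Real.log w := by
    rw [le_div_iff₀ hlogw, one_mul]; exact Real.log_le_log (by linarith) hwz
  -- pointwise bound
  have hpt : ∀ p ∈ S, (1 - rhoDensity a b c Q p)⁻¹ ≤
      (if p ∈ B then (3 : ℝ) else 1) * (1 - (rhoG a' b' c' p : ℝ) / p)⁻¹ := by
    intro p hpS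
    have hp := hmemS p hpS
    have hp2 : (2 : ℝ) ≤ p := by exact_mod_cast hp.two_le
    have hp0 : (0 : ℝ) < p := by positivity
    have hρ'le : (rhoG a' b' c' p : ℝ) / p ≤ 2 / 3 := rhoG_div_le_two_thirds ha' hc' hirr' hp
    have hρ'0 : (0 : ℝ) ≤ (rhoG a' b' c' p : ℝ) / p := by positivity
    have hpos' : 0 < 1 - (rhoG a' b' c' p : ℝ) / p := by linarith
    have hinv1 : 1 ≤ (1 - (rhoG a' b' c' p : ℝ) / p)⁻¹ := by
      rw [one_le_inv₀ hpos']; linarith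
    have hstep : (1 - rhoDensity a b c Q p)⁻¹ ≤ 1 + (rhoG a b c p : ℝ) / ((p : ℝ) - 1) := by
      rw [rhoDensity_prime a b c Q hp]
      have hρ0 : (0 : ℝ) ≤ rhoG a b c p := Nat.cast_nonneg _
      split_ifs with hpQ
      · rw [sub_zero, inv_one]
        have : 0 ≤ (rhoG a b c p : ℝ) / ((p : ℝ) - 1) := div_nonneg hρ0 (by linarith)
        linarith
      · have hden : (p : ℝ) - 1 + rhoG a b c p ≠ 0 := by
          have : 0 < (p : ℝ) - 1 + rhoG a b c p := by linarith
          exact this.ne'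
        have hp1 : (p : ℝ) - 1 ≠ 0 := by
          have : 0 < (p : ℝ) - 1 := by linarith
          exact this.ne'
        have h1 : (1 : ℝ) - rhoG a b c p / ((p : ℝ) - 1 + rhoG a b c p) =
            ((p : ℝ) - 1) / ((p : ℝ) - 1 + rhoG a b c p) := by
          field_simp; ring
        have h2 : 1 + (rhoG a b c p : ℝ) / ((p : ℝ) - 1) =
            ((p : ℝ) - 1 + rhoG a b c p) / ((p : ℝ) - 1) := by
          field_simp
        rw [h1, inv_div, h2]
    by_cases hpB : p ∈ B
    · rw [if_pos hpB]
      have hρle : (rhoG a b c p : ℝ) ≤ p := by exact_mod_cast rhoG_le_self a b c p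
      have h3 : 1 + (rhoG a b c p : ℝ) / ((p : ℝ) - 1) ≤ 3 := by
        have : (rhoG a b c p : ℝ) / ((p : ℝ) - 1) ≤ 2 := by
          rw [div_le_iff₀ (by linarith)]; linarith
        linarith
      calc (1 - rhoDensity a b c Q p)⁻¹ ≤ 3 := hstep.trans h3
        _ = 3 * 1 := (mul_one _).symm
        _ ≤ 3 * (1 - (rhoG a' b' c' p : ℝ) / p)⁻¹ := by gcongr
    · rw [if_neg hpB, one_mul]
      have hpB' : ¬ p ∣ 2 * a.natAbs * a'.natAbs := fun h =>
        hpB (Nat.mem_primeFactors.mpr ⟨hp, h, hB0⟩)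
      have hp2' : p ≠ 2 := by
        intro h; subst h
        exact hpB' (dvd_mul_of_dvd_left (dvd_mul_right 2 _) _)
      have hpa : ¬ (p : ℤ) ∣ a := fun h =>
        hpB' (dvd_mul_of_dvd_left (Dvd.dvd.mul_left (Int.ofNat_dvd_left.mp h) 2) _)
      have hpa' : ¬ (p : ℤ) ∣ a' := fun h =>
        hpB' (Dvd.dvd.mul_left (Int.ofNat_dvd_left.mp h) _)
      have heq : rhoG a b c p = rhoG a' b' c' p := rhoG_eq_of_disc_eq ha hirr ha' hirr' hΔ hp hp2' hpa hpa'
      rw [heq] at hstep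
      refine hstep.trans ?_
      set r : ℝ := (rhoG a' b' c' p : ℝ) with hr
      have hr0 : 0 ≤ r := Nat.cast_nonneg _
      have hrp : r < p := by
        have := hρ'le
        rw [div_le_iff₀ hp0] at this; linarith
      have hrr : r * (1 - r) ≤ 0 := by
        rcases Nat.eq_zero_or_pos (rhoG a' b' c' p) with h0 | hpos
        · rw [hr, h0]; simp
        · have h1 : (1 : ℝ) ≤ r := by rw [hr]; exact_mod_cast hpos
          nlinarith
      rw [inv_eq_one_div, le_div_iff₀ hpos']
      have hp1 : (p : ℝ) - 1 ≠ 0 := by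
        have : 0 < (p : ℝ) - 1 := by linarith
        exact this.ne'
      have hexp : (1 + r / ((p : ℝ) - 1)) * (1 - r / p) =
          1 + r * (1 - r) / (((p : ℝ) - 1) * p) := by
        field_simp; ring
      rw [hexp]
      have : r * (1 - r) / (((p : ℝ) - 1) * p) ≤ 0 :=
        div_nonpos_of_nonpos_of_nonneg hrr (by nlinarith)
      linarith
  -- the product
  have hnn : ∀ p ∈ S, 0 ≤ (1 - rhoDensity a b c Q p)⁻¹ := fun p hp =>
    inv_nonneg.mpr (by have := (rhoDensity_prime_nonneg_lt_one a b c Q (hmemS p hp)).2; linarith)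
  have h1 : ∏ p ∈ S, (1 - rhoDensity a b c Q p)⁻¹ ≤
      ∏ p ∈ S, ((if p ∈ B then (3 : ℝ) else 1) * (1 - (rhoG a' b' c' p : ℝ) / p)⁻¹) :=
    Finset.prod_le_prod hnn hpt
  rw [Finset.prod_mul_distrib] at h1
  have hite : ∏ p ∈ S, (if p ∈ B then (3 : ℝ) else 1) ≤ 3 ^ B.card := by
    rw [Finset.prod_ite, Finset.prod_const_one, mul_one, Finset.prod_const]
    exact pow_le_pow_right₀ (by norm_num) (Finset.card_le_card fun x hx => (Finset.mem_filter.mp hx).2)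
  have hprod' : ∏ p ∈ S, (1 - (rhoG a' b' c' p : ℝ) / p)⁻¹ ≤
      Real.log z / Real.log w * (1 + K' / Real.log 2) := by
    rcases hwz.lt_or_eq with hlt | heq
    · refine (hK' w z hw hlt).trans ?_
      have hlogw2 : Real.log 2 ≤ Real.log w := Real.log_le_log (by norm_num) hw
      have : K' / Real.log w ≤ K' / Real.log 2 := div_le_div_of_nonneg_left hK'0.le hlog2 hlogw2
      have h0 : 0 ≤ Real.log z / Real.log w := by linarith
      gcongr
    · have hSe : S = ∅ := by
        rw [hS]
        refine Finset.filter_false_of_mem fun p hp => ?_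
        have := (Nat.mem_primesBelow.mp hp).1
        rw [Nat.lt_ceil] at this
        push Not
        rw [← heq] at this
        exact this
      rw [hSe, Finset.prod_empty]
      have : (1 : ℝ) ≤ 1 + K' / Real.log 2 := by
        have : 0 ≤ K' / Real.log 2 := by positivity
        linarith
      nlinarith
  have hnn1 : 0 ≤ ∏ p ∈ S, (1 - (rhoG a' b' c' p : ℝ) / p)⁻¹ := Finset.prod_nonneg fun p hp => by
    have := rhoG_div_le_two_thirds ha' hc' hirr' (hmemS p hp)
    exact inv_nonneg.mpr (by linarith)
  have hnn2 : 0 ≤ ∏ p ∈ S, (if p ∈ B then (3 : ℝ) else 1) :=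
    Finset.prod_nonneg fun p _ => by split_ifs <;> norm_num
  calc ∏ p ∈ S, (1 - rhoDensity a b c Q p)⁻¹
      ≤ (∏ p ∈ S, (if p ∈ B then (3 : ℝ) else 1)) * ∏ p ∈ S, (1 - (rhoG a' b' c' p : ℝ) / p)⁻¹ := h1
    _ ≤ 3 ^ B.card * (Real.log z / Real.log w * (1 + K' / Real.log 2)) :=
        mul_le_mul hite hprod' hnn1 (by positivity)
    _ = 3 ^ B.card * (1 + K' / Real.log 2) * (Real.log z / Real.log w) := by ring

end Variant

/-! ### E2-E. The main-term constant is uniform in the bad modulus: `F_Q · V_Q(z) ≥ W(z) ≥ c₀/log z` -/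

section Uniform

variable {a b c : ℤ} {Q : ℕ}
variable {χ : DirichletCharacter ℂ (4 * (b ^ 2 - 4 * a * c).natAbs)}

/-- `∏_{p < N} (1 − 1/p²) ≥ 1/2` (compare with `∏_{n ≥ 2} (1 − 1/n²) = 1/2`, telescoping).
[folklore] -/
theorem half_le_prod_one_sub_inv_sq (N : ℕ) :
    (1 : ℝ) / 2 ≤ ∏ p ∈ Nat.primesBelow N, (1 - 1 / (p : ℝ) ^ 2) := by
  have htel : ∀ N : ℕ, 2 ≤ N →
      ∏ n ∈ Finset.Ico 2 N, (1 - 1 / (n : ℝ) ^ 2) = N / (2 * ((N : ℝ) - 1)) := by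
    intro N hN
    induction N, hN using Nat.le_induction with
    | base => norm_num
    | succ N hN ih =>
        rw [Finset.prod_Ico_succ_top (by omega), ih]
        have hN2 : (2 : ℝ) ≤ N := by exact_mod_cast hN
        have h1 : (N : ℝ) - 1 ≠ 0 := by
          have : (0 : ℝ) < N - 1 := by linarith
          exact this.ne'
        have h2 : (N : ℝ) ≠ 0 := by
          have : (0 : ℝ) < N := by linarith
          exact this.ne'
        rw [show ((N + 1 : ℕ) : ℝ) - 1 = (N : ℝ) by push_cast; ring]
        push_cast
        field_simp
        ring
  have hfac : ∀ n : ℕ, 2 ≤ n → 0 ≤ 1 - 1 / (n : ℝ) ^ 2 ∧ 1 - 1 / (n : ℝ) ^ 2 ≤ 1 := by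
    intro n hn
    have hn2 : (2 : ℝ) ≤ n := by exact_mod_cast hn
    have h1 : 1 / (n : ℝ) ^ 2 ≤ 1 := by rw [div_le_one (by positivity)]; nlinarith
    have h2 : 0 ≤ 1 / (n : ℝ) ^ 2 := by positivity
    exact ⟨by linarith, by linarith⟩
  rcases Nat.lt_or_ge N 2 with hN | hN
  · have : Nat.primesBelow N = ∅ :=
      Finset.eq_empty_iff_forall_notMem.mpr fun p hp => by
        have := Nat.mem_primesBelow.mp hp
        have := this.2.two_le
        omega
    rw [this, Finset.prod_empty]; norm_num
  · have hsplit := Finset.prod_filter_mul_prod_filter_not (Finset.Ico 2 N) (fun n => n.Prime)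
      (fun n => (1 - 1 / (n : ℝ) ^ 2))
    have hfilter : (Finset.Ico 2 N).filter (fun n => n.Prime) = Nat.primesBelow N := by
      ext p
      simp only [Finset.mem_filter, Finset.mem_Ico, Nat.mem_primesBelow]
      constructor
      · rintro ⟨⟨-, h2⟩, hp⟩; exact ⟨h2, hp⟩
      · rintro ⟨h2, hp⟩; exact ⟨⟨hp.two_le, h2⟩, hp⟩
    rw [hfilter] at hsplit
    have hle1 : ∏ n ∈ (Finset.Ico 2 N).filter (fun n => ¬ n.Prime), (1 - 1 / (n : ℝ) ^ 2) ≤ 1 :=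
      Finset.prod_le_one (fun n hn => (hfac n (Finset.mem_Ico.mp (Finset.mem_filter.mp hn).1).1).1)
        fun n hn => (hfac n (Finset.mem_Ico.mp (Finset.mem_filter.mp hn).1).1).2
    have hpos : 0 ≤ ∏ p ∈ Nat.primesBelow N, (1 - 1 / (p : ℝ) ^ 2) :=
      Finset.prod_nonneg fun p hp => (hfac p (Nat.mem_primesBelow.mp hp).2.two_le).1
    have hN' : (1 : ℝ) / 2 ≤ N / (2 * ((N : ℝ) - 1)) := by
      have : (2 : ℝ) ≤ N := by exact_mod_cast hN
      rw [div_le_div_iff₀ (by norm_num) (by linarith)]; linarith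
    calc (1 : ℝ) / 2 ≤ N / (2 * ((N : ℝ) - 1)) := hN'
      _ = ∏ n ∈ Finset.Ico 2 N, (1 - 1 / (n : ℝ) ^ 2) := (htel N hN).symm
      _ = (∏ p ∈ Nat.primesBelow N, (1 - 1 / (p : ℝ) ^ 2)) *
            ∏ n ∈ (Finset.Ico 2 N).filter (fun n => ¬ n.Prime), (1 - 1 / (n : ℝ) ^ 2) :=
          hsplit.symm
      _ ≤ (∏ p ∈ Nat.primesBelow N, (1 - 1 / (p : ℝ) ^ 2)) * 1 :=
          mul_le_mul_of_nonneg_left hle1 hpos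
      _ = _ := mul_one _

/-- **`W(z) = ∏_{p<z} (1 − 1/p)(1 − χ(p)/p) ≥ c₀/log z`** for `z > 2`, with `c₀ = c₀(G) > 0`:
off the primes of `2a'` (`G'` the odd variant), `(1 − 1/p)(1 − χ(p)/p) ≥ (1 − ρ_{G'}(p)/p)(1 − 1/p²)`
(`ρ_{G'}(p) = 1 + χ(p)`), and `∏_{p<z}(1 − ρ_{G'}(p)/p) ≫ 1/log z` (the tree's Mertens product
bound for `ρ_{G'}`), `∏ (1 − 1/p²) ≥ 1/2`. [folklore] -/
theorem exists_W_lower (ha : 0 < a) (hirr : Irreducible (quadPoly a b c))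
    (hχ : ∀ n : ℕ, Odd n → χ n = (J(b ^ 2 - 4 * a * c | n) : ℂ)) :
    ∃ c₀ : ℝ, 0 < c₀ ∧ ∀ z : ℝ, 2 < z →
      c₀ / Real.log z ≤
        ∏ p ∈ Nat.primesBelow ⌈z⌉₊, (1 - ((p : ℝ))⁻¹) * (1 - DirichletAbel.reChar χ p / p) := by
  obtain ⟨a', b', c', ha', hc', hirr', hΔ⟩ := exists_odd_variant ha hirr
  obtain ⟨C, hC⟩ := rhoMertensStrongG ha' hc' hirr'
  obtain ⟨K', hK'1, hK'⟩ := prod_inv_one_sub_rhoG_div_le ha' hc' hirr' hC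
  set B : Finset ℕ := (2 * a'.natAbs).primeFactors with hB
  have hB0 : 2 * a'.natAbs ≠ 0 := mul_ne_zero two_ne_zero (Int.natAbs_ne_zero.mpr ha'.ne')
  have hlog2 : 0 < Real.log 2 := Real.log_pos one_lt_two
  have hK'0 : 0 < K' := by linarith
  have hM0 : 0 < 1 + K' / Real.log 2 := by positivity
  refine ⟨(1 / 4) ^ B.card * (Real.log 2 / (1 + K' / Real.log 2)) * (1 / 2), by positivity,
    fun z hz => ?_⟩
  set T := Nat.primesBelow ⌈z⌉₊ with hT
  have hmemT : ∀ p ∈ T, p.Prime := fun p hp => (Nat.mem_primesBelow.mp hp).2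
  have hlogz : 0 < Real.log z := Real.log_pos (by linarith)
  -- pointwise
  have hpt : ∀ p ∈ T, (if p ∈ B then (1 / 4 : ℝ) else 1) *
      ((1 - (rhoG a' b' c' p : ℝ) / p) * (1 - 1 / (p : ℝ) ^ 2)) ≤
      (1 - ((p : ℝ))⁻¹) * (1 - DirichletAbel.reChar χ p / p) := by
    intro p hpT
    have hp := hmemT p hpT
    have hp2 : (2 : ℝ) ≤ p := by exact_mod_cast hp.two_le
    have hp0 : (0 : ℝ) < p := by positivity
    have hχ1 := Literature.NumberTheory.LFunctions.DirichletAbel.abs_reChar_le_one χ p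
    rw [abs_le] at hχ1
    have hρ'le : (rhoG a' b' c' p : ℝ) / p ≤ 2 / 3 := rhoG_div_le_two_thirds ha' hc' hirr' hp
    have hu0 : 0 ≤ (1 - (rhoG a' b' c' p : ℝ) / p) * (1 - 1 / (p : ℝ) ^ 2) := by
      refine mul_nonneg (by linarith) ?_
      have : 1 / (p : ℝ) ^ 2 ≤ 1 := by rw [div_le_one (by positivity)]; nlinarith
      linarith
    have hu1 : (1 - (rhoG a' b' c' p : ℝ) / p) * (1 - 1 / (p : ℝ) ^ 2) ≤ 1 := by
      refine mul_le_one₀ ?_ ?_ ?_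
      · have : (0 : ℝ) ≤ (rhoG a' b' c' p : ℝ) / p := by positivity
        linarith
      · have : 1 / (p : ℝ) ^ 2 ≤ 1 := by rw [div_le_one (by positivity)]; nlinarith
        linarith
      · have : (0 : ℝ) ≤ 1 / (p : ℝ) ^ 2 := by positivity
        linarith
    have hw14 : (1 / 4 : ℝ) ≤ (1 - ((p : ℝ))⁻¹) * (1 - DirichletAbel.reChar χ p / p) := by
      have h1 : (1 / 2 : ℝ) ≤ 1 - ((p : ℝ))⁻¹ := by
        have : ((p : ℝ))⁻¹ ≤ 1 / 2 := by
          rw [inv_eq_one_div, div_le_div_iff₀ hp0 (by norm_num)]; linarith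
        linarith
      have h2 : (1 / 2 : ℝ) ≤ 1 - DirichletAbel.reChar χ p / p := by
        have : DirichletAbel.reChar χ p / p ≤ 1 / 2 := by
          rw [div_le_iff₀ hp0]; nlinarith
        linarith
      nlinarith
    by_cases hpB : p ∈ B
    · rw [if_pos hpB]
      nlinarith
    · rw [if_neg hpB, one_mul]
      have hpB' : ¬ p ∣ 2 * a'.natAbs := fun h => hpB (Nat.mem_primeFactors.mpr ⟨hp, h, hB0⟩)
      have hp2' : p ≠ 2 := by
        intro h; subst h
        exact hpB' (dvd_mul_right 2 _)
      have hpa' : ¬ (p : ℤ) ∣ a' := fun h => hpB' (Dvd.dvd.mul_left (Int.ofNat_dvd_left.mp h) _)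
      have hρ' : (rhoG a' b' c' p : ℝ) = 1 + (J(b ^ 2 - 4 * a * c | p) : ℝ) := by
        have h := rhoG_eq_one_add_jacobiSym ha' hirr' hp hp2' hpa'
        rw [hΔ] at h
        have h' : ((rhoG a' b' c' p : ℤ) : ℝ) = ((1 + J(b ^ 2 - 4 * a * c | p) : ℤ) : ℝ) := by
          rw [h]
        push_cast at h'
        exact h'
      have hχp : DirichletAbel.reChar χ p = (J(b ^ 2 - 4 * a * c | p) : ℝ) := by
        rw [Literature.NumberTheory.LFunctions.DirichletAbel.reChar_apply χ hp.ne_zero,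
          re_apply_prime_eq_jacobiSym hχ hp hp2']
      set j : ℝ := (J(b ^ 2 - 4 * a * c | p) : ℝ) with hj
      rw [hρ', hχp]
      rw [hχp] at hχ1
      have hp0' : (p : ℝ) ≠ 0 := hp0.ne'
      have key : (1 - ((p : ℝ))⁻¹) * (1 - j / p) - (1 - (1 + j) / p) * (1 - 1 / (p : ℝ) ^ 2) =
          ((p : ℝ) - 1) * (1 + j) / (p : ℝ) ^ 3 := by
        field_simp; ring
      have hnonneg : 0 ≤ ((p : ℝ) - 1) * (1 + j) / (p : ℝ) ^ 3 := by
        apply div_nonneg _ (by positivity)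
        exact mul_nonneg (by linarith) (by linarith [hχ1.1])
      linarith
  -- products
  have hnnL : ∀ p ∈ T, 0 ≤ (if p ∈ B then (1 / 4 : ℝ) else 1) *
      ((1 - (rhoG a' b' c' p : ℝ) / p) * (1 - 1 / (p : ℝ) ^ 2)) := by
    intro p hpT
    have hp := hmemT p hpT
    have hp2 : (2 : ℝ) ≤ p := by exact_mod_cast hp.two_le
    have hρ'le : (rhoG a' b' c' p : ℝ) / p ≤ 2 / 3 := rhoG_div_le_two_thirds ha' hc' hirr' hp
    refine mul_nonneg (by split_ifs <;> norm_num) (mul_nonneg (by linarith) ?_)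
    have : 1 / (p : ℝ) ^ 2 ≤ 1 := by rw [div_le_one (by positivity)]; nlinarith
    linarith
  have h1 := Finset.prod_le_prod hnnL hpt
  rw [Finset.prod_mul_distrib, Finset.prod_mul_distrib] at h1
  -- (i) the `1/4` factors
  have hite : (1 / 4 : ℝ) ^ B.card ≤ ∏ p ∈ T, (if p ∈ B then (1 / 4 : ℝ) else 1) := by
    rw [Finset.prod_ite, Finset.prod_const_one, mul_one, Finset.prod_const]
    exact pow_le_pow_of_le_one (by norm_num) (by norm_num)
      (Finset.card_le_card fun x hx => (Finset.mem_filter.mp hx).2)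
  -- (ii) the `ρ_{G'}` product
  have hrho : Real.log 2 / (1 + K' / Real.log 2) / Real.log z ≤
      ∏ p ∈ T, (1 - (rhoG a' b' c' p : ℝ) / p) := by
    have h := hK' 2 z le_rfl hz
    have hfilt : (Nat.primesBelow ⌈z⌉₊).filter (fun p : ℕ => (2 : ℝ) ≤ (p : ℝ)) = T :=
      Finset.filter_true_of_mem fun p hp => by exact_mod_cast (hmemT p hp).two_le
    rw [hfilt, Finset.prod_inv_distrib] at h
    have hpos : 0 < ∏ p ∈ T, (1 - (rhoG a' b' c' p : ℝ) / p) :=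
      Finset.prod_pos fun p hp => by
        have := rhoG_div_le_two_thirds ha' hc' hirr' (hmemT p hp); linarith
    have hM : 0 < Real.log z / Real.log 2 * (1 + K' / Real.log 2) := by positivity
    have := inv_le_of_inv_le₀ hpos h
    have heq : (Real.log z / Real.log 2 * (1 + K' / Real.log 2))⁻¹ =
        Real.log 2 / (1 + K' / Real.log 2) / Real.log z := by
      field_simp
    rw [heq] at this
    exact this
  -- (iii) the `1 - 1/p²` product
  have hsq := half_le_prod_one_sub_inv_sq ⌈z⌉₊
  have hc0 : 0 ≤ Real.log 2 / (1 + K' / Real.log 2) / Real.log z := by positivity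
  have hnnρ : 0 ≤ ∏ p ∈ T, (1 - (rhoG a' b' c' p : ℝ) / p) :=
    Finset.prod_nonneg fun p hp => by
      have := rhoG_div_le_two_thirds ha' hc' hirr' (hmemT p hp); linarith
  have hnnι : 0 ≤ ∏ p ∈ T, (if p ∈ B then (1 / 4 : ℝ) else 1) :=
    Finset.prod_nonneg fun p _ => by split_ifs <;> norm_num
  calc (1 / 4 : ℝ) ^ B.card * (Real.log 2 / (1 + K' / Real.log 2)) * (1 / 2) / Real.log z
      = (1 / 4 : ℝ) ^ B.card * ((Real.log 2 / (1 + K' / Real.log 2) / Real.log z) * (1 / 2)) := by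
        ring
    _ ≤ (∏ p ∈ T, (if p ∈ B then (1 / 4 : ℝ) else 1)) *
          ((∏ p ∈ T, (1 - (rhoG a' b' c' p : ℝ) / p)) * ∏ p ∈ T, (1 - 1 / (p : ℝ) ^ 2)) := by
        refine mul_le_mul hite (mul_le_mul hrho hsq (by norm_num) hnnρ) (by positivity) hnnι
    _ ≤ _ := h1

/-- **`F_Q · V_Q(z) ≥ W(z)`**: for `Q` squarefree, even, containing the primes of `a` and `Δ`,
with all prime factors `< z`:
`∏_{p<z} (1 − 1/p)(1 − χ(p)/p) ≤ (∑_{f∣Q} μ(f) g_r(f)) · ∏_{p<z} (1 − g_Q(p))`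
(at `p ∣ Q` the two sides carry the same factor; at `p ∤ Q`, `1 − g_Q(p) = (p−1)/(p+χ(p)) ≥
(1 − 1/p)(1 − χ(p)/p)`). [folklore] -/
theorem W_le_F_mul_V (ha : 0 < a) (hirr : Irreducible (quadPoly a b c))
    (hχ : ∀ n : ℕ, Odd n → χ n = (J(b ^ 2 - 4 * a * c | n) : ℂ))
    (hQ : Squarefree Q) (hQ2 : 2 ∣ Q) (hQa : ∀ p : ℕ, p.Prime → (p : ℤ) ∣ a → p ∣ Q)
    (hQΔ : ∀ p : ℕ, p.Prime → (p : ℤ) ∣ b ^ 2 - 4 * a * c → p ∣ Q) {z : ℝ}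
    (hQz : ∀ p ∈ Q.primeFactors, (p : ℝ) < z) :
    ∏ p ∈ Nat.primesBelow ⌈z⌉₊, (1 - ((p : ℝ))⁻¹) * (1 - DirichletAbel.reChar χ p / p) ≤
      (∑ f ∈ Q.divisors, (μ f : ℝ) * RealChar.charDivisorDensity χ f) *
        ∏ p ∈ Nat.primesBelow ⌈z⌉₊, (1 - rhoDensity a b c Q p) := by
  have hΔ0 : b ^ 2 - 4 * a * c ≠ 0 := disc_ne_zero ha.ne' hirr
  have hq : χ ^ 2 = 1 := chi_sq_eq_one hΔ0 hχ
  set T := Nat.primesBelow ⌈z⌉₊ with hT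
  have hmemT : ∀ p ∈ T, p.Prime := fun p hp => (Nat.mem_primesBelow.mp hp).2
  have hF : ∑ f ∈ Q.divisors, (μ f : ℝ) * RealChar.charDivisorDensity χ f =
      ∏ p ∈ T.filter (· ∣ Q), (1 - ((p : ℝ))⁻¹) * (1 - DirichletAbel.reChar χ p / p) := by
    rw [← ArithmeticFunction.IsMultiplicative.prodPrimeFactors_one_sub_of_squarefree _
      (RealChar.isMultiplicative_charDivisorDensity χ hq) hQ]
    have hset : Q.primeFactors = T.filter (· ∣ Q) := by
      ext p
      rw [Finset.mem_filter, hT, Nat.mem_primesBelow, Nat.lt_ceil]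
      constructor
      · intro hp
        exact ⟨⟨hQz p hp, Nat.prime_of_mem_primeFactors hp⟩, Nat.dvd_of_mem_primeFactors hp⟩
      · rintro ⟨⟨-, hp⟩, hd⟩
        exact Nat.mem_primeFactors.mpr ⟨hp, hd, hQ.ne_zero⟩
    rw [hset]
    exact Finset.prod_congr rfl fun p hp =>
      RealChar.one_sub_charDivisorDensity_prime χ hq (hmemT p (Finset.mem_filter.mp hp).1)
  rw [hF, Finset.prod_filter, ← Finset.prod_mul_distrib]
  refine Finset.prod_le_prod (fun p hp => ?_) fun p hp => ?_
  · have hp' := hmemT p hp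
    have hp2 : (2 : ℝ) ≤ p := by exact_mod_cast hp'.two_le
    have hp0 : (0 : ℝ) < p := by positivity
    have hχ1 := Literature.NumberTheory.LFunctions.DirichletAbel.abs_reChar_le_one χ p
    rw [abs_le] at hχ1
    refine mul_nonneg ?_ ?_
    · rw [sub_nonneg]; exact inv_le_one_of_one_le₀ (by linarith)
    · rw [sub_nonneg, div_le_one hp0]; linarith
  · have hp' := hmemT p hp
    have hp2 : (2 : ℝ) ≤ p := by exact_mod_cast hp'.two_le
    have hp0 : (0 : ℝ) < p := by positivity
    by_cases hpQ : p ∣ Q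
    · rw [if_pos hpQ, rhoDensity_prime a b c Q hp', if_pos hpQ, sub_zero, mul_one]
    · rw [if_neg hpQ, one_mul, rhoDensity_prime a b c Q hp', if_neg hpQ,
        rhoG_prime_eq_one_add_reChar ha hirr hχ hQ2 hQa hp' hpQ]
      set x : ℝ := DirichletAbel.reChar χ p with hx
      have hx1 : x = 1 ∨ x = -1 := reChar_good_prime hχ hQ2 hQΔ hp' hpQ
      have hp3 : (3 : ℝ) ≤ p := by
        have hp2' : p ≠ 2 := fun h => hpQ (h ▸ hQ2)
        have := hp'.two_le
        exact_mod_cast (show 3 ≤ p by omega)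
      have hden : (p : ℝ) - 1 + (1 + x) ≠ 0 := by
        rcases hx1 with h | h <;> rw [h] <;> (try norm_num) <;> linarith
      have hp0' : (p : ℝ) ≠ 0 := hp0.ne'
      have key : (1 - (1 + x) / ((p : ℝ) - 1 + (1 + x))) - (1 - ((p : ℝ))⁻¹) * (1 - x / p) =
          ((p : ℝ) - 1) * x ^ 2 / ((p : ℝ) ^ 2 * ((p : ℝ) + x)) := by
        have hden' : (p : ℝ) + x ≠ 0 := by
          rcases hx1 with h | h <;> rw [h] <;> linarith
        field_simp
        ring
      have hnonneg : 0 ≤ ((p : ℝ) - 1) * x ^ 2 / ((p : ℝ) ^ 2 * ((p : ℝ) + x)) := by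
        apply div_nonneg (mul_nonneg (by linarith) (sq_nonneg x))
        apply mul_nonneg (by positivity)
        rcases hx1 with h | h <;> rw [h] <;> linarith
      linarith

/-- **Uniform lower bound for the main-term constant**: there is `c₀ = c₀(G) > 0` such that
for every admissible bad modulus `Q` (squarefree, even, containing the primes of `aΔ`) whose
prime factors are `< z`, `z > 2`:
`c₀/log z ≤ (∑_{f∣Q} μ(f) g_r(f)) · ∏_{p<z}(1 − g_Q(p))`. [folklore] -/
theorem exists_const_F_mul_V (ha : 0 < a) (hirr : Irreducible (quadPoly a b c))
    (hχ : ∀ n : ℕ, Odd n → χ n = (J(b ^ 2 - 4 * a * c | n) : ℂ)) :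
    ∃ c₀ : ℝ, 0 < c₀ ∧ ∀ Q : ℕ, Squarefree Q → 2 ∣ Q →
      (∀ p : ℕ, p.Prime → (p : ℤ) ∣ a → p ∣ Q) →
      (∀ p : ℕ, p.Prime → (p : ℤ) ∣ b ^ 2 - 4 * a * c → p ∣ Q) →
      ∀ z : ℝ, 2 < z → (∀ p ∈ Q.primeFactors, (p : ℝ) < z) →
        c₀ / Real.log z ≤
          (∑ f ∈ Q.divisors, (μ f : ℝ) * RealChar.charDivisorDensity χ f) *
            ∏ p ∈ Nat.primesBelow ⌈z⌉₊, (1 - rhoDensity a b c Q p) := by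
  obtain ⟨c₀, hc₀, hW⟩ := exists_W_lower ha hirr hχ
  exact ⟨c₀, hc₀, fun Q hQ hQ2 hQa hQΔ z hz hQz =>
    (hW z hz).trans (W_le_F_mul_V ha hirr hχ hQ hQ2 hQa hQΔ hQz)⟩

end Uniform

end PropertySTypeI


namespace PropertySTypeI

open Polynomial Finset Iwaniec1978 RhoLogSums ArithmeticFunction
open scoped NumberTheorySymbols ArithmeticFunction.Moebius ArithmeticFunction.sigma
open Literature.NumberTheory.LFunctions (DirichletAbel.reChar RealChar.charDivisorDensity)

/-! ### E2-F. The sieve on the cofactor `m`: the sequence `𝒜^{(p₁)}` and its remainders -/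

section SieveStep

variable {a b c : ℤ} {Q : ℕ}

/-- **The main-term constant** `𝔠 = 𝔠(G, Q) = L(1, χ) F_Q Z_Q`. [folklore] -/
def cMain {N : ℕ} [NeZero N] (χ : DirichletCharacter ℂ N) (Q : ℕ) : ℝ :=
  (χ.LFunction 1).re * (∑ f ∈ Q.divisors, (μ f : ℝ) * RealChar.charDivisorDensity χ f) * zCoprime Q

/-- **The window constant** `K_V = 5 N τ(Q)³ (1 + log V) + 8 |L(1, χ) F_Q|`. [folklore] -/
def kWin {N : ℕ} [NeZero N] (χ : DirichletCharacter ℂ N) (Q V : ℕ) : ℝ :=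
  5 * (N : ℝ) * (#Q.divisors : ℝ) ^ 3 * (1 + Real.log V) +
    8 * |(χ.LFunction 1).re * ∑ f ∈ Q.divisors, (μ f : ℝ) * RealChar.charDivisorDensity χ f|

/-- `K_V ≥ 0` for `V ≥ 1`. [folklore] -/
theorem kWin_nonneg {N : ℕ} [NeZero N] (χ : DirichletCharacter ℂ N) (Q : ℕ) {V : ℕ} (hV : 1 ≤ V) :
    0 ≤ kWin χ Q V := by
  have : 0 ≤ Real.log V := Real.log_nonneg (by exact_mod_cast hV)
  unfold kWin; positivity

/-- **The sieve sequence on the cofactor**: `a_m = A(p₁ m)` for `M₁ ≤ m`, `(m, Q) = 1` (else `0`),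
expected size `X`, density `g = rhoDensity a b c Q`. [folklore] -/
def mSeq (a b c : ℤ) (Q p₁ M₁ : ℕ) (A : ℕ → ℕ) (X : ℝ) : SieveSequence where
  a m := if M₁ ≤ m ∧ m.Coprime Q then (A (p₁ * m) : ℝ) else 0
  a_nonneg m := by
    split_ifs
    · exact Nat.cast_nonneg _
    · exact le_rfl
  size _ := X
  density := rhoDensity a b c Q
  density_mult := isMultiplicative_rhoDensity a b c Q

/-- The sifting function of `𝒜^{(p₁)}` at `x = M₂`: the `z`-rough `m ∈ [M₁, M₂]` prime to `Q`,
counted with weight `A(p₁ m)`. [folklore] -/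
theorem sifted_mSeq (a b c : ℤ) (Q p₁ : ℕ) {M₁ : ℕ} (hM₁ : 1 ≤ M₁) (M₂ : ℕ) (A : ℕ → ℕ) (X : ℝ)
    (Pz : ℕ) :
    (mSeq a b c Q p₁ M₁ A X).sifted (M₂ : ℝ) Pz =
      ∑ m ∈ (Finset.Icc M₁ M₂).filter (fun m => m.Coprime Q ∧ m.Coprime Pz), (A (p₁ * m) : ℝ) := by
  rw [SieveSequence.sifted, Nat.floor_natCast]
  simp only [mSeq]
  rw [Finset.sum_filter, Finset.sum_filter]
  have hsub : Finset.Icc M₁ M₂ ⊆ Finset.Ioc 0 M₂ := fun m hm => by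
    rw [Finset.mem_Icc] at hm; rw [Finset.mem_Ioc]; omega
  rw [← Finset.sum_subset hsub]
  · refine Finset.sum_congr rfl fun m hm => ?_
    rw [Finset.mem_Icc] at hm
    by_cases h1 : m.Coprime Pz <;> by_cases h2 : m.Coprime Q
    · rw [if_pos h1, if_pos ⟨hm.1, h2⟩, if_pos ⟨h2, h1⟩]
    · rw [if_pos h1, if_neg (fun h => h2 h.2), if_neg (fun h => h2 h.1)]
    · rw [if_neg h1, if_neg (fun h => h1 h.2)]
    · rw [if_neg h1, if_neg (fun h => h1 h.2)]
  · intro m hm hm'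
    rw [Finset.mem_Ioc] at hm
    rw [Finset.mem_Icc, not_and_or] at hm'
    have : ¬ M₁ ≤ m := by omega
    by_cases hc : m.Coprime Pz
    · rw [if_pos hc, if_neg (fun h => this h.1)]
    · rw [if_neg hc]

/-- The congruence sums of `𝒜^{(p₁)}`: `A_d(M₂) = ∑_{M₁ ≤ m ≤ M₂, d ∣ m, (m,Q)=1} A(p₁ m)`.
[folklore] -/
theorem congrSum_mSeq (a b c : ℤ) (Q p₁ : ℕ) {M₁ : ℕ} (hM₁ : 1 ≤ M₁) (d M₂ : ℕ) (A : ℕ → ℕ)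
    (X : ℝ) :
    (mSeq a b c Q p₁ M₁ A X).congrSum d (M₂ : ℝ) =
      ∑ m ∈ (Finset.Ioc (M₁ - 1) M₂).filter (fun m => d ∣ m ∧ m.Coprime Q), (A (p₁ * m) : ℝ) := by
  rw [SieveSequence.congrSum, Nat.floor_natCast]
  simp only [mSeq]
  rw [Finset.sum_filter, Finset.sum_filter]
  have hsub : Finset.Ioc (M₁ - 1) M₂ ⊆ Finset.Ioc 0 M₂ := fun m hm => by
    rw [Finset.mem_Ioc] at hm ⊢; omega
  rw [← Finset.sum_subset hsub]
  · refine Finset.sum_congr rfl fun m hm => ?_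
    rw [Finset.mem_Ioc] at hm
    have hM : M₁ ≤ m := by omega
    by_cases h1 : d ∣ m <;> by_cases h2 : m.Coprime Q
    · rw [if_pos h1, if_pos ⟨hM, h2⟩, if_pos ⟨h1, h2⟩]
    · rw [if_pos h1, if_neg (fun h => h2 h.2), if_neg (fun h => h2 h.2)]
    · rw [if_neg h1, if_neg (fun h => h1 h.1)]
    · rw [if_neg h1, if_neg (fun h => h1 h.1)]
  · intro m hm hm'
    rw [Finset.mem_Ioc] at hm hm'
    have : ¬ M₁ ≤ m := by omega
    by_cases hc : d ∣ m
    · rw [if_pos hc, if_neg (fun h => this h.1)]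
    · rw [if_neg hc]

/-- `g(d) = 0` when `(d, Q) > 1` (`d ≠ 0`). [folklore] -/
theorem rhoDensity_eq_zero_of_not_coprime (a b c : ℤ) {Q d : ℕ} (hd : d ≠ 0)
    (hdQ : ¬ d.Coprime Q) : rhoDensity a b c Q d = 0 := by
  rw [rhoDensity, ArithmeticFunction.prodPrimeFactors_apply hd]
  obtain ⟨p, hp, hpd, hpQ⟩ := Nat.Prime.not_coprime_iff_dvd.mp hdQ
  exact Finset.prod_eq_zero (Nat.mem_primeFactors.mpr ⟨hp, hpd, hd⟩) (by rw [if_pos hpQ])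

/-- The remainders `R_d` of `𝒜^{(p₁)}` vanish for `(d, Q) > 1`. [folklore] -/
theorem remainder_mSeq_eq_zero (a b c : ℤ) (Q p₁ : ℕ) {M₁ : ℕ} (hM₁ : 1 ≤ M₁) (A : ℕ → ℕ)
    (X : ℝ) {d : ℕ} (hd : d ≠ 0) (hdQ : ¬ d.Coprime Q) (M₂ : ℕ) :
    (mSeq a b c Q p₁ M₁ A X).remainder d (M₂ : ℝ) = 0 := by
  rw [SieveSequence.remainder, congrSum_mSeq a b c Q p₁ hM₁ d M₂ A X,
    show (mSeq a b c Q p₁ M₁ A X).density = rhoDensity a b c Q from rfl,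
    rhoDensity_eq_zero_of_not_coprime a b c hd hdQ, zero_mul, sub_zero]
  refine Finset.sum_eq_zero fun m hm => ?_
  exfalso
  rw [Finset.mem_filter] at hm
  exact hdQ (Nat.Coprime.coprime_dvd_left hm.2.1 hm.2.2)

variable {χ : DirichletCharacter ℂ (4 * (b ^ 2 - 4 * a * c).natAbs)}

/-- **The remainder of `𝒜^{(p₁)}` at a squarefree `d` prime to `Q`**, with
`X = X₀ (ρ(p₁)/p₁) 𝔠 log(M₂/U)`, `U = M₁ − 1 ≥ 1`:
`|R_d| ≤ |T₁(d)| + (X₀/p₁) · 8(1 + log M₂)²/p₁ + (X₀ ρ(p₁)/p₁)(2𝔠/U + 4 K_{M₂} τ(d)³/√U)`,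
`T₁(d) = ∑_{U<m≤M₂, d∣m, (m,Q)=1} (A(p₁m) − X₀ ρ(p₁m)/(p₁m))` (the type-I remainder; the other
two terms are the E1 window estimates). [folklore] -/
theorem abs_remainder_mSeq_le (ha : 0 < a) (hirr : Irreducible (quadPoly a b c))
    (hχ : ∀ n : ℕ, Odd n → χ n = (J(b ^ 2 - 4 * a * c | n) : ℂ))
    (hQ : Squarefree Q) (hQ2 : 2 ∣ Q) (hQa : ∀ p : ℕ, p.Prime → (p : ℤ) ∣ a → p ∣ Q)
    (hQΔ : ∀ p : ℕ, p.Prime → (p : ℤ) ∣ b ^ 2 - 4 * a * c → p ∣ Q)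
    (hpow : ∀ p : ℕ, p.Prime → ¬ p ∣ Q → ∀ k : ℕ, 1 ≤ k → rhoG a b c (p ^ k) = rhoG a b c p)
    [NeZero (4 * (b ^ 2 - 4 * a * c).natAbs)]
    {p₁ : ℕ} (hp₁ : p₁.Prime) (hp₁Q : ¬ p₁ ∣ Q) (A : ℕ → ℕ) {X₀ : ℝ} (hX₀ : 0 ≤ X₀)
    {M₁ M₂ : ℕ} (hM₁ : 2 ≤ M₁) (hM : M₁ ≤ M₂) {d : ℕ} (hd : Squarefree d) (hdQ : d.Coprime Q) :
    |(mSeq a b c Q p₁ M₁ A (X₀ * ((rhoG a b c p₁ : ℝ) / p₁) * cMain χ Q *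
        Real.log ((M₂ : ℝ) / ((M₁ - 1 : ℕ) : ℝ)))).remainder d (M₂ : ℝ)| ≤
      |∑ m ∈ (Finset.Ioc (M₁ - 1) M₂).filter (fun m => d ∣ m ∧ m.Coprime Q),
          ((A (p₁ * m) : ℝ) - X₀ * (rhoG a b c (p₁ * m) : ℝ) / ((p₁ * m : ℕ) : ℝ))| +
        X₀ / p₁ * (8 * (1 + Real.log M₂) ^ 2 / p₁) +
        X₀ * ((rhoG a b c p₁ : ℝ) / p₁) *
          (2 * |cMain χ Q| / ((M₁ - 1 : ℕ) : ℝ) +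
            4 * (kWin χ Q M₂ * (#d.divisors : ℝ) ^ 3) / Real.sqrt ((M₁ - 1 : ℕ) : ℝ)) := by
  have hQ0 : Q ≠ 0 := hQ.ne_zero
  have hU : 1 ≤ M₁ - 1 := by omega
  have hUV : M₁ - 1 ≤ M₂ := by omega
  have hM₁' : 1 ≤ M₁ := by omega
  have hp0 : (0 : ℝ) < p₁ := by exact_mod_cast hp₁.pos
  set W := (Finset.Ioc (M₁ - 1) M₂).filter (fun m => d ∣ m ∧ m.Coprime Q) with hW
  set S₂ : ℝ := ∑ m ∈ W, (rhoG a b c (p₁ * m) : ℝ) / m with hS₂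
  set S₃ : ℝ := ∑ m ∈ W, (rhoG a b c m : ℝ) / m with hS₃
  set T₁ : ℝ := ∑ m ∈ W, ((A (p₁ * m) : ℝ) - X₀ * (rhoG a b c (p₁ * m) : ℝ) / ((p₁ * m : ℕ) : ℝ))
    with hT₁
  set Lg : ℝ := Real.log ((M₂ : ℝ) / ((M₁ - 1 : ℕ) : ℝ)) with hLg
  -- the E1 window estimates
  have h2 : |S₂ - (rhoG a b c p₁ : ℝ) * S₃| ≤ 8 * (1 + Real.log M₂) ^ 2 / p₁ :=
    abs_rhoLogSum_prime_mul_sub_le ha hirr hχ hQ2 hQa hpow hp₁ hp₁Q d (M₁ - 1) M₂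
  have h3 : |S₃ - cMain χ Q * rhoDensity a b c Q d * Lg| ≤
      2 * |cMain χ Q| / ((M₁ - 1 : ℕ) : ℝ) +
        4 * (kWin χ Q M₂ * (#d.divisors : ℝ) ^ 3) / Real.sqrt ((M₁ - 1 : ℕ) : ℝ) := by
    have h := abs_rhoLogSum_sub_le ha hirr hχ hQ0 hQ2 hQa hQΔ hpow hd hdQ hU hUV (χ := χ)
    simp only [cMain, kWin]
    convert h using 2
  -- the decomposition of the remainder
  have hsum : (mSeq a b c Q p₁ M₁ A (X₀ * ((rhoG a b c p₁ : ℝ) / p₁) * cMain χ Q * Lg)).congrSum d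
      (M₂ : ℝ) = T₁ + X₀ / p₁ * S₂ := by
    rw [congrSum_mSeq a b c Q p₁ hM₁' d M₂ A, hT₁, hS₂, Finset.mul_sum, ← Finset.sum_add_distrib]
    refine Finset.sum_congr rfl fun m hm => ?_
    have hm0 : (0 : ℝ) < m := by
      rw [hW, Finset.mem_filter, Finset.mem_Ioc] at hm
      exact_mod_cast (show 0 < m by omega)
    push_cast
    field_simp
    ring
  have hrem : (mSeq a b c Q p₁ M₁ A (X₀ * ((rhoG a b c p₁ : ℝ) / p₁) * cMain χ Q * Lg)).remainder d
      (M₂ : ℝ) = T₁ + X₀ / p₁ * (S₂ - (rhoG a b c p₁ : ℝ) * S₃) +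
        X₀ * ((rhoG a b c p₁ : ℝ) / p₁) * (S₃ - cMain χ Q * rhoDensity a b c Q d * Lg) := by
    rw [SieveSequence.remainder, hsum]
    change T₁ + X₀ / p₁ * S₂ - rhoDensity a b c Q d * (X₀ * ((rhoG a b c p₁ : ℝ) / p₁) *
      cMain χ Q * Lg) = _
    ring
  rw [hrem]
  have hc1 : 0 ≤ X₀ / p₁ := by positivity
  have hc2 : 0 ≤ X₀ * ((rhoG a b c p₁ : ℝ) / p₁) := by positivity
  calc |T₁ + X₀ / p₁ * (S₂ - (rhoG a b c p₁ : ℝ) * S₃) +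
        X₀ * ((rhoG a b c p₁ : ℝ) / p₁) * (S₃ - cMain χ Q * rhoDensity a b c Q d * Lg)|
      ≤ |T₁| + |X₀ / p₁ * (S₂ - (rhoG a b c p₁ : ℝ) * S₃)| +
          |X₀ * ((rhoG a b c p₁ : ℝ) / p₁) * (S₃ - cMain χ Q * rhoDensity a b c Q d * Lg)| := by
        refine (abs_add_le _ _).trans ?_
        gcongr
        exact abs_add_le _ _
    _ = |T₁| + X₀ / p₁ * |S₂ - (rhoG a b c p₁ : ℝ) * S₃| +
          X₀ * ((rhoG a b c p₁ : ℝ) / p₁) * |S₃ - cMain χ Q * rhoDensity a b c Q d * Lg| := by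
        rw [abs_mul, abs_mul, abs_of_nonneg hc1, abs_of_nonneg hc2]
    _ ≤ _ := by gcongr

/-- **The sieve step**: for `2 ≤ z ≤ D` and the sequence `𝒜^{(p₁)}` (dimension `1`, constant `K`
for `g = rhoDensity a b c Q`),
`S(𝒜^{(p₁)}, z) ≥ X V(z) (1 − C(1,K) e^{−log D/log z}) − ∑_{d ∣ P(z), d ≤ D, (d,Q)=1} B(d)`,
where `S(𝒜^{(p₁)}, z) = ∑_{M₁≤m≤M₂, (m, Q P(z)) = 1} A(p₁ m)`, `V(z) = ∏_{p<z}(1 − g(p))` and `B(d)`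
is the bound of `abs_remainder_mSeq_le` (the remainders at `(d, Q) > 1` vanish).
[cite: FriedlanderIwaniecOpera2010, Cor. 6.10 (the fundamental lemma used)] -/
theorem sieve_step (ha : 0 < a) (hirr : Irreducible (quadPoly a b c))
    (hχ : ∀ n : ℕ, Odd n → χ n = (J(b ^ 2 - 4 * a * c | n) : ℂ))
    (hQ : Squarefree Q) (hQ2 : 2 ∣ Q) (hQa : ∀ p : ℕ, p.Prime → (p : ℤ) ∣ a → p ∣ Q)
    (hQΔ : ∀ p : ℕ, p.Prime → (p : ℤ) ∣ b ^ 2 - 4 * a * c → p ∣ Q)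
    (hpow : ∀ p : ℕ, p.Prime → ¬ p ∣ Q → ∀ k : ℕ, 1 ≤ k → rhoG a b c (p ^ k) = rhoG a b c p)
    [NeZero (4 * (b ^ 2 - 4 * a * c).natAbs)]
    {K : ℝ} (hdim : HasSieveDimension (rhoDensity a b c Q) 1 K)
    {p₁ : ℕ} (hp₁ : p₁.Prime) (hp₁Q : ¬ p₁ ∣ Q) (A : ℕ → ℕ) {X₀ : ℝ} (hX₀ : 0 ≤ X₀)
    {M₁ M₂ : ℕ} (hM₁ : 2 ≤ M₁) (hM : M₁ ≤ M₂) {z D : ℝ} (hz : 2 ≤ z) (hzD : z ≤ D) :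
    X₀ * ((rhoG a b c p₁ : ℝ) / p₁) * cMain χ Q * Real.log ((M₂ : ℝ) / ((M₁ - 1 : ℕ) : ℝ)) *
        (∏ p ∈ Nat.primesBelow ⌈z⌉₊, (1 - rhoDensity a b c Q p)) *
        (1 - SieveSequence.flConst 1 K * Real.exp (-(Real.log D / Real.log z))) -
      ∑ d ∈ ((primesProdBelow z).divisors.filter (fun d : ℕ => (d : ℝ) ≤ D)).filter
          (fun d : ℕ => d.Coprime Q),
        (|∑ m ∈ (Finset.Ioc (M₁ - 1) M₂).filter (fun m => d ∣ m ∧ m.Coprime Q),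
            ((A (p₁ * m) : ℝ) - X₀ * (rhoG a b c (p₁ * m) : ℝ) / ((p₁ * m : ℕ) : ℝ))| +
          X₀ / p₁ * (8 * (1 + Real.log M₂) ^ 2 / p₁) +
          X₀ * ((rhoG a b c p₁ : ℝ) / p₁) *
            (2 * |cMain χ Q| / ((M₁ - 1 : ℕ) : ℝ) +
              4 * (kWin χ Q M₂ * (#d.divisors : ℝ) ^ 3) / Real.sqrt ((M₁ - 1 : ℕ) : ℝ))) ≤
      ∑ m ∈ (Finset.Icc M₁ M₂).filter (fun m => m.Coprime Q ∧ m.Coprime (primesProdBelow z)),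
        (A (p₁ * m) : ℝ) := by
  have hM₁' : 1 ≤ M₁ := by omega
  set Lg : ℝ := Real.log ((M₂ : ℝ) / ((M₁ - 1 : ℕ) : ℝ)) with hLg
  have hLg0 : 0 ≤ Lg := by
    rw [hLg]
    apply Real.log_nonneg
    rw [le_div_iff₀ (by exact_mod_cast (show 0 < M₁ - 1 by omega))]
    rw [one_mul]; exact_mod_cast (show M₁ - 1 ≤ M₂ by omega)
  have h𝔠 : 0 < cMain χ Q := const_pos ha hirr hχ hQ
  set X : ℝ := X₀ * ((rhoG a b c p₁ : ℝ) / p₁) * cMain χ Q * Lg with hX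
  have hXnn : 0 ≤ X := by rw [hX]; positivity
  set 𝒜 := mSeq a b c Q p₁ M₁ A X with h𝒜
  have hdim' : HasSieveDimension 𝒜.density 1 K := hdim
  have hFL := SieveSequence.fundamental_lemma_explicit hdim' one_pos hz hzD (x := (M₂ : ℝ))
    (show 0 ≤ 𝒜.size (M₂ : ℝ) from hXnn)
  have hsize : 𝒜.size (M₂ : ℝ) = X := rfl
  have hV : 𝒜.densityProduct (primesProdBelow z) =
      ∏ p ∈ Nat.primesBelow ⌈z⌉₊, (1 - rhoDensity a b c Q p) := by
    rw [SieveSequence.densityProduct, primeFactors_primesProdBelow]; rfl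
  have hsift : 𝒜.sifted (M₂ : ℝ) (primesProdBelow z) =
      ∑ m ∈ (Finset.Icc M₁ M₂).filter (fun m => m.Coprime Q ∧ m.Coprime (primesProdBelow z)),
        (A (p₁ * m) : ℝ) := sifted_mSeq a b c Q p₁ hM₁' M₂ A X (primesProdBelow z)
  rw [hsize, hV, hsift] at hFL
  -- the remainder sum: drop the `d` with `(d, Q) > 1` and bound the rest
  have hR : ∑ d ∈ (primesProdBelow z).divisors.filter (fun d : ℕ => (d : ℝ) ≤ D),
      |𝒜.remainder d (M₂ : ℝ)| ≤
      ∑ d ∈ ((primesProdBelow z).divisors.filter (fun d : ℕ => (d : ℝ) ≤ D)).filter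
          (fun d : ℕ => d.Coprime Q),
        (|∑ m ∈ (Finset.Ioc (M₁ - 1) M₂).filter (fun m => d ∣ m ∧ m.Coprime Q),
            ((A (p₁ * m) : ℝ) - X₀ * (rhoG a b c (p₁ * m) : ℝ) / ((p₁ * m : ℕ) : ℝ))| +
          X₀ / p₁ * (8 * (1 + Real.log M₂) ^ 2 / p₁) +
          X₀ * ((rhoG a b c p₁ : ℝ) / p₁) *
            (2 * |cMain χ Q| / ((M₁ - 1 : ℕ) : ℝ) +
              4 * (kWin χ Q M₂ * (#d.divisors : ℝ) ^ 3) / Real.sqrt ((M₁ - 1 : ℕ) : ℝ))) := by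
    rw [← Finset.sum_filter_add_sum_filter_not _ (fun d : ℕ => d.Coprime Q)]
    have hzero : ∑ d ∈ ((primesProdBelow z).divisors.filter (fun d : ℕ => (d : ℝ) ≤ D)).filter
        (fun d : ℕ => ¬ d.Coprime Q), |𝒜.remainder d (M₂ : ℝ)| = 0 := by
      refine Finset.sum_eq_zero fun d hd => ?_
      rw [Finset.mem_filter, Finset.mem_filter] at hd
      have hd0 : d ≠ 0 := Nat.ne_of_gt (Nat.pos_of_mem_divisors hd.1.1)
      rw [h𝒜, remainder_mSeq_eq_zero a b c Q p₁ hM₁' A X hd0 hd.2 M₂, abs_zero]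
    rw [hzero, add_zero]
    refine Finset.sum_le_sum fun d hd => ?_
    rw [Finset.mem_filter, Finset.mem_filter] at hd
    have hdsq : Squarefree d :=
      (squarefree_primesProdBelow z).squarefree_of_dvd (Nat.dvd_of_mem_divisors hd.1.1)
    rw [h𝒜, hX, hLg]
    exact abs_remainder_mSeq_le ha hirr hχ hQ hQ2 hQa hQΔ hpow hp₁ hp₁Q A hX₀ hM₁ hM hdsq hd.2
  have habs := (abs_sub_le_iff.mp hFL).2
  -- `X V - S ≤ F X V e^{-s} + R`
  have hflnn : 0 ≤ SieveSequence.flConst 1 K :=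
    (SieveSequence.flConst_pos zero_le_one (lt_of_lt_of_le one_pos hdim.one_le)).le
  nlinarith [habs, hR, hflnn]

/-- **Re-indexing the type-I remainder by `n = p₁ m`** (`p₁ ∤ Q`): the `m`-sum over
`U < m ≤ V`, `d ∣ m`, `(m, Q) = 1` of `f(p₁ m)` is the `n`-sum over `p₁U < n ≤ p₁V`, `p₁d ∣ n`,
`(n, Q) = 1` of `f(n)`. [folklore] -/
theorem sum_filter_dvd_coprime_reindex {p₁ : ℕ} (hp₁ : 0 < p₁) (hp₁Q : p₁.Coprime Q)
    (d U V : ℕ) (f : ℕ → ℝ) :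
    ∑ m ∈ (Finset.Ioc U V).filter (fun m => d ∣ m ∧ m.Coprime Q), f (p₁ * m) =
      ∑ n ∈ (Finset.Ioc (p₁ * U) (p₁ * V)).filter (fun n => p₁ * d ∣ n ∧ n.Coprime Q), f n := by
  refine Finset.sum_nbij' (fun m => p₁ * m) (fun n => n / p₁) ?_ ?_ ?_ ?_ ?_
  · intro m hm
    rw [Finset.mem_filter, Finset.mem_Ioc] at hm ⊢
    refine ⟨⟨Nat.mul_lt_mul_of_pos_left hm.1.1 hp₁, Nat.mul_le_mul_left _ hm.1.2⟩,
      mul_dvd_mul_left _ hm.2.1, Nat.Coprime.mul_left hp₁Q hm.2.2⟩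
  · intro n hn
    rw [Finset.mem_filter, Finset.mem_Ioc] at hn ⊢
    obtain ⟨k, hk⟩ := (dvd_mul_right p₁ d).trans hn.2.1
    subst hk
    rw [Nat.mul_div_cancel_left _ hp₁]
    refine ⟨⟨Nat.lt_of_mul_lt_mul_left hn.1.1, Nat.le_of_mul_le_mul_left hn.1.2 hp₁⟩,
      (Nat.mul_dvd_mul_iff_left hp₁).mp hn.2.1,
      Nat.Coprime.coprime_dvd_left (dvd_mul_left k p₁) hn.2.2⟩
  · intro m hm
    exact Nat.mul_div_cancel_left _ hp₁
  · intro n hn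
    rw [Finset.mem_filter] at hn
    obtain ⟨k, hk⟩ := (dvd_mul_right p₁ d).trans hn.2.1
    rw [hk, Nat.mul_div_cancel_left _ hp₁]
  · intro m hm
    rfl

end SieveStep

end PropertySTypeI


namespace PropertySTypeI

open Polynomial Finset Iwaniec1978 RhoLogSums ArithmeticFunction
open scoped NumberTheorySymbols

/-! ### E2-G. Multiplicity of the certificates; Mertens-type sums over the primes `p₁` -/

section Multiplicity

/-- **Counting with multiplicity**: if every `t ∈ T` has `0 < F(t) < min(L^{J₁+1}, Z^{J₂+1})`,
the `p₁ ∈ Pr` are primes `≥ L ≥ 2`, the `m ∈ ℳ(p₁)` are prime to a number `Pz` divisible by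
every prime `< Z`, and `p₁ m ∣ F(t)` certifies that `t` is good, then
`∑_{p₁} ∑_{m ∈ ℳ(p₁)} #{t ∈ T : p₁ m ∣ F(t)} ≤ J₁ 2^{J₂} · #{t ∈ T good}`
(each good `t` is counted at most `J₁ · 2^{J₂}` times: at most `J₁` primes `≥ L` and at most
`2^{J₂}` `Z`-rough divisors divide `F(t)`). [folklore] -/
theorem sum_sum_card_le_mul_card_good {T Pr : Finset ℕ} {ℳ : ℕ → Finset ℕ} {F : ℕ → ℕ}
    {good : ℕ → Prop} [DecidablePred good] {L Z Pz J₁ J₂ : ℕ} (hL : 2 ≤ L)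
    (hPz : ∀ p : ℕ, p.Prime → p < Z → p ∣ Pz)
    (hPr : ∀ p₁ ∈ Pr, p₁.Prime ∧ L ≤ p₁) (hℳ : ∀ p₁ ∈ Pr, ∀ m ∈ ℳ p₁, m.Coprime Pz)
    (hF : ∀ t ∈ T, 0 < F t ∧ F t < L ^ (J₁ + 1) ∧ F t < Z ^ (J₂ + 1))
    (hcert : ∀ t ∈ T, ∀ p₁ ∈ Pr, ∀ m ∈ ℳ p₁, p₁ * m ∣ F t → good t) :
    ∑ p₁ ∈ Pr, ∑ m ∈ ℳ p₁, (T.filter (fun t => p₁ * m ∣ F t)).card ≤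
      J₁ * 2 ^ J₂ * (T.filter good).card := by
  classical
  have hswap : ∑ p₁ ∈ Pr, ∑ m ∈ ℳ p₁, (T.filter (fun t => p₁ * m ∣ F t)).card =
      ∑ t ∈ T, ∑ p₁ ∈ Pr, ((ℳ p₁).filter (fun m => p₁ * m ∣ F t)).card := by
    simp only [Finset.card_filter]
    calc ∑ p₁ ∈ Pr, ∑ m ∈ ℳ p₁, ∑ t ∈ T, (if p₁ * m ∣ F t then 1 else 0)
        = ∑ p₁ ∈ Pr, ∑ t ∈ T, ∑ m ∈ ℳ p₁, (if p₁ * m ∣ F t then 1 else 0) :=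
          Finset.sum_congr rfl fun p₁ _ => Finset.sum_comm
      _ = ∑ t ∈ T, ∑ p₁ ∈ Pr, ∑ m ∈ ℳ p₁, (if p₁ * m ∣ F t then 1 else 0) := Finset.sum_comm
  rw [hswap]
  have hpt : ∀ t ∈ T, ∑ p₁ ∈ Pr, ((ℳ p₁).filter (fun m => p₁ * m ∣ F t)).card ≤
      if good t then J₁ * 2 ^ J₂ else 0 := by
    intro t ht
    obtain ⟨hF0, hFL, hFZ⟩ := hF t ht
    by_cases hex : ∃ p₁ ∈ Pr, ∃ m ∈ ℳ p₁, p₁ * m ∣ F t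
    · obtain ⟨p₁, hp₁, m, hm, hdvd⟩ := hex
      rw [if_pos (hcert t ht p₁ hp₁ m hm hdvd)]
      -- each `p₁ ∣ F t` contributes at most `2^{J₂}`, the others nothing
      have hinner : ∀ p₁ ∈ Pr, ((ℳ p₁).filter (fun m => p₁ * m ∣ F t)).card ≤
          if p₁ ∣ F t then 2 ^ J₂ else 0 := by
        intro p₁ hp₁
        split_ifs with hpF
        · calc ((ℳ p₁).filter (fun m => p₁ * m ∣ F t)).card
              ≤ (((F t).divisors).filter (fun m => m.Coprime Pz)).card := by
                refine Finset.card_le_card fun m hm' => ?_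
                rw [Finset.mem_filter] at hm' ⊢
                exact ⟨Nat.mem_divisors.mpr ⟨(dvd_mul_left m p₁).trans hm'.2, hF0.ne'⟩,
                  hℳ p₁ hp₁ m hm'.1⟩
            _ ≤ 2 ^ J₂ := card_rough_divisors_le hPz J₂ (F t) hF0 hFZ
        · have : (ℳ p₁).filter (fun m => p₁ * m ∣ F t) = ∅ :=
            Finset.filter_false_of_mem fun m _ h => hpF ((dvd_mul_right p₁ m).trans h)
          rw [this, Finset.card_empty]
      calc ∑ p₁ ∈ Pr, ((ℳ p₁).filter (fun m => p₁ * m ∣ F t)).card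
          ≤ ∑ p₁ ∈ Pr, (if p₁ ∣ F t then 2 ^ J₂ else 0) := Finset.sum_le_sum hinner
        _ = (Pr.filter (fun p₁ => p₁ ∣ F t)).card * 2 ^ J₂ := by
            rw [← Finset.sum_filter, Finset.sum_const, smul_eq_mul]
        _ ≤ J₁ * 2 ^ J₂ := by
            refine Nat.mul_le_mul_right _ (card_primes_dvd_le hL J₁ hF0 hFL _ fun p hp => ?_)
            rw [Finset.mem_filter] at hp
            exact ⟨(hPr p hp.1).1, (hPr p hp.1).2, hp.2⟩
    · push Not at hex
      have : ∑ p₁ ∈ Pr, ((ℳ p₁).filter (fun m => p₁ * m ∣ F t)).card = 0 :=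
        Finset.sum_eq_zero fun p₁ hp₁ => Finset.card_eq_zero.mpr
          (Finset.filter_false_of_mem fun m hm => hex p₁ hp₁ m hm)
      rw [this]
      exact Nat.zero_le _
  calc ∑ t ∈ T, ∑ p₁ ∈ Pr, ((ℳ p₁).filter (fun m => p₁ * m ∣ F t)).card
      ≤ ∑ t ∈ T, (if good t then J₁ * 2 ^ J₂ else 0) := Finset.sum_le_sum hpt
    _ = J₁ * 2 ^ J₂ * (T.filter good).card := by
        rw [← Finset.sum_filter, Finset.sum_const, smul_eq_mul, mul_comm]

end Multiplicity

section PrimeSums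

variable {a b c : ℤ}

/-- `∑_{N < n ≤ M} 1/n² ≤ 1/N` (`N ≥ 1`; telescoping `1/n² ≤ 1/(n−1) − 1/n`). [folklore] -/
theorem sum_Ioc_inv_sq_le {N : ℕ} (hN : 1 ≤ N) (M : ℕ) :
    ∑ n ∈ Finset.Ioc N M, 1 / (n : ℝ) ^ 2 ≤ 1 / (N : ℝ) := by
  have key : ∀ M : ℕ, N ≤ M →
      ∑ n ∈ Finset.Ioc N M, 1 / (n : ℝ) ^ 2 ≤ 1 / (N : ℝ) - 1 / (M : ℝ) := by
    intro M hM
    induction M, hM using Nat.le_induction with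
    | base => simp
    | succ M hM ih =>
        rw [Finset.sum_Ioc_succ_top (by omega)]
        have hM0 : (0 : ℝ) < M := by exact_mod_cast (show 0 < M by omega)
        have h1 : 1 / ((M + 1 : ℕ) : ℝ) ^ 2 ≤ 1 / (M : ℝ) - 1 / ((M + 1 : ℕ) : ℝ) := by
          push_cast
          rw [div_sub_div _ _ hM0.ne' (by positivity),
            div_le_div_iff₀ (by positivity) (by positivity)]
          nlinarith
        linarith
  rcases le_or_gt N M with hNM | hMN
  · have := key M hNM
    have : (0 : ℝ) ≤ 1 / (M : ℝ) := by positivity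
    linarith
  · rw [Finset.Ioc_eq_empty (by omega), Finset.sum_empty]
    positivity

/-- The set of primes `p₁` with `Y₁ < p₁ ≤ Y₂`. [folklore] -/
def primesIoc (Y₁ Y₂ : ℝ) : Finset ℕ := (Nat.primesLE ⌊Y₂⌋₊).filter (fun p : ℕ => Y₁ < (p : ℝ))

/-- Membership in `primesIoc`. [folklore] -/
theorem mem_primesIoc {Y₁ Y₂ : ℝ} {p : ℕ} :
    p ∈ primesIoc Y₁ Y₂ ↔ p.Prime ∧ Y₁ < (p : ℝ) ∧ p ≤ ⌊Y₂⌋₊ := by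
  rw [primesIoc, Finset.mem_filter, Nat.mem_primesLE]
  tauto

/-- `∑_{Y₁ < p ≤ Y₂} 1/p² ≤ 1/⌊Y₁⌋₊` for `Y₁ ≥ 1`. [folklore] -/
theorem sum_primesIoc_inv_sq_le {Y₁ Y₂ : ℝ} (hY₁ : 1 ≤ Y₁) :
    ∑ p ∈ primesIoc Y₁ Y₂, 1 / (p : ℝ) ^ 2 ≤ 1 / (⌊Y₁⌋₊ : ℝ) := by
  have hsub : primesIoc Y₁ Y₂ ⊆ Finset.Ioc ⌊Y₁⌋₊ ⌊Y₂⌋₊ := by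
    intro p hp
    rw [mem_primesIoc] at hp
    rw [Finset.mem_Ioc]
    refine ⟨?_, hp.2.2⟩
    exact (Nat.floor_lt (by linarith)).mpr hp.2.1
  have h1 : 1 ≤ ⌊Y₁⌋₊ := Nat.le_floor (by exact_mod_cast hY₁)
  refine (Finset.sum_le_sum_of_subset_of_nonneg hsub fun _ _ _ => by positivity).trans ?_
  exact sum_Ioc_inv_sq_le h1 _

/-- `∑_{Y₁ < p ≤ Y₂} ρ_G(p)/p ≤ Y₂ + 1` (trivially, `ρ_G(p) ≤ p`). [folklore] -/
theorem sum_primesIoc_rhoG_div_le (a b c : ℤ) {Y₁ Y₂ : ℝ} (hY₂ : 0 ≤ Y₂) :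
    ∑ p ∈ primesIoc Y₁ Y₂, (rhoG a b c p : ℝ) / p ≤ Y₂ + 1 := by
  have hterm : ∀ p ∈ primesIoc Y₁ Y₂, (rhoG a b c p : ℝ) / p ≤ 1 := by
    intro p hp
    have hp' := (mem_primesIoc.mp hp).1
    have hp0 : (0 : ℝ) < p := by exact_mod_cast hp'.pos
    rw [div_le_one hp0]
    exact_mod_cast rhoG_le_self a b c p
  calc ∑ p ∈ primesIoc Y₁ Y₂, (rhoG a b c p : ℝ) / p ≤ ∑ p ∈ primesIoc Y₁ Y₂, (1 : ℝ) :=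
        Finset.sum_le_sum hterm
    _ = (primesIoc Y₁ Y₂).card := by rw [Finset.sum_const, nsmul_eq_mul, mul_one]
    _ ≤ (Finset.range (⌊Y₂⌋₊ + 1)).card := by
        exact_mod_cast Finset.card_le_card fun p hp => by
          rw [Finset.mem_range]; have := (mem_primesIoc.mp hp).2.2; omega
    _ = ⌊Y₂⌋₊ + 1 := by rw [Finset.card_range]; push_cast; ring
    _ ≤ Y₂ + 1 := by linarith [Nat.floor_le hY₂]

/-- **Mertens for `ρ_G` on a window of primes** (any irreducible `G`, `a > 0`): there is
`C = C(G)` with `∑_{Y₁ < p ≤ Y₂} ρ_G(p) log p/p ≥ log Y₂ − log Y₁ − C` for `1 ≤ Y₁ ≤ Y₂`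
(the tree's `rhoMertensStrongG` for the odd variant `G'`, and `ρ_G = ρ_{G'}` off the primes of
`2aa'`). [folklore] -/
theorem exists_sum_primesIoc_rhoG_log_div_ge (ha : 0 < a) (hirr : Irreducible (quadPoly a b c)) :
    ∃ C : ℝ, ∀ Y₁ Y₂ : ℝ, 1 ≤ Y₁ → Y₁ ≤ Y₂ →
      Real.log Y₂ - Real.log Y₁ - C ≤
        ∑ p ∈ primesIoc Y₁ Y₂, (rhoG a b c p : ℝ) * Real.log p / p := by
  obtain ⟨a', b', c', ha', hc', hirr', hΔ⟩ := exists_odd_variant ha hirr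
  obtain ⟨C₀, hC₀⟩ := rhoMertensStrongG ha' hc' hirr'
  set B : Finset ℕ := (2 * a.natAbs * a'.natAbs).primeFactors with hB
  have hB0 : 2 * a.natAbs * a'.natAbs ≠ 0 :=
    mul_ne_zero (mul_ne_zero two_ne_zero (Int.natAbs_ne_zero.mpr ha.ne'))
      (Int.natAbs_ne_zero.mpr ha'.ne')
  set f : ℕ → ℝ := fun p => (rhoG a b c p : ℝ) * Real.log p / p with hf
  set f' : ℕ → ℝ := fun p => (rhoG a' b' c' p : ℝ) * Real.log p / p with hf'
  have hf'nn : ∀ p : ℕ, 0 ≤ f' p := fun p => by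
    rw [hf']; dsimp only
    rcases Nat.eq_zero_or_pos p with h0 | hp
    · subst h0; simp
    · have : (0 : ℝ) ≤ Real.log p := Real.log_nonneg (by exact_mod_cast hp)
      positivity
  have hfnn : ∀ p : ℕ, 0 ≤ f p := fun p => by
    rw [hf]; dsimp only
    rcases Nat.eq_zero_or_pos p with h0 | hp
    · subst h0; simp
    · have : (0 : ℝ) ≤ Real.log p := Real.log_nonneg (by exact_mod_cast hp)
      positivity
  refine ⟨2 * C₀ + ∑ p ∈ B, f' p, fun Y₁ Y₂ hY₁ hY₁₂ => ?_⟩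
  set Pr := primesIoc Y₁ Y₂ with hPr
  -- (i) `∑_Pr f ≥ ∑_{Pr, p ∉ B} f = ∑_{Pr, p ∉ B} f'`
  have h1 : ∑ p ∈ Pr.filter (fun p => p ∉ B), f' p ≤ ∑ p ∈ Pr, f p := by
    have heq : ∑ p ∈ Pr.filter (fun p => p ∉ B), f' p = ∑ p ∈ Pr.filter (fun p => p ∉ B), f p := by
      refine Finset.sum_congr rfl fun p hp => ?_
      rw [Finset.mem_filter] at hp
      have hpr : p.Prime := (mem_primesIoc.mp hp.1).1
      have hpB' : ¬ p ∣ 2 * a.natAbs * a'.natAbs := fun h =>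
        hp.2 (Nat.mem_primeFactors.mpr ⟨hpr, h, hB0⟩)
      have hp2' : p ≠ 2 := by
        intro h; subst h
        exact hpB' (dvd_mul_of_dvd_left (dvd_mul_right 2 _) _)
      have hpa : ¬ (p : ℤ) ∣ a := fun h =>
        hpB' (dvd_mul_of_dvd_left (Dvd.dvd.mul_left (Int.ofNat_dvd_left.mp h) 2) _)
      have hpa' : ¬ (p : ℤ) ∣ a' := fun h =>
        hpB' (Dvd.dvd.mul_left (Int.ofNat_dvd_left.mp h) _)
      rw [hf, hf']; dsimp only
      rw [rhoG_eq_of_disc_eq ha hirr ha' hirr' hΔ hpr hp2' hpa hpa']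
    rw [heq]
    exact Finset.sum_le_sum_of_subset_of_nonneg (Finset.filter_subset _ _) fun p _ _ => hfnn p
  -- (ii) `∑_{Pr, p ∉ B} f' ≥ ∑_Pr f' − ∑_B f'`
  have h2 : ∑ p ∈ Pr, f' p - ∑ p ∈ B, f' p ≤ ∑ p ∈ Pr.filter (fun p => p ∉ B), f' p := by
    rw [← Finset.sum_filter_add_sum_filter_not Pr (fun p => p ∈ B)]
    have : ∑ p ∈ Pr.filter (fun p => p ∈ B), f' p ≤ ∑ p ∈ B, f' p :=
      Finset.sum_le_sum_of_subset_of_nonneg (fun p hp => (Finset.mem_filter.mp hp).2)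
        fun p _ _ => hf'nn p
    linarith
  -- (iii) `∑_Pr f' = R'(Y₂) − R'(Y₁)`
  have h3 : ∑ p ∈ Pr, f' p = rhoLogSumG a' b' c' Y₂ - rhoLogSumG a' b' c' Y₁ := by
    have hsplit := Finset.sum_filter_add_sum_filter_not (Nat.primesLE ⌊Y₂⌋₊)
      (fun p : ℕ => Y₁ < (p : ℝ)) f'
    have hcompl : (Nat.primesLE ⌊Y₂⌋₊).filter (fun p : ℕ => ¬ Y₁ < (p : ℝ)) = Nat.primesLE ⌊Y₁⌋₊ := by
      ext p
      rw [Finset.mem_filter, Nat.mem_primesLE, Nat.mem_primesLE, not_lt]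
      constructor
      · rintro ⟨⟨-, hp⟩, hle⟩
        exact ⟨Nat.le_floor hle, hp⟩
      · rintro ⟨hle, hp⟩
        refine ⟨⟨hle.trans (Nat.floor_mono hY₁₂), hp⟩, ?_⟩
        exact (show (p : ℝ) ≤ ⌊Y₁⌋₊ by exact_mod_cast hle).trans (Nat.floor_le (by linarith))
    rw [hcompl] at hsplit
    rw [rhoLogSumG, rhoLogSumG, hPr, primesIoc]
    rw [← hsplit]
    ring
  have h4 := hC₀ Y₂ (hY₁.trans hY₁₂)
  have h5 := hC₀ Y₁ hY₁
  rw [abs_le] at h4 h5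
  have : ∑ p ∈ Pr, f p = ∑ p ∈ primesIoc Y₁ Y₂, (rhoG a b c p : ℝ) * Real.log p / p := rfl
  linarith [h4.1, h5.2]

end PrimeSums

end PropertySTypeI


namespace PropertySTypeI

open Polynomial Finset Iwaniec1978 RhoLogSums ArithmeticFunction
open scoped NumberTheorySymbols ArithmeticFunction.Moebius Classical
open Literature.NumberTheory.LFunctions (DirichletAbel.reChar RealChar.charDivisorDensity)

/-! ### E2-H. The dyadic count: certificates, sieve, and the error budget -/

section Eval

variable {a b c g : ℤ}

/-- `(g·G)(t) = g (a t² + b t + c)`. [folklore] -/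
theorem eval_C_mul_quadPoly (g a b c t : ℤ) :
    (C g * quadPoly a b c).eval t = g * (a * t ^ 2 + b * t + c) := by
  rw [eval_mul, eval_C, eval_quadPoly]

/-- `|P(t)| ≤ g(|a| + |b| + |c|) t²` for `t ≥ 1` (`P = g·(aX² + bX + c)`, `g > 0`). [folklore] -/
theorem natAbs_eval_le (hg : 0 < g) (a b c : ℤ) {t : ℕ} (ht : 1 ≤ t) :
    ((((C g * quadPoly a b c).eval (t : ℤ)).natAbs : ℕ) : ℝ) ≤
      ((g * (|a| + |b| + |c|) : ℤ) : ℝ) * (t : ℝ) ^ 2 := by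
  rw [eval_C_mul_quadPoly, Nat.cast_natAbs]
  push_cast
  have ht' : (1 : ℝ) ≤ t := by exact_mod_cast ht
  have hg' : (0 : ℝ) < g := by exact_mod_cast hg
  rw [abs_mul, abs_of_pos hg', mul_assoc]
  refine mul_le_mul_of_nonneg_left ?_ hg'.le
  calc |(a : ℝ) * (t : ℝ) ^ 2 + b * t + c| ≤ |(a : ℝ) * (t : ℝ) ^ 2| + |(b : ℝ) * t| + |(c : ℝ)| :=
        (abs_add_le _ _).trans (add_le_add (abs_add_le _ _) le_rfl)
    _ = |(a : ℝ)| * (t : ℝ) ^ 2 + |(b : ℝ)| * t + |(c : ℝ)| := by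
        rw [abs_mul, abs_mul, abs_of_nonneg (by positivity : (0 : ℝ) ≤ (t : ℝ) ^ 2),
          abs_of_nonneg (by positivity : (0 : ℝ) ≤ (t : ℝ))]
    _ ≤ |(a : ℝ)| * (t : ℝ) ^ 2 + |(b : ℝ)| * (t : ℝ) ^ 2 + |(c : ℝ)| * (t : ℝ) ^ 2 := by
        have h1 : (t : ℝ) ≤ (t : ℝ) ^ 2 := by nlinarith
        have h2 : (1 : ℝ) ≤ (t : ℝ) ^ 2 := by nlinarith
        nlinarith [abs_nonneg (b : ℝ), abs_nonneg (c : ℝ)]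
    _ = (|(a : ℝ)| + |(b : ℝ)| + |(c : ℝ)|) * (t : ℝ) ^ 2 := by ring

/-- `P(t) > 0` for `t > |b| + |c|` (`a, g ≥ 1`). [folklore] -/
theorem eval_pos (ha : 0 < a) (hg : 0 < g) (b c : ℤ) {t : ℕ} (ht : |b| + |c| < (t : ℤ)) :
    0 < (C g * quadPoly a b c).eval (t : ℤ) := by
  rw [eval_C_mul_quadPoly]
  refine mul_pos hg ?_
  have ht0 : (0 : ℤ) ≤ t := by positivity
  have h1 : -|b| * (t : ℤ) ≤ b * t := by nlinarith [neg_abs_le b]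
  have h2 : -|c| ≤ c := neg_abs_le c
  have h3 : (t : ℤ) ^ 2 ≤ a * (t : ℤ) ^ 2 := by nlinarith
  have hb0 : 0 ≤ |b| := abs_nonneg b
  have hc0 : 0 ≤ |c| := abs_nonneg c
  nlinarith

end Eval

section BadModulus

/-- **The bad modulus attached to `q`**: the radical of `B₀ q`. [folklore] -/
def badMod (B₀ q : ℕ) : ℕ := ∏ p ∈ (B₀ * q).primeFactors, p

/-- The bad modulus is squarefree, its prime factors are exactly the primes of `B₀ q`, and they
are all `≤ B₀ q`. [folklore] -/
theorem badMod_spec {B₀ q : ℕ} (hB₀ : B₀ ≠ 0) (hq : q ≠ 0) :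
    Squarefree (badMod B₀ q) ∧ (∀ p : ℕ, p.Prime → (p ∣ badMod B₀ q ↔ p ∣ B₀ * q)) ∧
      (∀ p ∈ (badMod B₀ q).primeFactors, p ≤ B₀ * q) := by
  have hn : B₀ * q ≠ 0 := mul_ne_zero hB₀ hq
  refine ⟨squarefree_prod_primes fun p hp => Nat.prime_of_mem_primeFactors hp,
    fun p hp => prime_dvd_rad_iff hn hp, fun p hp => ?_⟩
  have hp' := Nat.prime_of_mem_primeFactors hp
  exact Nat.le_of_dvd (Nat.pos_of_ne_zero hn)
    ((prime_dvd_rad_iff hn hp').mp (Nat.dvd_of_mem_primeFactors hp))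

end BadModulus

section Core

variable {a b c g : ℤ} {Q : ℕ}
variable {χ : DirichletCharacter ℂ (4 * (b ^ 2 - 4 * a * c).natAbs)}

set_option maxHeartbeats 1000000 in
/-- **The dyadic count from type-I information — the core inequality at one height `y`.**
All "`y` large" conditions are explicit hypotheses; `dyadic_lower_bound` discharges them.
[folklore] -/
theorem dyadic_core (ha : 0 < a) (hirr : Irreducible (quadPoly a b c))
    (hχ : ∀ n : ℕ, Odd n → χ n = (J(b ^ 2 - 4 * a * c | n) : ℂ))
    [NeZero (4 * (b ^ 2 - 4 * a * c).natAbs)]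
    (hQ : Squarefree Q) (hQ2 : 2 ∣ Q) (hQa : ∀ p : ℕ, p.Prime → (p : ℤ) ∣ a → p ∣ Q)
    (hQΔ : ∀ p : ℕ, p.Prime → (p : ℤ) ∣ b ^ 2 - 4 * a * c → p ∣ Q)
    (hQg : ∀ p : ℕ, p.Prime → (p : ℤ) ∣ g → p ∣ Q)
    (hpow : ∀ p : ℕ, p.Prime → ¬ p ∣ Q → ∀ k : ℕ, 1 ≤ k → rhoG a b c (p ^ k) = rhoG a b c p)
    {Kd : ℝ} (hdim : HasSieveDimension (rhoDensity a b c Q) 1 Kd)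
    {c₀ : ℝ} (hc₀ : 0 < c₀)
    (hFV : ∀ z : ℝ, 2 < z → (∀ p ∈ Q.primeFactors, (p : ℝ) < z) →
      c₀ / Real.log z ≤ (∑ f ∈ Q.divisors, (μ f : ℝ) * RealChar.charDivisorDensity χ f) *
        ∏ p ∈ Nat.primesBelow ⌈z⌉₊, (1 - rhoDensity a b c Q p))
    {CM : ℝ} (hCM : ∀ Y₁ Y₂ : ℝ, 1 ≤ Y₁ → Y₁ ≤ Y₂ → Real.log Y₂ - Real.log Y₁ - CM ≤
      ∑ p ∈ primesIoc Y₁ Y₂, (rhoG a b c p : ℝ) * Real.log p / p)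
    {q : ℕ} (hq : 1 ≤ q) (b₀ : ℕ) {y : ℕ} {A₀ : ℕ} (hA₀ : 1 ≤ A₀)
    (hPle : ∀ t : ℕ, 1 ≤ t →
      ((((C g * quadPoly a b c).eval (t : ℤ)).natAbs : ℕ) : ℝ) ≤ (A₀ : ℝ) * (t : ℝ) ^ 2)
    (hPpos : ∀ t : ℕ, y < t → 0 < (C g * quadPoly a b c).eval (t : ℤ))
    {κ η δ θ ε₀ KT : ℝ} (hκ : 0 < κ) (hκ2 : 2 * κ ≤ 1) (hη : 0 < η) (hηδ : η ≤ δ)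
    (hθℓ : 2 * κ + δ ≤ θ)
    (hFl : SieveSequence.flConst 1 Kd * Real.exp (-(δ / η)) ≤ 1 / 2)
    {J₁ J₂ : ℕ} (hJ₁ : 1 ≤ J₁)
    (HT : ∀ ℓ N₁ N₂ : ℕ, 1 ≤ ℓ → (ℓ : ℝ) ≤ (y : ℝ) ^ θ → N₁ ≤ N₂ →
      (N₂ : ℝ) ≤ (y : ℝ) ^ (1 + θ) →
      |∑ n ∈ (Finset.Ioc N₁ N₂).filter (fun n => ℓ ∣ n ∧ n.Coprime Q),
          ((((Finset.Ioc y (2 * y)).filter (fun t : ℕ => t % q = b₀ % q ∧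
              (n : ℤ) ∣ (C g * quadPoly a b c).eval (t : ℤ))).card : ℝ) -
            (y : ℝ) / q * (polyRootCountMod ![C g * quadPoly a b c] n : ℝ) / n)| ≤
        KT * (y : ℝ) ^ (1 - ε₀))
    (hy2 : 2 ≤ y) (hz2 : 2 < (y : ℝ) ^ η)
    (hQz : ∀ p ∈ Q.primeFactors, (p : ℝ) < (y : ℝ) ^ η)
    (hQκ : ∀ p ∈ Q.primeFactors, (p : ℝ) ≤ (y : ℝ) ^ κ)
    (hA₀κ : 4 * (A₀ : ℝ) ^ 2 + 4 * A₀ ≤ (y : ℝ) ^ κ)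
    (hCMy : CM ≤ κ / 2 * Real.log y)
    (hFJ₁ : 4 * A₀ * y ^ 2 < (⌊(y : ℝ) ^ κ⌋₊ + 1) ^ (J₁ + 1))
    (hFJ₂ : 4 * A₀ * y ^ 2 < ⌈(y : ℝ) ^ η⌉₊ ^ (J₂ + 1))
    (hUmin : 1 ≤ ⌊2 * (A₀ : ℝ) * y / (y : ℝ) ^ (2 * κ)⌋₊)
    (hErrA : (y : ℝ) ^ (2 * κ) * (y : ℝ) ^ δ * (KT * (y : ℝ) ^ (1 - ε₀)) ≤
      (χ.LFunction 1).re * c₀ * κ / (24 * η) / 8 * ((y : ℝ) / q))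
    (hErrB : 8 * (1 + Real.log y) ^ 2 * (y : ℝ) ^ δ / ⌊(y : ℝ) ^ κ⌋₊ ≤
      (χ.LFunction 1).re * c₀ * κ / (24 * η) / 8)
    (hErrC : ((y : ℝ) ^ (2 * κ) + 1) * (y : ℝ) ^ δ *
        (2 * cMain χ Q / ⌊2 * (A₀ : ℝ) * y / (y : ℝ) ^ (2 * κ)⌋₊ +
          4 * (kWin χ Q y * (⌊(y : ℝ) ^ δ⌋₊ : ℝ) ^ 3) /
            Real.sqrt ⌊2 * (A₀ : ℝ) * y / (y : ℝ) ^ (2 * κ)⌋₊) ≤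
      (χ.LFunction 1).re * c₀ * κ / (24 * η) / 8) :
    (χ.LFunction 1).re * c₀ * κ / (24 * η) / (2 * ((J₁ * 2 ^ J₂ : ℕ) : ℝ)) * ((y : ℝ) / q) ≤
      (((Finset.Ioc y (2 * y)).filter (fun t : ℕ => t % q = b₀ % q ∧
        ∀ p : ℕ, p.Prime → (p : ℤ) ∣ (C g * quadPoly a b c).eval (t : ℤ) → p ≤ t)).card : ℝ) := by
  classical
  -- ## notation and basic facts
  set G : ℤ[X] := C g * quadPoly a b c with hG
  have hy2r : (2 : ℝ) ≤ (y : ℝ) := by exact_mod_cast hy2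
  have hy1 : (1 : ℝ) < (y : ℝ) := by linarith
  have hyr0 : (0 : ℝ) < (y : ℝ) := by linarith
  have hlogy : 0 < Real.log (y : ℝ) := Real.log_pos hy1
  have hq0 : (0 : ℝ) < q := by exact_mod_cast hq
  set X₀ : ℝ := (y : ℝ) / q with hX₀
  have hX₀0 : 0 < X₀ := div_pos hyr0 hq0
  set Lχ : ℝ := (χ.LFunction 1).re with hLχ
  have hΔ0 : b ^ 2 - 4 * a * c ≠ 0 := disc_ne_zero ha.ne' hirr
  have hLχ0 : 0 < Lχ := Literature.NumberTheory.LFunctions.Siegel.LFunction_one_re_pos χ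
    (chi_ne_one ha hirr hχ) (chi_sq_eq_one hΔ0 hχ)
  set c₃ : ℝ := Lχ * c₀ * κ / (24 * η) with hc₃
  have hc₃0 : 0 < c₃ := by rw [hc₃]; positivity
  set z : ℝ := (y : ℝ) ^ η with hz
  set D : ℝ := (y : ℝ) ^ δ with hD
  have hz2' : 2 ≤ z := hz2.le
  have hzD : z ≤ D := Real.rpow_le_rpow_of_exponent_le hy1.le hηδ
  have hδ : 0 < δ := lt_of_lt_of_le hη hηδ
  have hD0 : 0 < D := by rw [hD]; positivity
  have hlogz : Real.log z = η * Real.log (y : ℝ) := Real.log_rpow hyr0 η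
  have hlogD : Real.log D = δ * Real.log (y : ℝ) := Real.log_rpow hyr0 δ
  have hs : Real.log D / Real.log z = δ / η := by
    rw [hlogD, hlogz]; field_simp
  have hrpow_le : ∀ {u v : ℝ}, u ≤ v → (y : ℝ) ^ u ≤ (y : ℝ) ^ v := fun h =>
    Real.rpow_le_rpow_of_exponent_le hy1.le h
  have hyκ1 : 1 ≤ (y : ℝ) ^ κ := Real.one_le_rpow hy1.le hκ.le
  have hyκ0 : 0 < (y : ℝ) ^ κ := by linarith
  have hy2κ : (y : ℝ) ^ (2 * κ) ≤ (y : ℝ) := by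
    conv_rhs => rw [← Real.rpow_one (y : ℝ)]
    exact hrpow_le hκ2
  set 𝔠 : ℝ := cMain χ Q with h𝔠def
  have h𝔠 : 0 < 𝔠 := const_pos ha hirr hχ hQ
  set V : ℝ := ∏ p ∈ Nat.primesBelow ⌈z⌉₊, (1 - rhoDensity a b c Q p) with hVdef
  have hV0 : 0 < V := Finset.prod_pos fun p hp =>
    sub_pos.mpr (rhoDensity_prime_nonneg_lt_one a b c Q (Nat.prime_of_mem_primesBelow hp)).2
  -- the sets
  set Pr : Finset ℕ := primesIoc ((y : ℝ) ^ κ) ((y : ℝ) ^ (2 * κ)) with hPr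
  set T : Finset ℕ := (Finset.Ioc y (2 * y)).filter (fun t : ℕ => t % q = b₀ % q) with hT
  set F : ℕ → ℕ := fun t => (G.eval (t : ℤ)).natAbs with hF
  set A : ℕ → ℕ := fun n => (T.filter (fun t => n ∣ F t)).card with hA
  set U : ℕ → ℕ := fun p₁ => ⌊2 * (A₀ : ℝ) * y / p₁⌋₊ with hU
  set ℳ : ℕ → Finset ℕ := fun p₁ => (Finset.Icc (U p₁ + 1) y).filter
    (fun m => m.Coprime Q ∧ m.Coprime (primesProdBelow z)) with hℳ
  set good : ℕ → Prop := fun t => ∀ p : ℕ, p.Prime → (p : ℤ) ∣ G.eval (t : ℤ) → p ≤ t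
    with hgood
  have hA₀r : (1 : ℝ) ≤ A₀ := by exact_mod_cast hA₀
  -- ## facts about `p₁ ∈ Pr`
  have hPr_prime : ∀ p₁ ∈ Pr, p₁.Prime := fun p₁ hp => (mem_primesIoc.mp hp).1
  have hPr_gt : ∀ p₁ ∈ Pr, (y : ℝ) ^ κ < (p₁ : ℝ) := fun p₁ hp => (mem_primesIoc.mp hp).2.1
  have hPr_le : ∀ p₁ ∈ Pr, (p₁ : ℝ) ≤ (y : ℝ) ^ (2 * κ) := fun p₁ hp => by
    have h := (mem_primesIoc.mp hp).2.2
    exact (show (p₁ : ℝ) ≤ ⌊(y : ℝ) ^ (2 * κ)⌋₊ by exact_mod_cast h).trans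
      (Nat.floor_le (by positivity))
  have hPr_le_y : ∀ p₁ ∈ Pr, p₁ ≤ y := fun p₁ hp => by
    have := (hPr_le p₁ hp).trans hy2κ
    exact_mod_cast this
  have hPr_pos : ∀ p₁ ∈ Pr, (0 : ℝ) < p₁ := fun p₁ hp => by
    exact_mod_cast (hPr_prime p₁ hp).pos
  have hPr_notQ : ∀ p₁ ∈ Pr, ¬ p₁ ∣ Q := fun p₁ hp hdvd => by
    have := hQκ p₁ (Nat.mem_primeFactors.mpr ⟨hPr_prime p₁ hp, hdvd, hQ.ne_zero⟩)
    linarith [hPr_gt p₁ hp]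
  have hPr_A₀ : ∀ p₁ ∈ Pr, 4 * (A₀ : ℝ) ≤ p₁ ∧ 4 * (A₀ : ℝ) ^ 2 ≤ p₁ := fun p₁ hp => by
    have := hPr_gt p₁ hp
    have h0 := sq_nonneg (A₀ : ℝ)
    have h1 : (0 : ℝ) ≤ 4 * A₀ := by positivity
    constructor <;> linarith
  -- `U(p₁)`: `1 ≤ U`, `U + 1 ≤ y`, `U ≤ 2A₀y/p₁ < U + 1`, `log(y/U) ≥ ½ log p₁`
  have hU_le : ∀ p₁ ∈ Pr, (U p₁ : ℝ) ≤ 2 * (A₀ : ℝ) * y / p₁ := fun p₁ hp =>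
    Nat.floor_le (by have := hPr_pos p₁ hp; positivity)
  have hU_lt : ∀ p₁ ∈ Pr, 2 * (A₀ : ℝ) * y / p₁ < (U p₁ : ℝ) + 1 := fun p₁ hp =>
    Nat.lt_floor_add_one _
  have hU1 : ∀ p₁ ∈ Pr, 1 ≤ U p₁ := fun p₁ hp => by
    have hp0 := hPr_pos p₁ hp
    have hpy : (p₁ : ℝ) ≤ y := (hPr_le p₁ hp).trans hy2κ
    have h2 : (2 : ℝ) ≤ 2 * (A₀ : ℝ) * y / p₁ := by
      rw [le_div_iff₀ hp0]
      have : (p₁ : ℝ) ≤ A₀ * y := hpy.trans (le_mul_of_one_le_left hyr0.le hA₀r)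
      linarith
    exact Nat.le_floor (by rw [Nat.cast_one]; linarith)
  have hUy : ∀ p₁ ∈ Pr, U p₁ + 1 ≤ y := fun p₁ hp => by
    have hp0 := hPr_pos p₁ hp
    have h4 := (hPr_A₀ p₁ hp).1
    have h1 : 2 * (A₀ : ℝ) * y / p₁ ≤ (y : ℝ) / 2 := by
      rw [div_le_iff₀ hp0]
      have := mul_le_mul_of_nonneg_left h4 (by positivity : (0 : ℝ) ≤ (y : ℝ) / 2)
      linarith
    have h2 : (U p₁ : ℝ) + 1 ≤ y := by linarith [hU_le p₁ hp]
    exact_mod_cast h2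
  have hUmin_le : ∀ p₁ ∈ Pr, ⌊2 * (A₀ : ℝ) * y / (y : ℝ) ^ (2 * κ)⌋₊ ≤ U p₁ := fun p₁ hp => by
    refine Nat.floor_mono ?_
    exact div_le_div_of_nonneg_left (by positivity) (hPr_pos p₁ hp) (hPr_le p₁ hp)
  have hlogU : ∀ p₁ ∈ Pr, Real.log p₁ / 2 ≤ Real.log ((y : ℝ) / ((U p₁ + 1 - 1 : ℕ) : ℝ)) :=
    fun p₁ hp => by
    rw [Nat.add_sub_cancel]
    have hp0 := hPr_pos p₁ hp
    have hU0 : (0 : ℝ) < U p₁ := by exact_mod_cast hU1 p₁ hp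
    have h1 : (p₁ : ℝ) / (2 * A₀) ≤ (y : ℝ) / U p₁ := by
      rw [div_le_div_iff₀ (by positivity) hU0]
      have := hU_le p₁ hp
      rw [le_div_iff₀ hp0] at this
      linarith
    have h2 : Real.log ((p₁ : ℝ) / (2 * A₀)) ≤ Real.log ((y : ℝ) / U p₁) :=
      Real.log_le_log (by positivity) h1
    rw [Real.log_div hp0.ne' (by positivity)] at h2
    have h3 : 2 * Real.log (2 * (A₀ : ℝ)) ≤ Real.log p₁ := by
      rw [← Real.log_rpow (by positivity), Real.rpow_two]
      refine Real.log_le_log (by positivity) ?_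
      calc (2 * (A₀ : ℝ)) ^ 2 = 4 * (A₀ : ℝ) ^ 2 := by ring
        _ ≤ (p₁ : ℝ) := (hPr_A₀ p₁ hp).2
    linarith
  -- ## Step A: multiplicity
  have hL2 : 2 ≤ ⌊(y : ℝ) ^ κ⌋₊ + 1 := by
    have : 1 ≤ ⌊(y : ℝ) ^ κ⌋₊ := Nat.le_floor (by exact_mod_cast hyκ1)
    omega
  have hFt : ∀ t ∈ T, 0 < F t ∧ F t ≤ 4 * A₀ * y ^ 2 := by
    intro t ht
    rw [hT, Finset.mem_filter, Finset.mem_Ioc] at ht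
    have hpos := hPpos t ht.1.1
    refine ⟨Int.natAbs_pos.mpr hpos.ne', ?_⟩
    have h1 := hPle t (by omega)
    have h2 : (A₀ : ℝ) * (t : ℝ) ^ 2 ≤ ((4 * A₀ * y ^ 2 : ℕ) : ℝ) := by
      have : (t : ℝ) ≤ 2 * y := by exact_mod_cast ht.1.2
      have ht0 : (0 : ℝ) ≤ t := Nat.cast_nonneg t
      have ht2 : (t : ℝ) ^ 2 ≤ (2 * y) ^ 2 := pow_le_pow_left₀ ht0 this 2
      push_cast
      calc (A₀ : ℝ) * (t : ℝ) ^ 2 ≤ A₀ * (2 * y) ^ 2 := mul_le_mul_of_nonneg_left ht2 (by positivity)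
        _ = 4 * A₀ * (y : ℝ) ^ 2 := by ring
    exact_mod_cast h1.trans h2
  have hmult := sum_sum_card_le_mul_card_good (T := T) (Pr := Pr) (ℳ := ℳ) (F := F)
    (good := good) (L := ⌊(y : ℝ) ^ κ⌋₊ + 1) (Z := ⌈z⌉₊) (Pz := primesProdBelow z) (J₁ := J₁)
    (J₂ := J₂) hL2
    (fun p hp hpz => (dvd_primesProdBelow_iff hp z).mpr (Nat.lt_ceil.mp hpz))
    (fun p₁ hp => ⟨hPr_prime p₁ hp, (Nat.floor_lt (by positivity)).mpr (hPr_gt p₁ hp)⟩)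
    (fun p₁ _ m hm => by rw [hℳ, Finset.mem_filter] at hm; exact hm.2.2)
    (fun t ht => ⟨(hFt t ht).1, lt_of_le_of_lt (hFt t ht).2 hFJ₁,
      lt_of_le_of_lt (hFt t ht).2 hFJ₂⟩)
    (by
      intro t ht p₁ hp m hm hdvd
      rw [hT, Finset.mem_filter, Finset.mem_Ioc] at ht
      rw [hℳ, Finset.mem_filter, Finset.mem_Icc] at hm
      have hpos := hPpos t ht.1.1
      have hv : (G.eval (t : ℤ)) = ((F t : ℕ) : ℤ) := by
        rw [hF]; exact (Int.natAbs_of_nonneg hpos.le).symm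
      have hpt : p₁ ≤ t := (hPr_le_y p₁ hp).trans (by omega)
      have hm1 : 1 ≤ m := le_trans (by omega) hm.1.1
      have hmt : m ≤ t := hm.1.2.trans (by omega)
      refine smooth_of_certificate hpos hpt hm1 hmt (hPr_prime p₁ hp).one_lt.le ?_ ?_
      · rw [hv]; exact_mod_cast hdvd
      · have h1 := hPle t (by omega)
        have hpm : 2 * (A₀ : ℝ) * y ≤ (p₁ : ℝ) * m := by
          have := hU_lt p₁ hp
          rw [div_lt_iff₀ (hPr_pos p₁ hp)] at this
          have hm' : ((U p₁ : ℝ) + 1) ≤ m := by exact_mod_cast hm.1.1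
          have := mul_le_mul_of_nonneg_right hm' (hPr_pos p₁ hp).le
          linarith
        have ht2 : (t : ℝ) ≤ 2 * y := by exact_mod_cast ht.1.2
        have ht0 : (0 : ℝ) ≤ t := Nat.cast_nonneg t
        have h2 : (A₀ : ℝ) * (t : ℝ) ^ 2 ≤ ((p₁ * m * t : ℕ) : ℝ) := by
          have hAt : (A₀ : ℝ) * t ≤ A₀ * (2 * y) := mul_le_mul_of_nonneg_left ht2 (by positivity)
          push_cast
          calc (A₀ : ℝ) * (t : ℝ) ^ 2 = (A₀ * t) * t := by ring
            _ ≤ ((p₁ : ℝ) * m) * t := mul_le_mul_of_nonneg_right (by linarith) ht0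
            _ = (p₁ : ℝ) * m * t := by ring
        have h3 : ((F t : ℕ) : ℝ) ≤ ((p₁ * m * t : ℕ) : ℝ) := h1.trans h2
        rw [hv]; exact_mod_cast h3)
  have hmultR : ∑ p₁ ∈ Pr, ∑ m ∈ ℳ p₁, (A (p₁ * m) : ℝ) ≤
      ((J₁ * 2 ^ J₂ : ℕ) : ℝ) * ((T.filter good).card : ℝ) := by
    have := hmult
    rw [hA]
    exact_mod_cast this
  have hgoodset : T.filter good = (Finset.Ioc y (2 * y)).filter (fun t : ℕ => t % q = b₀ % q ∧
      ∀ p : ℕ, p.Prime → (p : ℤ) ∣ G.eval (t : ℤ) → p ≤ t) := by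
    rw [hT, Finset.filter_filter]
  -- ## Step B: the sieve, for each `p₁ ∈ Pr`
  set 𝒟 : Finset ℕ := ((primesProdBelow z).divisors.filter (fun d : ℕ => (d : ℝ) ≤ D)).filter
    (fun d : ℕ => d.Coprime Q) with h𝒟
  set E₁ : ℕ → ℝ := fun p₁ => ∑ d ∈ 𝒟,
    |∑ m ∈ (Finset.Ioc (U p₁ + 1 - 1) y).filter (fun m => d ∣ m ∧ m.Coprime Q),
        ((A (p₁ * m) : ℝ) - X₀ * (rhoG a b c (p₁ * m) : ℝ) / ((p₁ * m : ℕ) : ℝ))| with hE₁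
  set E₂ : ℕ → ℝ := fun p₁ => ∑ d ∈ 𝒟, X₀ / p₁ * (8 * (1 + Real.log y) ^ 2 / p₁) with hE₂
  set E₃ : ℕ → ℝ := fun p₁ => ∑ d ∈ 𝒟, X₀ * ((rhoG a b c p₁ : ℝ) / p₁) *
        (2 * |𝔠| / ((U p₁ + 1 - 1 : ℕ) : ℝ) +
          4 * (kWin χ Q y * (#d.divisors : ℝ) ^ 3) / Real.sqrt ((U p₁ + 1 - 1 : ℕ) : ℝ)) with hE₃
  set Mn : ℕ → ℝ := fun p₁ => X₀ * ((rhoG a b c p₁ : ℝ) / p₁) * 𝔠 *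
        Real.log ((y : ℝ) / ((U p₁ + 1 - 1 : ℕ) : ℝ)) * V with hMn
  have hstep : ∀ p₁ ∈ Pr, 1 / 2 * Mn p₁ - (E₁ p₁ + E₂ p₁ + E₃ p₁) ≤
      ∑ m ∈ ℳ p₁, (A (p₁ * m) : ℝ) := by
    intro p₁ hp
    have h := sieve_step ha hirr hχ hQ hQ2 hQa hQΔ hpow hdim (hPr_prime p₁ hp) (hPr_notQ p₁ hp) A
      hX₀0.le (M₁ := U p₁ + 1) (M₂ := y) (by have := hU1 p₁ hp; omega) (hUy p₁ hp) hz2' hzD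
      (χ := χ)
    rw [hs, Finset.sum_add_distrib, Finset.sum_add_distrib, ← h𝔠def, ← hVdef] at h
    have hXV : 0 ≤ Mn p₁ := by
      have hl : 0 ≤ Real.log ((y : ℝ) / ((U p₁ + 1 - 1 : ℕ) : ℝ)) :=
        le_trans (by
          have := Real.log_nonneg (show (1 : ℝ) ≤ p₁ by
            exact_mod_cast (hPr_prime p₁ hp).one_lt.le)
          positivity) (hlogU p₁ hp)
      rw [hMn]; positivity
    have hhalf : 1 / 2 ≤ 1 - SieveSequence.flConst 1 Kd * Real.exp (-(δ / η)) := by linarith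
    have := mul_le_mul_of_nonneg_left hhalf hXV
    simp only [hMn] at this hXV ⊢
    simp only [hℳ, hE₁, hE₂, hE₃]
    linarith
  -- ## Step C: the sum of the main terms over `p₁`
  have hmain : κ / 4 * Real.log (y : ℝ) ≤
      ∑ p₁ ∈ Pr, (rhoG a b c p₁ : ℝ) / p₁ * Real.log ((y : ℝ) / ((U p₁ + 1 - 1 : ℕ) : ℝ)) := by
    have h1 := hCM ((y : ℝ) ^ κ) ((y : ℝ) ^ (2 * κ)) hyκ1 (hrpow_le (by linarith))
    rw [Real.log_rpow hyr0, Real.log_rpow hyr0] at h1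
    have h2 : ∑ p ∈ Pr, (rhoG a b c p : ℝ) * Real.log p / p ≤
        2 * ∑ p₁ ∈ Pr, (rhoG a b c p₁ : ℝ) / p₁ *
          Real.log ((y : ℝ) / ((U p₁ + 1 - 1 : ℕ) : ℝ)) := by
      rw [Finset.mul_sum]
      refine Finset.sum_le_sum fun p₁ hp => ?_
      have hρ : (0 : ℝ) ≤ (rhoG a b c p₁ : ℝ) / p₁ := by
        have := hPr_pos p₁ hp; positivity
      have := mul_le_mul_of_nonneg_left (hlogU p₁ hp) hρ
      have heq : (rhoG a b c p₁ : ℝ) * Real.log p₁ / p₁ =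
          2 * ((rhoG a b c p₁ : ℝ) / p₁ * (Real.log p₁ / 2)) := by ring
      rw [heq]; linarith
    linarith
  -- ## Step D: the main-term constant, uniformly in `Q`
  have h𝔠V : Lχ * c₀ / (3 * (η * Real.log (y : ℝ))) ≤ 𝔠 * V := by
    have hFV' := hFV z hz2 (fun p hp => hQz p hp)
    rw [hlogz] at hFV'
    have hZ := one_third_le_zCoprime Q
    have hF0 : 0 ≤ c₀ / (η * Real.log (y : ℝ)) := by positivity
    have : 𝔠 * V = Lχ * zCoprime Q *
        ((∑ f ∈ Q.divisors, (μ f : ℝ) * RealChar.charDivisorDensity χ f) * V) := by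
      rw [h𝔠def, cMain]; ring
    rw [this]
    calc Lχ * c₀ / (3 * (η * Real.log (y : ℝ))) = Lχ * (1 / 3) * (c₀ / (η * Real.log (y : ℝ))) := by
          field_simp
      _ ≤ Lχ * zCoprime Q *
          ((∑ f ∈ Q.divisors, (μ f : ℝ) * RealChar.charDivisorDensity χ f) * V) := by
          refine mul_le_mul (mul_le_mul_of_nonneg_left hZ hLχ0.le) hFV' hF0 ?_
          exact mul_nonneg hLχ0.le (by linarith)
  -- ## Step E: the error budget
  have h𝒟card : (𝒟.card : ℝ) ≤ D := by
    have hsub : 𝒟 ⊆ Finset.Icc 1 ⌊D⌋₊ := by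
      intro d hd
      rw [h𝒟, Finset.mem_filter, Finset.mem_filter] at hd
      rw [Finset.mem_Icc]
      exact ⟨Nat.pos_of_mem_divisors hd.1.1, Nat.le_floor hd.1.2⟩
    calc (𝒟.card : ℝ) ≤ ((Finset.Icc 1 ⌊D⌋₊).card : ℝ) := by
          exact_mod_cast Finset.card_le_card hsub
      _ = ⌊D⌋₊ := by rw [Nat.card_Icc]; push_cast; ring
      _ ≤ D := Nat.floor_le hD0.le
  have hPrcard : (Pr.card : ℝ) ≤ (y : ℝ) ^ (2 * κ) := by
    have hsub : Pr ⊆ Finset.Icc 1 ⌊(y : ℝ) ^ (2 * κ)⌋₊ := by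
      intro p hp
      rw [Finset.mem_Icc]
      exact ⟨(hPr_prime p hp).one_lt.le, (mem_primesIoc.mp hp).2.2⟩
    calc (Pr.card : ℝ) ≤ ((Finset.Icc 1 ⌊(y : ℝ) ^ (2 * κ)⌋₊).card : ℝ) := by
          exact_mod_cast Finset.card_le_card hsub
      _ = ⌊(y : ℝ) ^ (2 * κ)⌋₊ := by rw [Nat.card_Icc]; push_cast; ring
      _ ≤ (y : ℝ) ^ (2 * κ) := Nat.floor_le (by positivity)
  -- (A) the type-I remainders
  have hT1 : ∀ p₁ ∈ Pr, ∀ d ∈ 𝒟,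
      |∑ m ∈ (Finset.Ioc (U p₁ + 1 - 1) y).filter (fun m => d ∣ m ∧ m.Coprime Q),
        ((A (p₁ * m) : ℝ) - X₀ * (rhoG a b c (p₁ * m) : ℝ) / ((p₁ * m : ℕ) : ℝ))| ≤
      max KT 0 * (y : ℝ) ^ (1 - ε₀) := by
    intro p₁ hp d hd
    rw [h𝒟, Finset.mem_filter, Finset.mem_filter] at hd
    have hp0 : 0 < p₁ := (hPr_prime p₁ hp).pos
    have hpQ : p₁.Coprime Q :=
      (Nat.Prime.coprime_iff_not_dvd (hPr_prime p₁ hp)).mpr (hPr_notQ p₁ hp)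
    rw [sum_filter_dvd_coprime_reindex hp0 hpQ d (U p₁ + 1 - 1) y
      (fun n => (A n : ℝ) - X₀ * (rhoG a b c n : ℝ) / (n : ℝ))]
    have hd1 : 1 ≤ d := Nat.pos_of_mem_divisors hd.1.1
    have hℓ : ((p₁ * d : ℕ) : ℝ) ≤ (y : ℝ) ^ θ := by
      push_cast
      calc (p₁ : ℝ) * d ≤ (y : ℝ) ^ (2 * κ) * (y : ℝ) ^ δ :=
            mul_le_mul (hPr_le p₁ hp) hd.1.2 (by positivity) (by positivity)
        _ = (y : ℝ) ^ (2 * κ + δ) := (Real.rpow_add hyr0 _ _).symm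
        _ ≤ (y : ℝ) ^ θ := hrpow_le hθℓ
    have hN : ((p₁ * y : ℕ) : ℝ) ≤ (y : ℝ) ^ (1 + θ) := by
      push_cast
      calc (p₁ : ℝ) * y ≤ (y : ℝ) ^ (2 * κ) * (y : ℝ) ^ (1 : ℝ) := by
            rw [Real.rpow_one]; exact mul_le_mul_of_nonneg_right (hPr_le p₁ hp) hyr0.le
        _ = (y : ℝ) ^ (2 * κ + 1) := (Real.rpow_add hyr0 _ _).symm
        _ ≤ (y : ℝ) ^ (1 + θ) := hrpow_le (by linarith)
    have h := HT (p₁ * d) (p₁ * (U p₁ + 1 - 1)) (p₁ * y) (Nat.succ_le_of_lt (Nat.mul_pos hp0 hd1))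
      hℓ (Nat.mul_le_mul_left _ (by have := hUy p₁ hp; omega)) hN
    refine le_trans (le_of_eq ?_) (h.trans (mul_le_mul_of_nonneg_right (le_max_left _ _)
      (by positivity)))
    congr 1
    refine Finset.sum_congr rfl fun n hn => ?_
    rw [Finset.mem_filter] at hn
    have hnQ : n.Coprime Q := hn.2.2
    have hng : n.Coprime g.natAbs := Nat.coprime_of_dvd fun k hk hkn hkg =>
      (Nat.Prime.coprime_iff_not_dvd hk).mp (Nat.Coprime.coprime_dvd_left hkn hnQ)
        (hQg k hk (Int.ofNat_dvd_left.mpr hkg))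
    have hρ : (polyRootCountMod ![G] n : ℝ) = (rhoG a b c n : ℝ) := by
      rw [hG, polyRootCountMod_C_mul _ hng]; rfl
    rw [hρ, hA]
    dsimp only
    rw [hT, Finset.filter_filter]
    have hAeq : ((Finset.Ioc y (2 * y)).filter (fun t => t % q = b₀ % q ∧ n ∣ F t)) =
        ((Finset.Ioc y (2 * y)).filter (fun t : ℕ => t % q = b₀ % q ∧
          (n : ℤ) ∣ G.eval (t : ℤ))) := by
      refine Finset.filter_congr fun t _ => ?_
      rw [hF]; dsimp only
      rw [Int.ofNat_dvd_left]
    rw [hAeq, hX₀]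
  have hEA : ∑ p₁ ∈ Pr, E₁ p₁ ≤ c₃ / 8 * X₀ := by
    calc ∑ p₁ ∈ Pr, E₁ p₁ ≤ ∑ p₁ ∈ Pr, ∑ d ∈ 𝒟, max KT 0 * (y : ℝ) ^ (1 - ε₀) :=
          Finset.sum_le_sum fun p₁ hp => Finset.sum_le_sum fun d hd => hT1 p₁ hp d hd
      _ = Pr.card * (𝒟.card * (max KT 0 * (y : ℝ) ^ (1 - ε₀))) := by
          rw [Finset.sum_const, Finset.sum_const, nsmul_eq_mul, nsmul_eq_mul]
      _ ≤ (y : ℝ) ^ (2 * κ) * (D * (max KT 0 * (y : ℝ) ^ (1 - ε₀))) := by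
          have hK : 0 ≤ max KT 0 * (y : ℝ) ^ (1 - ε₀) := by positivity
          exact mul_le_mul hPrcard (mul_le_mul_of_nonneg_right h𝒟card hK) (by positivity)
            (by positivity)
      _ ≤ c₃ / 8 * X₀ := by
          rcases le_or_gt 0 KT with hK | hK
          · rw [max_eq_left hK, hD]
            linarith [hErrA]
          · rw [max_eq_right hK.le, zero_mul, mul_zero, mul_zero]
            positivity
  -- (B) the `p₁`-shift terms
  have hEB : ∑ p₁ ∈ Pr, E₂ p₁ ≤ c₃ / 8 * X₀ := by
    have heq : ∀ p₁ ∈ Pr, E₂ p₁ =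
        X₀ * (8 * (1 + Real.log y) ^ 2) * 𝒟.card * (1 / (p₁ : ℝ) ^ 2) := by
      intro p₁ hp
      rw [hE₂]; dsimp only
      rw [Finset.sum_const, nsmul_eq_mul]
      have := hPr_pos p₁ hp
      field_simp
    rw [Finset.sum_congr rfl heq, ← Finset.mul_sum]
    have hinv := sum_primesIoc_inv_sq_le (Y₂ := (y : ℝ) ^ (2 * κ)) hyκ1
    have hfl0 : (0 : ℝ) < ⌊(y : ℝ) ^ κ⌋₊ := by
      exact_mod_cast Nat.le_floor (α := ℝ) (n := 1) (by exact_mod_cast hyκ1)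
    have hs0 : 0 ≤ ∑ p ∈ Pr, 1 / (p : ℝ) ^ 2 := Finset.sum_nonneg fun _ _ => by positivity
    calc X₀ * (8 * (1 + Real.log y) ^ 2) * 𝒟.card * ∑ p ∈ Pr, 1 / (p : ℝ) ^ 2
        ≤ X₀ * (8 * (1 + Real.log y) ^ 2) * D * (1 / (⌊(y : ℝ) ^ κ⌋₊ : ℝ)) :=
          mul_le_mul (mul_le_mul_of_nonneg_left h𝒟card (by positivity)) hinv hs0 (by positivity)
      _ = X₀ * (8 * (1 + Real.log y) ^ 2 * (y : ℝ) ^ δ / ⌊(y : ℝ) ^ κ⌋₊) := by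
          rw [hD]; field_simp
      _ ≤ X₀ * (c₃ / 8) := mul_le_mul_of_nonneg_left hErrB hX₀0.le
      _ = c₃ / 8 * X₀ := by ring
  -- (C) the window terms
  have hEC : ∑ p₁ ∈ Pr, E₃ p₁ ≤ c₃ / 8 * X₀ := by
    set Um : ℕ := ⌊2 * (A₀ : ℝ) * y / (y : ℝ) ^ (2 * κ)⌋₊ with hUm
    have hUm0 : (0 : ℝ) < Um := by exact_mod_cast hUmin
    have hKV : 0 ≤ kWin χ Q y := kWin_nonneg χ Q (by omega : 1 ≤ y)
    set Bnd : ℝ := 2 * 𝔠 / Um + 4 * (kWin χ Q y * (⌊D⌋₊ : ℝ) ^ 3) / Real.sqrt Um with hBnd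
    have hBnd0 : 0 ≤ Bnd := by rw [hBnd]; positivity
    have hterm : ∀ p₁ ∈ Pr, ∀ d ∈ 𝒟,
        2 * |𝔠| / ((U p₁ + 1 - 1 : ℕ) : ℝ) +
          4 * (kWin χ Q y * (#d.divisors : ℝ) ^ 3) / Real.sqrt ((U p₁ + 1 - 1 : ℕ) : ℝ) ≤ Bnd := by
      intro p₁ hp d hd
      rw [Nat.add_sub_cancel, abs_of_pos h𝔠]
      have hUge : (Um : ℝ) ≤ (U p₁ : ℝ) := by exact_mod_cast hUmin_le p₁ hp
      have hτ : (#d.divisors : ℝ) ≤ ⌊D⌋₊ := by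
        rw [h𝒟, Finset.mem_filter, Finset.mem_filter] at hd
        have h1 : #d.divisors ≤ d := Nat.card_divisors_le_self d
        have h2 : d ≤ ⌊D⌋₊ := Nat.le_floor hd.1.2
        exact_mod_cast h1.trans h2
      have h1 : 2 * 𝔠 / (U p₁ : ℝ) ≤ 2 * 𝔠 / Um :=
        div_le_div_of_nonneg_left (by positivity) hUm0 hUge
      have h2 : 4 * (kWin χ Q y * (#d.divisors : ℝ) ^ 3) / Real.sqrt (U p₁ : ℝ) ≤
          4 * (kWin χ Q y * (⌊D⌋₊ : ℝ) ^ 3) / Real.sqrt Um := by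
        refine div_le_div₀ (by positivity) ?_ (Real.sqrt_pos.mpr hUm0) (Real.sqrt_le_sqrt hUge)
        gcongr
      rw [hBnd]; linarith
    have hρsum := sum_primesIoc_rhoG_div_le a b c (Y₁ := (y : ℝ) ^ κ) (Y₂ := (y : ℝ) ^ (2 * κ))
      (by positivity)
    calc ∑ p₁ ∈ Pr, E₃ p₁ ≤ ∑ p₁ ∈ Pr, ∑ d ∈ 𝒟, X₀ * ((rhoG a b c p₁ : ℝ) / p₁) * Bnd := by
          refine Finset.sum_le_sum fun p₁ hp => Finset.sum_le_sum fun d hd => ?_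
          have hρ0 : 0 ≤ X₀ * ((rhoG a b c p₁ : ℝ) / p₁) := by
            have := hPr_pos p₁ hp; positivity
          exact mul_le_mul_of_nonneg_left (hterm p₁ hp d hd) hρ0
      _ = X₀ * Bnd * 𝒟.card * ∑ p₁ ∈ Pr, (rhoG a b c p₁ : ℝ) / p₁ := by
          rw [Finset.mul_sum]
          refine Finset.sum_congr rfl fun p₁ _ => ?_
          rw [Finset.sum_const, nsmul_eq_mul]; ring
      _ ≤ X₀ * Bnd * D * ((y : ℝ) ^ (2 * κ) + 1) := by
          refine mul_le_mul (mul_le_mul_of_nonneg_left h𝒟card (by positivity)) hρsum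
            (Finset.sum_nonneg fun p hp => by have := hPr_pos p hp; positivity) (by positivity)
      _ = X₀ * (((y : ℝ) ^ (2 * κ) + 1) * (y : ℝ) ^ δ * Bnd) := by rw [hD]; ring
      _ ≤ X₀ * (c₃ / 8) := by
          refine mul_le_mul_of_nonneg_left ?_ hX₀0.le
          rw [hBnd, hUm]; exact hErrC
      _ = c₃ / 8 * X₀ := by ring
  -- ## assembly
  have hsumS := Finset.sum_le_sum hstep
  rw [Finset.sum_sub_distrib, Finset.sum_add_distrib, Finset.sum_add_distrib] at hsumS
  have hmainV : c₃ * X₀ ≤ ∑ p₁ ∈ Pr, 1 / 2 * Mn p₁ := by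
    have heq : ∑ p₁ ∈ Pr, 1 / 2 * Mn p₁ = 1 / 2 * X₀ * (𝔠 * V) *
        ∑ p₁ ∈ Pr, (rhoG a b c p₁ : ℝ) / p₁ * Real.log ((y : ℝ) / ((U p₁ + 1 - 1 : ℕ) : ℝ)) := by
      rw [Finset.mul_sum]
      refine Finset.sum_congr rfl fun p₁ _ => ?_
      rw [hMn]; ring
    rw [heq]
    have h1 : Lχ * c₀ / (3 * (η * Real.log (y : ℝ))) * (κ / 4 * Real.log (y : ℝ)) = 2 * c₃ := by
      rw [hc₃]; field_simp; ring
    have hκlog : 0 ≤ κ / 4 * Real.log (y : ℝ) := by positivity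
    calc c₃ * X₀ = 1 / 2 * X₀ * (Lχ * c₀ / (3 * (η * Real.log (y : ℝ))) *
          (κ / 4 * Real.log (y : ℝ))) := by rw [h1]; ring
      _ ≤ 1 / 2 * X₀ * ((𝔠 * V) * ∑ p₁ ∈ Pr, (rhoG a b c p₁ : ℝ) / p₁ *
            Real.log ((y : ℝ) / ((U p₁ + 1 - 1 : ℕ) : ℝ))) := by
          refine mul_le_mul_of_nonneg_left ?_ (by positivity)
          exact mul_le_mul h𝔠V hmain hκlog (by positivity)
      _ = _ := by ring
  have hN : (0 : ℝ) < ((J₁ * 2 ^ J₂ : ℕ) : ℝ) := by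
    have : 1 ≤ J₁ * 2 ^ J₂ := Nat.one_le_iff_ne_zero.mpr
      (mul_ne_zero (by omega) (pow_ne_zero _ two_ne_zero))
    exact_mod_cast this
  rw [hgoodset] at hmultR
  have hcX : 0 ≤ c₃ * X₀ := by positivity
  have h58 : 5 / 8 * (c₃ * X₀) ≤ ((J₁ * 2 ^ J₂ : ℕ) : ℝ) *
      ((((Finset.Ioc y (2 * y)).filter (fun t : ℕ => t % q = b₀ % q ∧
        ∀ p : ℕ, p.Prime → (p : ℤ) ∣ G.eval (t : ℤ) → p ≤ t)).card : ℕ) : ℝ) := by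
    linarith [hmultR, hsumS, hmainV, hEA, hEB, hEC]
  rw [div_mul_eq_mul_div, div_le_iff₀ (by positivity)]
  linarith [h58, hcX]

end Core

end PropertySTypeI


namespace PropertySTypeI

open Polynomial Finset Iwaniec1978 RhoLogSums ArithmeticFunction Filter
open scoped NumberTheorySymbols ArithmeticFunction.Moebius Classical Topology
open Literature.NumberTheory.LFunctions (DirichletAbel.reChar RealChar.charDivisorDensity)

/-! ### E2-I. Choosing the parameters: the dyadic count for all large `y`, and property S -/

section Assembly

variable {a b c g : ℤ}

/-- `C ≤ y^ν` for all large `y ∈ ℕ` (`ν > 0`). [folklore] -/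
theorem eventually_nat_le_rpow {ν : ℝ} (hν : 0 < ν) (C : ℝ) :
    ∀ᶠ y : ℕ in atTop, C ≤ (y : ℝ) ^ ν :=
  ((tendsto_rpow_atTop hν).comp tendsto_natCast_atTop_atTop).eventually_ge_atTop C

/-- `C < y^ν` for all large `y ∈ ℕ` (`ν > 0`). [folklore] -/
theorem eventually_nat_lt_rpow {ν : ℝ} (hν : 0 < ν) (C : ℝ) :
    ∀ᶠ y : ℕ in atTop, C < (y : ℝ) ^ ν :=
  ((tendsto_rpow_atTop hν).comp tendsto_natCast_atTop_atTop).eventually_gt_atTop C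

/-- `log y ≤ y^ν` for all large `y ∈ ℕ` (`ν > 0`). [folklore] -/
theorem eventually_nat_log_le_rpow {ν : ℝ} (hν : 0 < ν) :
    ∀ᶠ y : ℕ in atTop, Real.log y ≤ (y : ℝ) ^ ν := by
  have h := (isLittleO_log_rpow_atTop hν).bound (show (0 : ℝ) < 1 by norm_num)
  filter_upwards [tendsto_natCast_atTop_atTop.eventually h] with y hy
  rw [one_mul, Real.norm_eq_abs, Real.norm_eq_abs] at hy
  exact (le_abs_self _).trans (hy.trans (le_of_eq (abs_of_nonneg (by positivity))))

/-- From `4A₀ < y^κ ≤ L` and `κJ ≥ 2`: `4A₀ y² < L^{J+1}`. [folklore] -/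
theorem four_mul_mul_sq_lt_pow {y A₀ L J : ℕ} {κ : ℝ} (hy : 1 ≤ y) (hJ : 2 ≤ κ * J)
    (hA : 4 * (A₀ : ℝ) < (y : ℝ) ^ κ) (hL : (y : ℝ) ^ κ ≤ L) :
    4 * A₀ * y ^ 2 < L ^ (J + 1) := by
  have hy1 : (1 : ℝ) ≤ y := by exact_mod_cast hy
  have hy0 : (0 : ℝ) < y := by linarith
  have hκ0 : 0 ≤ (y : ℝ) ^ κ := by positivity
  have h1 : ((y : ℝ) ^ κ) ^ (J + 1) ≤ ((L : ℕ) : ℝ) ^ (J + 1) := pow_le_pow_left₀ hκ0 hL _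
  have h2 : ((y : ℝ) ^ κ) ^ (J + 1) = (y : ℝ) ^ (κ * J) * (y : ℝ) ^ κ := by
    rw [pow_succ, ← Real.rpow_natCast, ← Real.rpow_mul hy0.le]
  have h3 : (y : ℝ) ^ (2 : ℝ) ≤ (y : ℝ) ^ (κ * J) := Real.rpow_le_rpow_of_exponent_le hy1 hJ
  rw [Real.rpow_two] at h3
  have h4 : ((4 * A₀ * y ^ 2 : ℕ) : ℝ) < ((L ^ (J + 1) : ℕ) : ℝ) := by
    push_cast
    have hy2 : (0 : ℝ) < (y : ℝ) ^ 2 := by positivity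
    calc (4 : ℝ) * A₀ * (y : ℝ) ^ 2 = (y : ℝ) ^ 2 * (4 * A₀) := by ring
      _ < (y : ℝ) ^ 2 * (y : ℝ) ^ κ := mul_lt_mul_of_pos_left hA hy2
      _ ≤ (y : ℝ) ^ (κ * J) * (y : ℝ) ^ κ := mul_le_mul_of_nonneg_right h3 hκ0
      _ = ((y : ℝ) ^ κ) ^ (J + 1) := h2.symm
      _ ≤ _ := h1
  exact_mod_cast h4

set_option maxHeartbeats 1000000 in
/-- **The dyadic count from type-I information.**  Let `P = g · (aX² + bX + c)` with `a, g > 0`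
and `aX² + bX + c` irreducible, and assume the type-I level-of-distribution hypothesis with
exponents `θ, ε₀ > 0`: for all `q ≥ 1`, `b₀`, and every modulus `Q ≠ 0` containing the primes of
`q`, of the content of `P` and of `2 · lc P · disc P`, there are `K, y₀` such that for
`y ≥ y₀`, every level
`1 ≤ ℓ ≤ y^θ` and `N₁ ≤ N₂ ≤ y^{1+θ}`,
`|∑_{N₁<n≤N₂, ℓ∣n, (n,Q)=1} (#{y<t≤2y : t ≡ b₀ (q), n ∣ P(t)} − (y/q) ρ_P(n)/n)| ≤ K y^{1−ε₀}`.
Then there is `c₁ = c₁(P, θ, ε₀) > 0` such that for all `q ≥ 1`, `b₀` and `y ≥ y₀(q, b₀)`,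
`#{y < t ≤ 2y : t ≡ b₀ (mod q), P(t) is t-smooth} ≥ c₁ y/q`.
(The constant is uniform in `q`: the main terms only involve `ρ_P` and the bad modulus enters
through `F_Q V_Q(z) ≥ W(z)`, `exists_const_F_mul_V`.) [folklore] -/
theorem dyadic_lower_bound {P : ℤ[X]} (ha : 0 < a) (hg : 0 < g)
    (hirr : Irreducible (quadPoly a b c)) (hP : P = C g * quadPoly a b c)
    {θ ε₀ : ℝ} (hθ : 0 < θ) (hε₀ : 0 < ε₀)
    (hTI : ∀ q b₀ Q : ℕ, 1 ≤ q → Q ≠ 0 → (∀ p : ℕ, p.Prime → p ∣ q → p ∣ Q) →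
      (∀ p : ℕ, p.Prime → (p : ℤ) ∣ P.content → p ∣ Q) →
      (∀ p : ℕ, p.Prime → (p : ℤ) ∣ 2 * P.leadingCoeff *
        (P.coeff 1 ^ 2 - 4 * P.coeff 2 * P.coeff 0) → p ∣ Q) →
      ∃ (K : ℝ) (y₀ : ℕ), ∀ y : ℕ, y₀ ≤ y → ∀ ℓ N₁ N₂ : ℕ, 1 ≤ ℓ → (ℓ : ℝ) ≤ (y : ℝ) ^ θ →
        N₁ ≤ N₂ → (N₂ : ℝ) ≤ (y : ℝ) ^ (1 + θ) →
        |∑ n ∈ (Finset.Ioc N₁ N₂).filter (fun n => ℓ ∣ n ∧ n.Coprime Q),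
            ((((Finset.Ioc y (2 * y)).filter (fun t : ℕ => t % q = b₀ % q ∧
                (n : ℤ) ∣ P.eval (t : ℤ))).card : ℝ) -
              (y : ℝ) / q * (polyRootCountMod ![P] n : ℝ) / n)| ≤ K * (y : ℝ) ^ (1 - ε₀)) :
    ∃ c₁ : ℝ, 0 < c₁ ∧ ∀ q b₀ : ℕ, 1 ≤ q → ∃ y₀ : ℕ, ∀ y : ℕ, y₀ ≤ y →
      c₁ * ((y : ℝ) / q) ≤ (((Finset.Ioc y (2 * y)).filter (fun t : ℕ => t % q = b₀ % q ∧
          ∀ p : ℕ, p.Prime → (p : ℤ) ∣ P.eval (t : ℤ) → p ≤ t)).card : ℝ) := by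
  subst hP
  -- ## constants attached to `G`
  have hΔ0 : b ^ 2 - 4 * a * c ≠ 0 := disc_ne_zero ha.ne' hirr
  haveI : NeZero (4 * (b ^ 2 - 4 * a * c).natAbs) :=
    ⟨mul_ne_zero (by norm_num) (Int.natAbs_ne_zero.mpr hΔ0)⟩
  obtain ⟨χ, hχ⟩ :=
    Literature.NumberTheory.QuadraticFields.exists_dirichletCharacter_four_mul _ hΔ0
  obtain ⟨Kd, hKd⟩ := exists_hasSieveDimension ha hirr
  have hKd1 : 1 ≤ Kd := (hKd 1).one_le
  obtain ⟨c₀, hc₀, hFVall⟩ := exists_const_F_mul_V ha hirr hχ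
  obtain ⟨CM, hCM⟩ := exists_sum_primesIoc_rhoG_log_div_ge ha hirr
  obtain ⟨E₁, hE₁0, hE₁⟩ := exists_forall_prime_polyRootCountMod_pow_eq hirr
    (by rw [natDegree_quadPoly ha.ne']; norm_num)
  have hLχ0 : 0 < (χ.LFunction 1).re :=
    Literature.NumberTheory.LFunctions.Siegel.LFunction_one_re_pos χ (chi_ne_one ha hirr hχ)
      (chi_sq_eq_one hΔ0 hχ)
  -- ## parameters
  set κ : ℝ := min (min θ ε₀ / 8) (1 / 32) with hκdef
  have hκ0 : 0 < κ := by rw [hκdef]; exact lt_min (by positivity) (by norm_num)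
  have hκθ : 8 * κ ≤ θ := by
    have h1 := min_le_left (min θ ε₀ / 8) (1 / 32)
    have h2 := min_le_left θ ε₀
    rw [← hκdef] at h1; linarith
  have hκε : 8 * κ ≤ ε₀ := by
    have h1 := min_le_left (min θ ε₀ / 8) (1 / 32)
    have h2 := min_le_right θ ε₀
    rw [← hκdef] at h1; linarith
  have hκ32 : κ ≤ 1 / 32 := by rw [hκdef]; exact min_le_right _ _
  set δ : ℝ := κ / 2 with hδdef
  have hδ0 : 0 < δ := by positivity
  set Fc : ℝ := SieveSequence.flConst 1 Kd with hFcdef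
  have hFc0 : 0 < Fc := SieveSequence.flConst_pos zero_le_one (by linarith)
  set s₀ : ℝ := max 1 (Real.log (2 * Fc)) with hs₀def
  have hs₀1 : 1 ≤ s₀ := le_max_left _ _
  have hs₀0 : 0 < s₀ := by linarith
  set η : ℝ := δ / s₀ with hηdef
  have hη0 : 0 < η := by positivity
  have hηδ : η ≤ δ := div_le_self hδ0.le hs₀1
  have hFl : Fc * Real.exp (-(δ / η)) ≤ 1 / 2 := by
    have hδη : δ / η = s₀ := by rw [hηdef]; field_simp
    rw [hδη]
    have h1 : Real.exp (-s₀) ≤ Real.exp (-(Real.log (2 * Fc))) :=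
      Real.exp_le_exp.mpr (by linarith [le_max_right 1 (Real.log (2 * Fc))])
    rw [Real.exp_neg (Real.log (2 * Fc)), Real.exp_log (by positivity)] at h1
    calc Fc * Real.exp (-s₀) ≤ Fc * (2 * Fc)⁻¹ := mul_le_mul_of_nonneg_left h1 hFc0.le
      _ = 1 / 2 := by field_simp
  set J₁ : ℕ := ⌈2 / κ⌉₊ with hJ₁def
  have hJ₁ : 1 ≤ J₁ := Nat.ceil_pos.mpr (by positivity)
  have hJ₁κ : 2 ≤ κ * J₁ := by
    have := Nat.le_ceil (2 / κ)
    rw [← hJ₁def, div_le_iff₀ hκ0] at this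
    linarith
  set J₂ : ℕ := ⌈2 / η⌉₊ with hJ₂def
  have hJ₂η : 2 ≤ η * J₂ := by
    have := Nat.le_ceil (2 / η)
    rw [← hJ₂def, div_le_iff₀ hη0] at this
    linarith
  set A₀ : ℕ := (g * (|a| + |b| + |c|)).toNat with hA₀def
  have hA₀int : ((A₀ : ℕ) : ℤ) = g * (|a| + |b| + |c|) := Int.toNat_of_nonneg (by positivity)
  have hA₀ : 1 ≤ A₀ := by
    have h1 : (1 : ℤ) ≤ |a| := Int.one_le_abs ha.ne'
    have hS : (1 : ℤ) ≤ |a| + |b| + |c| := by linarith [abs_nonneg b, abs_nonneg c]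
    have h2 : (1 : ℤ) ≤ g * (|a| + |b| + |c|) :=
      hS.trans (le_mul_of_one_le_left (by linarith) (by omega))
    rw [← hA₀int] at h2
    exact_mod_cast h2
  have hA₀r : (1 : ℝ) ≤ A₀ := by exact_mod_cast hA₀
  have hPle : ∀ t : ℕ, 1 ≤ t →
      ((((C g * quadPoly a b c).eval (t : ℤ)).natAbs : ℕ) : ℝ) ≤ (A₀ : ℝ) * (t : ℝ) ^ 2 := by
    intro t ht
    have := natAbs_eval_le hg a b c ht
    have hcast : ((g * (|a| + |b| + |c|) : ℤ) : ℝ) = (A₀ : ℝ) := by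
      rw [← hA₀int]; norm_cast
    rw [hcast] at this; exact this
  set c₃ : ℝ := (χ.LFunction 1).re * c₀ * κ / (24 * η) with hc₃
  have hc₃0 : 0 < c₃ := by positivity
  have hNpos : (0 : ℝ) < ((J₁ * 2 ^ J₂ : ℕ) : ℝ) := by
    have : 1 ≤ J₁ * 2 ^ J₂ := Nat.one_le_iff_ne_zero.mpr
      (mul_ne_zero (by omega) (pow_ne_zero _ two_ne_zero))
    exact_mod_cast this
  refine ⟨c₃ / (2 * ((J₁ * 2 ^ J₂ : ℕ) : ℝ)), by positivity, fun q b₀ hq => ?_⟩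
  -- ## the bad modulus for this `q`
  set B₀ : ℕ := 2 * a.natAbs * g.natAbs * (b ^ 2 - 4 * a * c).natAbs * E₁ with hB₀
  have hB₀0 : B₀ ≠ 0 := by
    rw [hB₀]
    refine mul_ne_zero (mul_ne_zero (mul_ne_zero (mul_ne_zero two_ne_zero ?_) ?_) ?_) hE₁0
    · exact Int.natAbs_ne_zero.mpr ha.ne'
    · exact Int.natAbs_ne_zero.mpr hg.ne'
    · exact Int.natAbs_ne_zero.mpr hΔ0
  have hq0 : q ≠ 0 := by omega
  obtain ⟨hQsq, hQiff, hQle⟩ := badMod_spec hB₀0 hq0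
  set Q : ℕ := badMod B₀ q with hQdef
  have hdvdB : ∀ p : ℕ, p.Prime → p ∣ B₀ * q → p ∣ Q := fun p hp h => (hQiff p hp).mpr h
  have h2B : 2 ∣ B₀ := by
    rw [hB₀]; exact (((dvd_mul_right 2 _).mul_right _).mul_right _).mul_right _
  have haB : a.natAbs ∣ B₀ := by
    rw [hB₀]; exact (((dvd_mul_left _ 2).mul_right _).mul_right _).mul_right _
  have hgB : g.natAbs ∣ B₀ := by
    rw [hB₀]; exact ((dvd_mul_left _ _).mul_right _).mul_right _
  have hΔB : (b ^ 2 - 4 * a * c).natAbs ∣ B₀ := by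
    rw [hB₀]; exact (dvd_mul_left _ _).mul_right _
  have hEB : E₁ ∣ B₀ := by rw [hB₀]; exact dvd_mul_left _ _
  have hQ2 : 2 ∣ Q := hdvdB 2 Nat.prime_two (dvd_mul_of_dvd_left h2B q)
  have hQa : ∀ p : ℕ, p.Prime → (p : ℤ) ∣ a → p ∣ Q := fun p hp h =>
    hdvdB p hp (dvd_mul_of_dvd_left ((Int.ofNat_dvd_left.mp h).trans haB) q)
  have hQg : ∀ p : ℕ, p.Prime → (p : ℤ) ∣ g → p ∣ Q := fun p hp h =>
    hdvdB p hp (dvd_mul_of_dvd_left ((Int.ofNat_dvd_left.mp h).trans hgB) q)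
  have hQΔ : ∀ p : ℕ, p.Prime → (p : ℤ) ∣ b ^ 2 - 4 * a * c → p ∣ Q := fun p hp h =>
    hdvdB p hp (dvd_mul_of_dvd_left ((Int.ofNat_dvd_left.mp h).trans hΔB) q)
  have hQq : ∀ p : ℕ, p.Prime → p ∣ q → p ∣ Q := fun p hp h =>
    hdvdB p hp (dvd_mul_of_dvd_right h B₀)
  have hpow : ∀ p : ℕ, p.Prime → ¬ p ∣ Q → ∀ k : ℕ, 1 ≤ k →
      rhoG a b c (p ^ k) = rhoG a b c p := by
    intro p hp hpQ k hk
    have hpE : ¬ p ∣ E₁ := fun h => hpQ (hdvdB p hp (dvd_mul_of_dvd_left (h.trans hEB) q))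
    simp only [rhoG]
    exact (hE₁ p hp hpE k hk).1
  have hQprimes : ∀ p ∈ Q.primeFactors, (p : ℝ) ≤ ((B₀ * q : ℕ) : ℝ) := fun p hp => by
    exact_mod_cast hQle p hp
  have hcontent : (C g * quadPoly a b c).content = g := by
    rw [Polynomial.content_C_mul, (hirr.isPrimitive (by rw [natDegree_quadPoly ha.ne']; decide)).content_eq_one,
      mul_one, Int.normalize_of_nonneg hg.le]
  -- the bad primes `2 · lc P · disc P = 2 g³ a Δ` divide `Q`
  have hbadQ : ∀ p : ℕ, p.Prime → (p : ℤ) ∣ 2 * (C g * quadPoly a b c).leadingCoeff *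
      ((C g * quadPoly a b c).coeff 1 ^ 2 - 4 * (C g * quadPoly a b c).coeff 2 *
        (C g * quadPoly a b c).coeff 0) → p ∣ Q := by
    intro p hp hdvd
    have hlc : (C g * quadPoly a b c).leadingCoeff = g * a := by
      rw [leadingCoeff_mul, leadingCoeff_C, leadingCoeff_quadPoly ha.ne']
    have hc1 : (C g * quadPoly a b c).coeff 1 = g * b := by
      simp only [quadPoly, coeff_C_mul, coeff_add, coeff_X_pow, coeff_X, coeff_C]; norm_num
    have hc2 : (C g * quadPoly a b c).coeff 2 = g * a := by
      simp only [quadPoly, coeff_C_mul, coeff_add, coeff_X_pow, coeff_X, coeff_C]; norm_num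
    have hc0 : (C g * quadPoly a b c).coeff 0 = g * c := by
      simp only [quadPoly, coeff_C_mul, coeff_add, coeff_X_pow, coeff_X, coeff_C]; norm_num
    rw [hlc, hc1, hc2, hc0] at hdvd
    have heq : 2 * (g * a) * ((g * b) ^ 2 - 4 * (g * a) * (g * c)) =
        2 * (g * (g * (g * (a * (b ^ 2 - 4 * a * c))))) := by ring
    rw [heq] at hdvd
    have hpP : Prime (p : ℤ) := Nat.prime_iff_prime_int.mp hp
    rcases hpP.dvd_or_dvd hdvd with h2 | h
    · have : p ∣ 2 := by exact_mod_cast Int.natCast_dvd_natCast.mp (by exact_mod_cast h2)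
      exact (Nat.le_of_dvd two_pos this |> fun hle => by
        interval_cases p <;> first | exact hQ2 | exact absurd hp (by decide))
    rcases hpP.dvd_or_dvd h with hg1 | h
    · exact hQg p hp hg1
    rcases hpP.dvd_or_dvd h with hg2 | h
    · exact hQg p hp hg2
    rcases hpP.dvd_or_dvd h with hg3 | h
    · exact hQg p hp hg3
    rcases hpP.dvd_or_dvd h with ha1 | hΔ1
    · exact hQa p hp ha1
    · exact hQΔ p hp hΔ1
  obtain ⟨KT, yT, hT⟩ := hTI q b₀ Q hq hQsq.ne_zero hQq
    (fun p hp hpc => hQg p hp (by rwa [hcontent] at hpc)) hbadQ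
  -- constants for the window terms
  set 𝔠 : ℝ := cMain χ Q with h𝔠def
  have h𝔠0 : 0 < 𝔠 := const_pos ha hirr hχ hQsq
  set K₁ : ℝ := 5 * ((4 * (b ^ 2 - 4 * a * c).natAbs : ℕ) : ℝ) * (#Q.divisors : ℝ) ^ 3 +
    8 * |(χ.LFunction 1).re * ∑ f ∈ Q.divisors, (μ f : ℝ) * RealChar.charDivisorDensity χ f|
    with hK₁def
  have hK₁0 : 0 ≤ K₁ := by rw [hK₁def]; positivity
  have hkWin : ∀ y : ℕ, 1 ≤ y → kWin χ Q y ≤ K₁ * (1 + Real.log y) := by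
    intro y hy
    have hl : 0 ≤ Real.log y := Real.log_nonneg (by exact_mod_cast hy)
    have h8 : 8 * |(χ.LFunction 1).re * ∑ f ∈ Q.divisors, (μ f : ℝ) *
        RealChar.charDivisorDensity χ f| ≤
        8 * |(χ.LFunction 1).re * ∑ f ∈ Q.divisors, (μ f : ℝ) *
          RealChar.charDivisorDensity χ f| * (1 + Real.log y) :=
      le_mul_of_one_le_right (by positivity) (by linarith)
    rw [kWin, hK₁def]
    linarith
  -- ## largeness conditions
  have hq0r : (0 : ℝ) < q := by exact_mod_cast hq
  have e0 : ∀ᶠ y : ℕ in atTop, yT ≤ y := eventually_ge_atTop yT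
  have e1 : ∀ᶠ y : ℕ in atTop, 2 ≤ y := eventually_ge_atTop 2
  have e2 : ∀ᶠ y : ℕ in atTop, (2 : ℝ) < (y : ℝ) ^ η := eventually_nat_lt_rpow hη0 _
  have e3 : ∀ᶠ y : ℕ in atTop, ((B₀ * q : ℕ) : ℝ) < (y : ℝ) ^ η := eventually_nat_lt_rpow hη0 _
  have e4 : ∀ᶠ y : ℕ in atTop, 4 * (A₀ : ℝ) < (y : ℝ) ^ η := eventually_nat_lt_rpow hη0 _
  have e5 : ∀ᶠ y : ℕ in atTop, ((B₀ * q : ℕ) : ℝ) ≤ (y : ℝ) ^ κ := eventually_nat_le_rpow hκ0 _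
  have e6 : ∀ᶠ y : ℕ in atTop, 4 * (A₀ : ℝ) ^ 2 + 4 * A₀ ≤ (y : ℝ) ^ κ :=
    eventually_nat_le_rpow hκ0 _
  have e7 : ∀ᶠ y : ℕ in atTop, CM ≤ κ / 2 * Real.log y :=
    ((Real.tendsto_log_atTop.comp tendsto_natCast_atTop_atTop).const_mul_atTop
      (by positivity : 0 < κ / 2)).eventually_ge_atTop CM
  have e8 : ∀ᶠ y : ℕ in atTop, Real.log y ≤ (y : ℝ) ^ (κ / 8) :=
    eventually_nat_log_le_rpow (by positivity)
  have e9 : ∀ᶠ y : ℕ in atTop, 8 * q * max KT 0 / c₃ ≤ (y : ℝ) ^ (ε₀ - 2 * κ - δ) :=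
    eventually_nat_le_rpow (by rw [hδdef]; linarith) _
  have e10 : ∀ᶠ y : ℕ in atTop, 1024 / c₃ ≤ (y : ℝ) ^ (κ / 4) :=
    eventually_nat_le_rpow (by positivity) _
  have e11 : ∀ᶠ y : ℕ in atTop, (4 * 𝔠 + 16 * K₁) * 8 / c₃ ≤ (y : ℝ) ^ (1 / 4 : ℝ) :=
    eventually_nat_le_rpow (by norm_num) _
  have e12 : ∀ᶠ y : ℕ in atTop, (|b| + |c|).toNat ≤ y := eventually_ge_atTop _
  obtain ⟨y₀, hy₀⟩ := Filter.eventually_atTop.mp (e0.and (e1.and (e2.and (e3.and (e4.and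
    (e5.and (e6.and (e7.and (e8.and (e9.and (e10.and (e11.and e12))))))))))))
  refine ⟨y₀, fun y hy => ?_⟩
  obtain ⟨hy0, hy1, hy2, hy3, hy4, hy5, hy6, hy7, hy8, hy9, hy10, hy11, hy12⟩ := hy₀ y hy
  -- ## pointwise consequences
  have hy1r : (1 : ℝ) ≤ y := by exact_mod_cast (show 1 ≤ y by omega)
  have hyr0 : (0 : ℝ) < y := by linarith
  have hmul : ∀ u v : ℝ, (y : ℝ) ^ u * (y : ℝ) ^ v = (y : ℝ) ^ (u + v) := fun u v =>
    (Real.rpow_add hyr0 u v).symm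
  have hrle : ∀ {u v : ℝ}, u ≤ v → (y : ℝ) ^ u ≤ (y : ℝ) ^ v := fun h =>
    Real.rpow_le_rpow_of_exponent_le hy1r h
  have hPpos : ∀ t : ℕ, y < t → 0 < (C g * quadPoly a b c).eval (t : ℤ) := by
    intro t ht
    refine eval_pos ha hg b c ?_
    have h1 : |b| + |c| ≤ (y : ℤ) := Int.toNat_le.mp hy12
    have h2 : (y : ℤ) < t := by exact_mod_cast ht
    linarith
  have hQz : ∀ p ∈ Q.primeFactors, (p : ℝ) < (y : ℝ) ^ η := fun p hp =>
    lt_of_le_of_lt (hQprimes p hp) hy3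
  have hQκ : ∀ p ∈ Q.primeFactors, (p : ℝ) ≤ (y : ℝ) ^ κ := fun p hp =>
    (hQprimes p hp).trans hy5
  have hA₀κ' : 4 * (A₀ : ℝ) < (y : ℝ) ^ κ := by
    have hpos : (0 : ℝ) < (A₀ : ℝ) ^ 2 := by positivity
    linarith
  have hFJ₁ : 4 * A₀ * y ^ 2 < (⌊(y : ℝ) ^ κ⌋₊ + 1) ^ (J₁ + 1) :=
    four_mul_mul_sq_lt_pow (by omega) hJ₁κ hA₀κ' (by
      push_cast; exact (Nat.lt_floor_add_one _).le)
  have hFJ₂ : 4 * A₀ * y ^ 2 < ⌈(y : ℝ) ^ η⌉₊ ^ (J₂ + 1) :=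
    four_mul_mul_sq_lt_pow (by omega) hJ₂η hy4 (Nat.le_ceil _)
  have hy2κ : (y : ℝ) ^ (2 * κ) ≤ y := by
    conv_rhs => rw [← Real.rpow_one (y : ℝ)]
    exact hrle (by linarith)
  have hW1 : 1 ≤ (y : ℝ) ^ (1 - 2 * κ) := Real.one_le_rpow hy1r (by linarith)
  have hWeq : (y : ℝ) / (y : ℝ) ^ (2 * κ) = (y : ℝ) ^ (1 - 2 * κ) := by
    rw [Real.rpow_sub hyr0, Real.rpow_one]
  have hUm_ge : (y : ℝ) ^ (1 - 2 * κ) ≤ ⌊2 * (A₀ : ℝ) * y / (y : ℝ) ^ (2 * κ)⌋₊ := by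
    have h2 : 2 * (A₀ : ℝ) * y / (y : ℝ) ^ (2 * κ) = 2 * A₀ * (y : ℝ) ^ (1 - 2 * κ) := by
      rw [← hWeq]; ring
    have h1 : 2 * (A₀ : ℝ) * (y : ℝ) ^ (1 - 2 * κ) <
        (⌊2 * (A₀ : ℝ) * y / (y : ℝ) ^ (2 * κ)⌋₊ : ℝ) + 1 := by
      rw [← h2]; exact Nat.lt_floor_add_one _
    have h3 : 1 * (y : ℝ) ^ (1 - 2 * κ) ≤ A₀ * (y : ℝ) ^ (1 - 2 * κ) :=
      mul_le_mul_of_nonneg_right hA₀r (by positivity)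
    linarith
  have hUmin : 1 ≤ ⌊2 * (A₀ : ℝ) * y / (y : ℝ) ^ (2 * κ)⌋₊ := by
    have : (1 : ℝ) ≤ ⌊2 * (A₀ : ℝ) * y / (y : ℝ) ^ (2 * κ)⌋₊ := hW1.trans hUm_ge
    exact_mod_cast this
  -- (A)
  have hErrA : (y : ℝ) ^ (2 * κ) * (y : ℝ) ^ δ * (KT * (y : ℝ) ^ (1 - ε₀)) ≤
      (χ.LFunction 1).re * c₀ * κ / (24 * η) / 8 * ((y : ℝ) / q) := by
    rw [← hc₃]
    rcases le_or_gt KT 0 with hK | hK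
    · have : (y : ℝ) ^ (2 * κ) * (y : ℝ) ^ δ * (KT * (y : ℝ) ^ (1 - ε₀)) ≤ 0 := by
        have h1 : KT * (y : ℝ) ^ (1 - ε₀) ≤ 0 :=
          mul_nonpos_of_nonpos_of_nonneg hK (by positivity)
        exact mul_nonpos_of_nonneg_of_nonpos (by positivity) h1
      exact this.trans (by positivity)
    · rw [max_eq_left hK.le] at hy9
      have h1 : KT ≤ c₃ / (8 * q) * (y : ℝ) ^ (ε₀ - 2 * κ - δ) := by
        rw [div_le_iff₀ hc₃0] at hy9
        rw [div_mul_eq_mul_div, le_div_iff₀ (by positivity)]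
        linarith
      calc (y : ℝ) ^ (2 * κ) * (y : ℝ) ^ δ * (KT * (y : ℝ) ^ (1 - ε₀))
          = KT * ((y : ℝ) ^ (2 * κ) * (y : ℝ) ^ δ * (y : ℝ) ^ (1 - ε₀)) := by ring
        _ ≤ c₃ / (8 * q) * (y : ℝ) ^ (ε₀ - 2 * κ - δ) *
            ((y : ℝ) ^ (2 * κ) * (y : ℝ) ^ δ * (y : ℝ) ^ (1 - ε₀)) :=
            mul_le_mul_of_nonneg_right h1 (by positivity)
        _ = c₃ / (8 * q) * y := by
            rw [hmul, hmul, mul_assoc, hmul]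
            have : ε₀ - 2 * κ - δ + (2 * κ + δ + (1 - ε₀)) = 1 := by ring
            rw [this, Real.rpow_one]
        _ = c₃ / 8 * ((y : ℝ) / q) := by field_simp
  -- (B)
  have hlog1 : 1 + Real.log y ≤ 2 * (y : ℝ) ^ (κ / 8) := by
    have : 1 ≤ (y : ℝ) ^ (κ / 8) := Real.one_le_rpow hy1r (by positivity)
    linarith
  have hlog0 : 0 ≤ 1 + Real.log y := by
    have := Real.log_nonneg hy1r; linarith
  have hErrB : 8 * (1 + Real.log y) ^ 2 * (y : ℝ) ^ δ / ⌊(y : ℝ) ^ κ⌋₊ ≤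
      (χ.LFunction 1).re * c₀ * κ / (24 * η) / 8 := by
    rw [← hc₃]
    set P₁ : ℝ := (y : ℝ) ^ (κ / 4) with hP₁
    set P₂ : ℝ := (y : ℝ) ^ (κ / 2) with hP₂
    have hP₁0 : 0 < P₁ := by positivity
    have hP₂0 : 0 < P₂ := by positivity
    have hκP : (y : ℝ) ^ κ = P₁ * P₂ * P₁ := by
      rw [hP₁, hP₂, hmul, hmul]; congr 1; ring
    have hL2 : (1 + Real.log y) ^ 2 ≤ 4 * P₁ := by
      have h1 : (1 + Real.log y) ^ 2 ≤ (2 * (y : ℝ) ^ (κ / 8)) ^ 2 :=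
        pow_le_pow_left₀ hlog0 hlog1 2
      have h2 : ((y : ℝ) ^ (κ / 8)) ^ 2 = P₁ := by
        rw [hP₁, ← Real.rpow_natCast, ← Real.rpow_mul hyr0.le]; congr 1; push_cast; ring
      calc (1 + Real.log y) ^ 2 ≤ (2 * (y : ℝ) ^ (κ / 8)) ^ 2 := h1
        _ = 4 * ((y : ℝ) ^ (κ / 8)) ^ 2 := by ring
        _ = 4 * P₁ := by rw [h2]
    have hA₀sq : (1 : ℝ) ≤ (A₀ : ℝ) ^ 2 := one_le_pow₀ hA₀r
    have hyκ2 : (2 : ℝ) ≤ (y : ℝ) ^ κ := by linarith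
    have hfloor : (y : ℝ) ^ κ / 2 ≤ ⌊(y : ℝ) ^ κ⌋₊ := by
      have h1 := Nat.lt_floor_add_one ((y : ℝ) ^ κ)
      linarith
    have hF0 : (0 : ℝ) < ⌊(y : ℝ) ^ κ⌋₊ := by linarith
    rw [div_le_iff₀ hF0]
    have h1024 : 1024 ≤ c₃ * P₁ := by
      have := hy10; rw [div_le_iff₀ hc₃0] at this; linarith
    have h1 : (1 + Real.log y) ^ 2 * P₂ ≤ 4 * P₁ * P₂ := mul_le_mul_of_nonneg_right hL2 hP₂0.le
    have h2 : P₁ * P₂ / 16 * 1024 ≤ P₁ * P₂ / 16 * (c₃ * P₁) :=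
      mul_le_mul_of_nonneg_left h1024 (by positivity)
    have hfloor2 : P₁ * P₂ * P₁ / 2 ≤ ⌊(y : ℝ) ^ κ⌋₊ := by rw [← hκP]; exact hfloor
    have hfloor' := mul_le_mul_of_nonneg_left hfloor2 (by positivity : (0 : ℝ) ≤ c₃ / 8)
    have hnn : 0 ≤ P₁ * P₂ := by positivity
    linarith [hfloor', h1, h2, hnn]
  -- (C)
  have hErrC : ((y : ℝ) ^ (2 * κ) + 1) * (y : ℝ) ^ δ *
      (2 * cMain χ Q / ⌊2 * (A₀ : ℝ) * y / (y : ℝ) ^ (2 * κ)⌋₊ +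
        4 * (kWin χ Q y * (⌊(y : ℝ) ^ δ⌋₊ : ℝ) ^ 3) /
          Real.sqrt ⌊2 * (A₀ : ℝ) * y / (y : ℝ) ^ (2 * κ)⌋₊) ≤
      (χ.LFunction 1).re * c₀ * κ / (24 * η) / 8 := by
    rw [← hc₃, ← h𝔠def]
    set Um : ℝ := (⌊2 * (A₀ : ℝ) * y / (y : ℝ) ^ (2 * κ)⌋₊ : ℝ) with hUmdef
    have hUm0 : 0 < Um := lt_of_lt_of_le (by linarith) hUm_ge
    -- `1/Um ≤ y^{2κ-1}`, `1/√Um ≤ y^{κ - 1/2}`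
    have hinv : 1 / Um ≤ (y : ℝ) ^ (2 * κ - 1) := by
      rw [div_le_iff₀ hUm0]
      have : (y : ℝ) ^ (2 * κ - 1) * (y : ℝ) ^ (1 - 2 * κ) = 1 := by
        rw [hmul]; rw [show 2 * κ - 1 + (1 - 2 * κ) = 0 by ring, Real.rpow_zero]
      calc (1 : ℝ) = (y : ℝ) ^ (2 * κ - 1) * (y : ℝ) ^ (1 - 2 * κ) := this.symm
        _ ≤ (y : ℝ) ^ (2 * κ - 1) * Um :=
            mul_le_mul_of_nonneg_left hUm_ge (Real.rpow_nonneg hyr0.le _)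
    have hsq : (y : ℝ) ^ ((1 - 2 * κ) / 2) ≤ Real.sqrt Um := by
      have h1 : Real.sqrt ((y : ℝ) ^ (1 - 2 * κ)) ≤ Real.sqrt Um := Real.sqrt_le_sqrt hUm_ge
      rwa [Real.sqrt_eq_rpow, ← Real.rpow_mul hyr0.le,
        show (1 - 2 * κ) * (1 / 2 : ℝ) = (1 - 2 * κ) / 2 by ring] at h1
    have hinvs : 1 / Real.sqrt Um ≤ (y : ℝ) ^ (κ - 1 / 2) := by
      have hs0 : 0 < (y : ℝ) ^ ((1 - 2 * κ) / 2) := by positivity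
      calc 1 / Real.sqrt Um ≤ 1 / (y : ℝ) ^ ((1 - 2 * κ) / 2) :=
            div_le_div_of_nonneg_left zero_le_one hs0 hsq
        _ = (y : ℝ) ^ (κ - 1 / 2) := by
            rw [one_div, ← Real.rpow_neg hyr0.le]; congr 1; ring
    have hkw : kWin χ Q y ≤ 2 * K₁ * (y : ℝ) ^ (κ / 8) := by
      have h1 := hkWin y (by omega)
      have h2 := mul_le_mul_of_nonneg_left hlog1 hK₁0
      linarith
    have hD3 : (⌊(y : ℝ) ^ δ⌋₊ : ℝ) ^ 3 ≤ (y : ℝ) ^ (3 * δ) := by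
      have h1 : (⌊(y : ℝ) ^ δ⌋₊ : ℝ) ≤ (y : ℝ) ^ δ := Nat.floor_le (by positivity)
      calc (⌊(y : ℝ) ^ δ⌋₊ : ℝ) ^ 3 ≤ ((y : ℝ) ^ δ) ^ 3 := pow_le_pow_left₀ (by positivity) h1 3
        _ = (y : ℝ) ^ (3 * δ) := by
            rw [← Real.rpow_natCast, ← Real.rpow_mul hyr0.le]; congr 1; push_cast; ring
    -- the bracket
    have hBnd : 2 * 𝔠 / Um + 4 * (kWin χ Q y * (⌊(y : ℝ) ^ δ⌋₊ : ℝ) ^ 3) / Real.sqrt Um ≤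
        2 * 𝔠 * (y : ℝ) ^ (2 * κ - 1) +
          8 * K₁ * ((y : ℝ) ^ (κ / 8) * (y : ℝ) ^ (3 * δ) * (y : ℝ) ^ (κ - 1 / 2)) := by
      have h1 : 2 * 𝔠 / Um ≤ 2 * 𝔠 * (y : ℝ) ^ (2 * κ - 1) := by
        rw [show 2 * 𝔠 / Um = 2 * 𝔠 * (1 / Um) by ring]
        exact mul_le_mul_of_nonneg_left hinv (by positivity)
      have hkw0 : 0 ≤ kWin χ Q y := kWin_nonneg χ Q (by omega)
      have h2 : 4 * (kWin χ Q y * (⌊(y : ℝ) ^ δ⌋₊ : ℝ) ^ 3) / Real.sqrt Um ≤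
          4 * ((2 * K₁ * (y : ℝ) ^ (κ / 8)) * (y : ℝ) ^ (3 * δ)) * (y : ℝ) ^ (κ - 1 / 2) := by
        rw [show 4 * (kWin χ Q y * (⌊(y : ℝ) ^ δ⌋₊ : ℝ) ^ 3) / Real.sqrt Um =
          4 * (kWin χ Q y * (⌊(y : ℝ) ^ δ⌋₊ : ℝ) ^ 3) * (1 / Real.sqrt Um) by ring]
        refine mul_le_mul ?_ hinvs (by positivity) (by positivity)
        refine mul_le_mul_of_nonneg_left ?_ (by norm_num)
        exact mul_le_mul hkw hD3 (by positivity) (by positivity)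
      linarith
    have hfac : ((y : ℝ) ^ (2 * κ) + 1) * (y : ℝ) ^ δ ≤ 2 * ((y : ℝ) ^ (2 * κ) * (y : ℝ) ^ δ) := by
      have h1 : 1 ≤ (y : ℝ) ^ (2 * κ) := Real.one_le_rpow hy1r (by linarith)
      have h2 : 1 * (y : ℝ) ^ δ ≤ (y : ℝ) ^ (2 * κ) * (y : ℝ) ^ δ :=
        mul_le_mul_of_nonneg_right h1 (Real.rpow_nonneg hyr0.le δ)
      linarith
    have hexp1 : (y : ℝ) ^ (2 * κ) * (y : ℝ) ^ δ * (y : ℝ) ^ (2 * κ - 1) ≤ (y : ℝ) ^ (-(1 / 4) : ℝ) := by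
      rw [hmul, hmul]; exact hrle (by rw [hδdef]; linarith)
    have hexp2 : (y : ℝ) ^ (2 * κ) * (y : ℝ) ^ δ *
        ((y : ℝ) ^ (κ / 8) * (y : ℝ) ^ (3 * δ) * (y : ℝ) ^ (κ - 1 / 2)) ≤ (y : ℝ) ^ (-(1 / 4) : ℝ) := by
      rw [hmul, hmul, hmul, hmul]; exact hrle (by rw [hδdef]; linarith)
    have hneg : (4 * 𝔠 + 16 * K₁) * (y : ℝ) ^ (-(1 / 4) : ℝ) ≤ c₃ / 8 := by
      have h1 : (y : ℝ) ^ (-(1 / 4) : ℝ) * (y : ℝ) ^ (1 / 4 : ℝ) = 1 := by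
        rw [hmul, show -(1 / 4 : ℝ) + 1 / 4 = 0 by ring, Real.rpow_zero]
      have h2 : (4 * 𝔠 + 16 * K₁) * 8 ≤ c₃ * (y : ℝ) ^ (1 / 4 : ℝ) := by
        have := hy11; rw [div_le_iff₀ hc₃0] at this; linarith
      have h3 : 0 ≤ (y : ℝ) ^ (-(1 / 4) : ℝ) := by positivity
      have h4 := mul_le_mul_of_nonneg_left h2 h3
      have h5 : (y : ℝ) ^ (-(1 / 4) : ℝ) * (c₃ * (y : ℝ) ^ (1 / 4 : ℝ)) = c₃ := by
        rw [mul_left_comm, h1, mul_one]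
      linarith
    calc ((y : ℝ) ^ (2 * κ) + 1) * (y : ℝ) ^ δ *
          (2 * 𝔠 / Um + 4 * (kWin χ Q y * (⌊(y : ℝ) ^ δ⌋₊ : ℝ) ^ 3) / Real.sqrt Um)
        ≤ 2 * ((y : ℝ) ^ (2 * κ) * (y : ℝ) ^ δ) * (2 * 𝔠 * (y : ℝ) ^ (2 * κ - 1) +
            8 * K₁ * ((y : ℝ) ^ (κ / 8) * (y : ℝ) ^ (3 * δ) * (y : ℝ) ^ (κ - 1 / 2))) :=
          mul_le_mul hfac hBnd
            (by have := kWin_nonneg χ Q (show 1 ≤ y by omega); positivity) (by positivity)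
      _ = 4 * 𝔠 * ((y : ℝ) ^ (2 * κ) * (y : ℝ) ^ δ * (y : ℝ) ^ (2 * κ - 1)) +
          16 * K₁ * ((y : ℝ) ^ (2 * κ) * (y : ℝ) ^ δ *
            ((y : ℝ) ^ (κ / 8) * (y : ℝ) ^ (3 * δ) * (y : ℝ) ^ (κ - 1 / 2))) := by ring
      _ ≤ 4 * 𝔠 * (y : ℝ) ^ (-(1 / 4) : ℝ) + 16 * K₁ * (y : ℝ) ^ (-(1 / 4) : ℝ) := by
          gcongr
      _ = (4 * 𝔠 + 16 * K₁) * (y : ℝ) ^ (-(1 / 4) : ℝ) := by ring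
      _ ≤ c₃ / 8 := hneg
  -- ## the core
  have key := dyadic_core ha hirr hχ hQsq hQ2 hQa hQΔ hQg hpow (hKd Q) hc₀
    (fun z hz hQz' => hFVall Q hQsq hQ2 hQa hQΔ z hz hQz') hCM hq b₀ hA₀ hPle hPpos hκ0
    (by linarith) hη0 hηδ (by rw [hδdef]; linarith) hFl hJ₁ (J₂ := J₂)
    (fun ℓ N₁ N₂ h1 h2 h3 h4 => hT y hy0 ℓ N₁ N₂ h1 h2 h3 h4) hy1 hy2 hQz hQκ hy6 hy7 hFJ₁
    hFJ₂ hUmin hErrA hErrB hErrC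
  rw [← hc₃] at key
  exact key

end Assembly

end PropertySTypeI

namespace PropertySTypeI

open Polynomial Finset Iwaniec1978 RhoLogSums ArithmeticFunction Filter
open scoped NumberTheorySymbols Classical

/-! ### E2-J. Property S, and the fact, from type-I information -/

section PropertyS

/-- **Property S for an irreducible quadratic from type-I information.**  If `P ∈ ℤ[X]` has
degree `2`, positive leading coefficient, is irreducible over `ℚ`, and satisfies the type-I
level-of-distribution hypothesis of `dyadic_lower_bound` with some exponents `θ, ε₀ > 0`, then
`P` has property S (`η₀ = c₁/4`, counting the window `(x/2, x]`).
[cite: Teravainen2024, Definition 2.9 and Proposition 2.11 (conditional form)] -/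
theorem hasPropertyS_of_typeI {P : ℤ[X]} (hdeg : P.natDegree = 2) (hlc : 0 < P.leadingCoeff)
    (hirr : Irreducible (P.map (Int.castRingHom ℚ))) {θ ε₀ : ℝ} (hθ : 0 < θ) (hε₀ : 0 < ε₀)
    (hTI : ∀ q b₀ Q : ℕ, 1 ≤ q → Q ≠ 0 → (∀ p : ℕ, p.Prime → p ∣ q → p ∣ Q) →
      (∀ p : ℕ, p.Prime → (p : ℤ) ∣ P.content → p ∣ Q) →
      (∀ p : ℕ, p.Prime → (p : ℤ) ∣ 2 * P.leadingCoeff *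
        (P.coeff 1 ^ 2 - 4 * P.coeff 2 * P.coeff 0) → p ∣ Q) →
      ∃ (K : ℝ) (y₀ : ℕ), ∀ y : ℕ, y₀ ≤ y → ∀ ℓ N₁ N₂ : ℕ, 1 ≤ ℓ → (ℓ : ℝ) ≤ (y : ℝ) ^ θ →
        N₁ ≤ N₂ → (N₂ : ℝ) ≤ (y : ℝ) ^ (1 + θ) →
        |∑ n ∈ (Finset.Ioc N₁ N₂).filter (fun n => ℓ ∣ n ∧ n.Coprime Q),
            ((((Finset.Ioc y (2 * y)).filter (fun t : ℕ => t % q = b₀ % q ∧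
                (n : ℤ) ∣ P.eval (t : ℤ))).card : ℝ) -
              (y : ℝ) / q * (polyRootCountMod ![P] n : ℝ) / n)| ≤ K * (y : ℝ) ^ (1 - ε₀)) :
    HasPropertyS P := by
  obtain ⟨a, b, c, g, ha, hg, hirr', hP⟩ := exists_primitive_data hdeg hlc hirr
  obtain ⟨c₁, hc₁, hdy⟩ := dyadic_lower_bound ha hg hirr' hP hθ hε₀ hTI
  refine ⟨c₁ / 4, by positivity, fun q b₀ hq _ η hη => ?_⟩
  obtain ⟨y₀, hy₀⟩ := hdy q b₀ hq
  refine ⟨2 * y₀ + 2, fun x hx => ?_⟩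
  have hyy₀ : y₀ ≤ x / 2 := by omega
  have h := hy₀ (x / 2) hyy₀
  have hq0 : (0 : ℝ) < q := by exact_mod_cast hq
  have hsub : (Finset.Ioc (x / 2) (2 * (x / 2))).filter (fun t : ℕ => t % q = b₀ % q ∧
      ∀ p : ℕ, p.Prime → (p : ℤ) ∣ P.eval (t : ℤ) → p ≤ t) ⊆
      (Finset.Icc 1 x).filter (fun n : ℕ => n % q = b₀ % q ∧
        ∀ p : ℕ, p.Prime → (p : ℤ) ∣ P.eval (n : ℤ) → p ≤ n) := by
    refine Finset.filter_subset_filter _ fun t ht => ?_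
    rw [Finset.mem_Ioc] at ht
    rw [Finset.mem_Icc]
    omega
  have hcard := Finset.card_le_card hsub
  have hx2 : (2 : ℝ) ≤ x := by exact_mod_cast (show 2 ≤ x by omega)
  have hyx : ((x : ℝ) - 1) / 2 ≤ ((x / 2 : ℕ) : ℝ) := by
    have : x ≤ 2 * (x / 2) + 1 := by omega
    have : (x : ℝ) ≤ 2 * ((x / 2 : ℕ) : ℝ) + 1 := by exact_mod_cast this
    linarith
  have h1 : c₁ / 4 / q * x ≤ c₁ * ((((x : ℝ) - 1) / 2) / q) := by
    rw [show c₁ / 4 / q * x = (c₁ * x / 4) / q by ring,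
      show c₁ * ((((x : ℝ) - 1) / 2) / q) = (c₁ * (x - 1) / 2) / q by ring]
    refine div_le_div_of_nonneg_right ?_ hq0.le
    nlinarith [mul_nonneg hc₁.le (sub_nonneg.mpr hx2)]
  have h2 : c₁ * ((((x : ℝ) - 1) / 2) / q) ≤ c₁ * (((x / 2 : ℕ) : ℝ) / q) :=
    mul_le_mul_of_nonneg_left (div_le_div_of_nonneg_right hyx hq0.le) hc₁.le
  calc η * (x : ℝ) ≤ c₁ / 4 / q * x := mul_le_mul_of_nonneg_right hη.le (Nat.cast_nonneg x)
    _ ≤ c₁ * (((x / 2 : ℕ) : ℝ) / q) := h1.trans h2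
    _ ≤ _ := h
    _ ≤ _ := by exact_mod_cast hcard

/-- **Teräväinen 2024, Proposition 2.11 (quadratic clause), from type-I information.**  If every
degree-`2` `P ∈ ℤ[X]` with positive leading coefficient which is irreducible over `ℚ` satisfies
the type-I level-of-distribution hypothesis of `dyadic_lower_bound` (level `y^{1+θ}` for the
congruence counts `#{y < t ≤ 2y : t ≡ b₀ (q), n ∣ P(t)}` at level-`ℓ` moduli `n ≡ 0 (ℓ)`,
`ℓ ≤ y^θ`, prime to any modulus `Q` containing the primes of `q`, of `cont P` and of
`2 · lc P · disc P`, with saving `y^{−ε₀}`), then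
`teravainen2024_prop_2_11_quadratic` holds: the reducible case is
`teravainen2024_prop_2_11_quadratic_of_irreducible` (PROVED in the tree), the irreducible case is
`hasPropertyS_of_typeI`.  This replaces the bilinear (Iwaniec Proposition 1 / Lemke Oliver
Lemma 8) hypothesis of `teravainen2024_prop_2_11_quadratic_of_level` by plain type-I sums over the
smooth variable, which is what Hooley's method (equidistribution of the roots of `P` to moduli in
a fixed residue class, DFI §2 level forms) delivers.
[cite: Teravainen2024, Proposition 2.11 and §7 (the statement); conditional reduction] -/
theorem teravainen2024_prop_2_11_quadratic_of_typeI {θ ε₀ : ℝ} (hθ : 0 < θ) (hε₀ : 0 < ε₀)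
    (hTI : ∀ P : ℤ[X], P.natDegree = 2 → 0 < P.leadingCoeff →
      Irreducible (P.map (Int.castRingHom ℚ)) →
      ∀ q b₀ Q : ℕ, 1 ≤ q → Q ≠ 0 → (∀ p : ℕ, p.Prime → p ∣ q → p ∣ Q) →
      (∀ p : ℕ, p.Prime → (p : ℤ) ∣ P.content → p ∣ Q) →
      (∀ p : ℕ, p.Prime → (p : ℤ) ∣ 2 * P.leadingCoeff *
        (P.coeff 1 ^ 2 - 4 * P.coeff 2 * P.coeff 0) → p ∣ Q) →
      ∃ (K : ℝ) (y₀ : ℕ), ∀ y : ℕ, y₀ ≤ y → ∀ ℓ N₁ N₂ : ℕ, 1 ≤ ℓ → (ℓ : ℝ) ≤ (y : ℝ) ^ θ →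
        N₁ ≤ N₂ → (N₂ : ℝ) ≤ (y : ℝ) ^ (1 + θ) →
        |∑ n ∈ (Finset.Ioc N₁ N₂).filter (fun n => ℓ ∣ n ∧ n.Coprime Q),
            ((((Finset.Ioc y (2 * y)).filter (fun t : ℕ => t % q = b₀ % q ∧
                (n : ℤ) ∣ P.eval (t : ℤ))).card : ℝ) -
              (y : ℝ) / q * (polyRootCountMod ![P] n : ℝ) / n)| ≤ K * (y : ℝ) ^ (1 - ε₀)) :
    teravainen2024_prop_2_11_quadratic :=
  teravainen2024_prop_2_11_quadratic_of_irreducible fun P hdeg hlc hirr =>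
    hasPropertyS_of_typeI hdeg hlc hirr hθ hε₀ (hTI P hdeg hlc hirr)

end PropertyS

end PropertySTypeI

end Literature.NumberTheory.Sieve

end
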